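import Summits.BirchSwinnertonDyer.BirchSwinnertonDyer.Theorems.ErratumRoadFiveEulerHalfNotRamInertUpToOne
import Summits.BirchSwinnertonDyer.BirchSwinnertonDyer.Theorems.ErratumRoadFiveEulerHalfNotRamInert
import Summits.BirchSwinnertonDyer.Rank1Residual.X11b.BDPRouteTamagawaSupport
import Summits.BirchSwinnertonDyer.BirchSwinnertonDyer.Theses.ErratumRoadFive
import Literature.NumberTheory.EllipticCurves.SemistablePeuRamifieRamifiedPrime
import Literature.NumberTheory.DiophantineGeometry.DenesEquationSerreRoadProofs
import Literature.NumberTheory.EllipticCurves.RootNumberProofs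
import Literature.NumberTheory.DiophantineGeometry.PastenValuationProductsProofs
import Literature.NumberTheory.EllipticCurves.QuadraticTwistLocalDataAtTwoHoldsProofs
import Literature.NumberTheory.EllipticCurves.CuspFormTwist
import Literature.NumberTheory.QuadraticFields.JacobiCharacterPrimitiveProofs
import Literature.NumberTheory.EllipticCurves.QuadraticTwistNegOneLFunctionProofs
import Literature.NumberTheory.EllipticCurves.ModularSymbolsRationalMinusPeriodsProofs
import Literature.NumberTheory.DiophantineGeometry.DenesEquationWeightTwoLevelsProofs
import Literature.NumberTheory.EllipticCurves.ModPIrreducibleNotEisensteinProofs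
import Literature.NumberTheory.Automorphic.CDTTheorem722SerreProofs
import Literature.NumberTheory.GaloisRepresentations.ChebotarevArtinRep
import Literature.NumberTheory.EllipticCurves.TorsionGaloisRepMatrixProofs
import Literature.NumberTheory.EllipticCurves.Rank1Residual.Predicates
import Literature.NumberTheory.EllipticCurves.DeligneSerreWeightOneIrreducibleKroneckerWeberProofs
import HarnessLib

/-!
# Crux `EulerHalfNotRamNoInertSetAtFive` (stmt-BirchSwinnertonDyer-19715) — line sketch «level-lowering cut» v5 (bsd-idea-9 g4; v4 commit 389d40b5dd11 by g3, idea 3; v1 commit 14ebb030554f; v2 commit 5b6882c90288 = + §4c–§4e, the prime-power rung PROVED at (2,4), (3,2); v3 commit c0876d2c28dc = + the (5,2) instance `N_add ∣ 25`; v4 = + §6 the CM-LEVEL CUT at Serre levels 27, 32, 49 — the first use of `Surj`; v5 = HOLE 2 PROVED: `surjInertTraceWitnessAtFive_holds` (§6 `section HoleTwo`: coset lemma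
`exists_trace_mul_sq_ne_zero` in `GL₂(𝔽_p)`, `p ≥ 5` + the tree's `chebotarev_geomTorsion` on `ℚ(E[mp])` + `a_q ≡ tr ρ̄(Frob_q)`), so every
`hCheb` binder of v4 is GONE — the CM-level cut at 27 ∕ 32 is now conditional ONLY on the route's printed inputs (`exists_isNewformOf` from
`PublishedInputsFive`, `diamond1995_refinedSerre`, Ogg–Saito), and at 49 additionally on the named dimension fact `finrank_cuspForm_two_eq_genusX0 49`.
STATUS AFTER critic V29 (p-anchor, `Lines/coker_units_surj.lean` v4): the level-lowering cut is an ALTERNATIVE mechanism for the residual —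
the p-anchor derives v10's residual stub from the route items + F(2) + LAB with no cut; this file's reach beyond the record is 0 census pairs
(its 13 CM-locus pairs on {27, 32, 49} are all road-reached: 404 = 69 road + 334 S1b + 1 S2b′ + 0) and, class-wide, the loci N_add ∈
{1, 4, 8, 16, 9, 25, 27, 32, 49} (64 = dim 3 and 36 = two additive primes are OUT of the typed lever; see the card).)

HONEST FRAMING: nothing here proves BSD or closes item 19715; no summit statement is proved by this seat. This is a CRUX WORKFILE
(`Lines/level_lowering_cut.lean`), self-contained (§0–§2 are copied VERBATIM from `Lines/coker_units_surj.lean` v3 commit 50b42e1e0b18,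
because crux workfiles are not importable on the farm), `sorry`-free.

THE LEVER (Ribet 1990 ∕ Diamond 1995 level lowering to level ONE, already a tree theorem for semistable curves:
`Literature.NumberTheory.EllipticCurves.ram_of_semistable_of_irr_of_mult_of_dvd`, `…_of_le_seven`). On the locus of 19715 — `p ≥ 5`
multiplicative, `E[p]` irreducible, NO (ram) prime (so EVERY multiplicative `ℓ ≠ p` is a `p`-carrier: `E[p]` unramified at `ℓ`) — the
SELF-CARRIER condition `p ∣ ord_p(Δ_min)` makes `E[p]` finite (peu ramifié) at `p`, hence `k(ρ̄) = 2` and `N(ρ̄) ∣ N_add(E)` (the additive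
part of the conductor). For a SEMISTABLE curve `N_add = 1`: `S₂(SL₂(ℤ)) = 0` — contradiction. Hence on semistable curves the crux's
locus carries the (W)-witness `p ∤ ord_p(Δ_min)` AT `p` FOR FREE, and then (§2, the exhaustion lemma, PROVED) the pair has an (A) datum or a
(B♯) datum; 19715 negates (A), and the (B♯) road (§1, PROVED modulo HOLE 1 = the saved display, + print) closes the pair. Moreover at
`p ∈ {5, 7}` a semistable pair always HAS a (ram) prime (`ram_of_semistable_of_irr_of_le_seven`), so 19715 is vacuous there.

§3 (NEW, PROVED): `res_semistableAtFive_of_levelLowering` — the statement of 19715 with ONE extra binder `Semistable W`, from the route's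
printed inputs (conjuncts of `PublishedInputsFive`), the items `X11aLowerHalf`, `ShimuraParametrizationDataNonempty`, the ORIGINAL Pasten
component-orders item `PastenComponentOrdersInput` (NOT the K1♭-modified package of the coker-units line), Barrios (tree theorem `_holds`),
the saved-display ∀-stub of the line of record (HOLE 1, v9 `stub_shimuraInertSavedDisplayAtFive` VERBATIM) and ONE additional PRINTED named
fact BY NAME: `Literature.NumberTheory.Automorphic.diamond1995_refinedSerre` (Ribet 1990 Thm 1.1 + Diamond 1995 Thm 1.1; already a by-name
input of other BSD Theorems files, e.g. `KimAtThreeDeepLowerOffStratumLevelLoweringRekey.lean`). NO K1♭, NO residual stub, NO Jetchev-at-p.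
What it buys the line of record (v9): the residual stub `stub_res_otherMultThreeBadOffendingAtFive` and the S1b port are BOTH restricted to
NON-semistable curves (on a semistable curve S1b ∩ {p ∣ ∏ c_ℓ} is EMPTY: §3c); the lead's census agrees (0 of the 404 residual pairs of
`census/residual_v2.tsv` are semistable; their additive conductors are 27, 32, 49, 121, 216, 243, 289, 784, 1323, 1521, …).

§5 (PROVED + TYPED): v9's residual stub `stub_res_otherMultThreeBadOffendingAtFive` (S2c″) VERBATIM with the extra hypothesis `Semistable W` is a
THEOREM (`res_threeBadOffending_semistable_of_items`); the honest remaining residual is its NON-semistable part (`ResThreeBadOffendingNonSemistableAtFive`,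
`def`), and S2c″ ⟸ that part (`res_threeBadOffending_of_nonSemistable_of_items`) — a v10 graft OPTION for the lead (price: ONE printed by-name input `hLL`).

§4 (v2: PROVED): `SelfCarrierFreeOnTwoPowerAdditiveAtFive` — the same exclusion of the self-carrier when every ODD bad prime is
multiplicative and `2⁵ ∤ N_E` (additive conductor a power of 2 dividing 16) — is now a THEOREM (`selfCarrierFreeOnTwoPowerAdditiveAtFive_of`,
§4c) from three PRINTED named facts by name: modularity `exists_isNewformOf` (a conjunct of `PublishedInputsFive`), `diamond1995_refinedSerre`,
and the exponentwise Ogg–Saito identity `WeierstrassCurve.artinConductorExponent_tate_eq_conductorExponent_of_isElliptic` (Serre–Tate 1968 §3 ∕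
Ogg 1967 ∕ Saito 1988; named fact, used here only to get `N(ρ̄) ∣ N_E` via `serreLevel_baseChange_dvd_conductorNorm_of_tate`). Proof = the tree's
`ram_of_semistable_of_irr_of_mult_of_dvd` Steps 1–4 verbatim, then `N(ρ̄ ⊗ 𝔽̄_p) ∣ 16` (odd `q`: good ⟹ unramified, multiplicative ⟹ carrier ⟹ Tate,
`p` never; `2`: Ogg–Saito + `2⁵ ∤ N_E`), Diamond ⟹ newform on `Γ₁(M)`, `M ∣ 16`, weight 2; `p ∤ φ(M)` ⟹ trivial nebentypus
(`nebentypus_eq_one_of_isGaloisRepOfNewform1Int_of_not_dvd_totient`) ⟹ descent to `Γ₀(M)` (`exists_isNewform0_coe_eq_of_nebentypus_eq_one`) ⟹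
`S₂(Γ₀(M)) = 0` (`cuspForm_two_gamma0_eq_zero_of_dvd_sixteen`) — the end-game of the Dénes Serre road. The proof is written ONCE for a prime-power additive
conductor (`not_dvd_ordp_of_primePowerAdditive_of_not_ram`, parameters `r`, `k`, a totient side condition and a vanishing oracle for the levels
`M ∣ r^k`) and instantiated at `(r, k) = (2, 4)`, `(3, 2)` (`SelfCarrierFreeOnThreeSquareAdditiveAtFive`: every bad prime `≠ 3` multiplicative,
`3³ ∤ N_E`; `S₂(Γ₀(M)) = 0` for `M ≤ 10`, `cuspForm_two_gamma0_eq_zero_of_le_ten`; this locus CONTAINS the semistable curves) and (v3) `(5, 2)`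
(`SelfCarrierFreeOnFiveSquareAdditiveAtFive`: `N_add ∣ 25`, `p ≥ 7` via the new vanishing lemma `cuspForm_two_gamma0_eq_zero_of_dvd_twentyFive` =
`finrank_cuspForm_two_eq_genusX0_of_mem` + `gamma0_data_25`; `p = 5` is the semistable case) — i.e. at EVERY prime-power level of genus 0 in the tree. §4d/§4d′: 19715 + the two extra hypotheses over
the ROUTE ITEMS (+ `hLL`, `hOS`, HOLE 1), PROVED; §4e: v9's residual stub S2c″ on that locus PROVED, the honest remaining residual RE-TYPED as
`ResThreeBadOffendingOddAdditiveOrDeepTwoAtFive` (S2c″ + «some odd additive prime, or `2⁵ ∣ N_E`») and finally `ResThreeBadOffendingAfterCutsAtFive`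
(S2c″ off both loci: an additive prime `∉ {2,3}`, or two additive primes, or `2⁵ ∣ N_E`, or `3³ ∣ N_E`), and S2c″ ⟸ each. The honest RESIDUAL of the
lever in general: non-semistable curves whose `N(ρ̄)` (a divisor of `N_add`) carries weight-2 newforms congruent to `f_E` mod `p` — there level
lowering gives no contradiction and the coker-units line (K1♭) or the residual stub is needed.

§6 (v4, NEW — PROVED modulo ONE new typed hypothesis, HOLE 2): THE CM-LEVEL CUT. At the positive-genus prime-power levels `27 = 3³`, `32 = 2⁵`,
`49 = 7²` the space `S₂(Γ₀(M))` is a LINE (Sturm `finrank_cuspForm_two_gamma0_le` + `gamma0_data_27`; the tree theorem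
`finrank_cuspForm_two_gamma0_thirtyTwo`; the dimension formula `finrank_cuspForm_two_eq_genusX0 49` by name + `gamma0_data_49`), so its newform `g`
equals its own quadratic twist `g ⊗ χ` by the primitive quadratic character `χ` of conductor `m`, `m² ∣ M` (`χ = (·∕3)`, `χ₄`, `(·∕7)`; tree: `charTwist`,
`cuspCoeff_charTwist` — Shimura Prop. 3.64, PROVED in the tree), whence `a_q(g) = 0` whenever `χ(q) = −1` (`cuspCoeff_eq_zero_of_isNewform0_of_finrank_le_one`,
PROVED — the CM phenomenon with no CM theory). Level lowering (§4 Steps 1–6′) puts `ρ̄_{E,p}` on such a `g` when `N_add = M` exactly (proper divisors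
`M' ∣ 9, 16, 7` carry no forms), and the Eichler–Shimura∕Carayol trace identity (tree: `exists_coeff_eq_lFunction_of_isGaloisRepOfNewform1Int`) gives
`a_q(E) ≡ a_q(g) = 0 (mod p)` at every good `q ∤ M p` with `χ(q) = −1` — contradicting HOLE 2 = `SurjInertTraceWitnessAtFive` (typed `def`, PRINTED:
Chebotarev in `ℚ(E[mp])∕ℚ` for a SURJECTIVE `ρ̄_{E,p}`, `p ≥ 5`: a Frobenius with `χ(q) = −1` and `a_q(E) ≢ 0 (mod p)`; proof sketch in its docstring;
the tree holds Chebotarev for torsion fields as the named fact `chebotarev_geomTorsion`). This is the FIRST place the line USES the hypothesis `Surj W p`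
of 19715. Instances PROVED: `not_dvd_ordp_of_twentySevenAdditive_of_not_ram` (every prime `≠ 3` semistable, `3⁴ ∤ N_E`),
`not_dvd_ordp_of_thirtyTwoAdditive_of_not_ram` (every odd prime semistable, `2⁶ ∤ N_E`), `not_dvd_ordp_of_fortyNineAdditive_of_not_ram` (every prime
`≠ 7` semistable, `7³ ∤ N_E`, `p ≠ 7`; `p = 7` is semistable, §3); §6d: 19715 on each locus over the ROUTE ITEMS (+ `hLL`, `hOS`, [`hDS49`], HOLE 1; v5: `hCheb` PROVED and removed)
PROVED via ONE generic lemma `res_of_selfCarrierFreeOfSurjOn_of_items`; §6e: the honest residual RE-TYPED `ResThreeBadOffendingAfterCMCutsAtFive` (S2c″ off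
the four loci `N_add ∣ 32`, `N_add ∣ 27`, `N_add ∣ 25`, `N_add ∣ 49`) and S2c″ ⟸ it (`res_threeBadOffending_of_afterCMCuts_of_items`). CENSUS: of the 404
`¬(ram)` pairs of the lead's `census/residual_v2.tsv`, 13 lie on the new loci (N_add = 27: 17955m1 (p=7), 19170s1; 32: 14560d1, 172960h1, 220640j1;
49: 8085y1, 16905bb1, 138670o1, 30135be1, 35770bg1, 369215i1, 44835bd1, 67130bc1; all p = 5 unless marked) versus 0 on the genus-0 loci of v3 — for
these the self-carrier is excluded by §6 ALONE (no Jetchev split-set datum needed). Levels `36` (0 pairs), `64` (dim 3: 2 pairs) and the non-CM levels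
`121, 243, …` are NOT cut: there level lowering meets genuine congruences (Transfer half only).

References: [Ribet1990] Invent. Math. 100, Thm 1.1; [Diamond1995RefinedSerre] Invent. Math. 121, Thm 1.1; [Serre1987] Duke 54, §2.8 Prop 4,
§4.1 (4.1.12); [corpus:book:cornell1997-modular-forms-fermats-last-theorem p0068 (Stevens §2: `E[p]` unramified at `ℓ ≠ p` ⟺ `p ∣ ord_ℓ Δ`,
flat at `p` ⟺ `p ∣ ord_p Δ`), p0070 (4.5) Ribet's theorem]; [cite: PastenShimura2024, §6.6] [cite: Jetchev2008, Cor. 1.5]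
[cite: SilvermanATAEC1994, Cor. IV.9.2(d)] (Tamagawa numbers at multiplicative primes); §6: [cite: Shimura1971, Prop. 3.64] (twists),
[cite: DiamondShurman2005, Thm. 3.5.1, Fig. 3.3] (dimensions at 27, 32, 49), [cite: Serre1972, Thm. 2 and §5] + [cite: TateGCFT1967, §2.4] (Chebotarev; HOLE 2),
[cite: DeligneSerre1974, §6] ∕ [cite: Carayol1986] (`a_q(E) ≡ a_q(g)`, tree `exists_coeff_eq_lFunction_of_isGaloisRepOfNewform1Int`).
-/

noncomputable section

open scoped Classical

open WeierstrassCurve Literature.NumberTheory.EllipticCurves Literature.NumberTheory.EllipticCurves.BarriosEtAl2025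
  Literature.NumberTheory.EllipticCurves.ModularForms Literature.NumberTheory.EllipticCurves.Rank1Residual
  Literature.NumberTheory.EllipticCurves.Rank1Residual.Typed Literature.NumberTheory.Automorphic
  Summit.BirchSwinnertonDyer.Rank1Residual Summit.BirchSwinnertonDyer.Rank1Residual.X11b


namespace Summit.BirchSwinnertonDyer.BirchSwinnertonDyer.Cruxes.EulerHalfNotRamNoInertSetAtFive.LevelLoweringCut

set_option linter.dupNamespace false

/-! ### §0 The data (verbatim shapes; `def`s, nothing asserted) -/

/-- (A) the INERT-SET datum with `p ∈ S` — VERBATIM the clause negated by `hnoP` in v6's S2b/S2c. -/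
def InertSetDatum (W : WeierstrassCurve ℚ) [W.IsElliptic] [W.IsGloballyMinimal] (p : ℕ) [Fact p.Prime] : Prop :=
  ∃ S : Finset ℕ, (∀ ℓ ∈ S, ∃ _ : Fact ℓ.Prime, Mult W ℓ) ∧ Even S.card ∧ p ∈ S ∧
    (∀ (ℓ : ℕ) [Fact ℓ.Prime], ℓ ∉ S → W.HasSplitMultiplicativeReductionAtPrime ℓ → ¬ p ∣ padicValInt ℓ W.minimalDiscriminantInt) ∧
    (¬ p ∣ padicValInt p W.minimalDiscriminantInt ∨ ∃ R ⊆ S, S.card = 2 * R.card ∧ ∀ q ∈ R, q ≠ 2 ∧ ¬ p ∣ q - 1)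

/-- (B) the UP-TO-ONE datum — VERBATIM the clause negated by `hup` in v6's S2c (degree datum = PR half only). -/
def UpToOneDatum (W : WeierstrassCurve ℚ) [W.IsElliptic] [W.IsGloballyMinimal] (p : ℕ) [Fact p.Prime] : Prop :=
  ∃ (q₁ : ℕ) (_ : Fact q₁.Prime) (S : Finset ℕ), W.HasSplitMultiplicativeReductionAtPrime q₁ ∧
    p ∣ padicValInt q₁ W.minimalDiscriminantInt ∧
    (∀ ℓ ∈ S, ∃ _ : Fact ℓ.Prime, Mult W ℓ) ∧ Even S.card ∧ p ∈ S ∧ q₁ ∉ S ∧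
    (∀ (ℓ : ℕ) [Fact ℓ.Prime], ℓ ∉ S → ℓ ≠ q₁ → W.HasSplitMultiplicativeReductionAtPrime ℓ →
      ¬ p ∣ padicValInt ℓ W.minimalDiscriminantInt) ∧
    ∃ R ⊆ S, S.card = 2 * R.card ∧ ∀ q ∈ R, q ≠ 2 ∧ ¬ p ∣ q - 1

/-- (B♯) the SHARP up-to-one datum: (B) with the degree datum widened to the core's full «(W) witness ∨ (P) PR half»
(VERBATIM the `hdegDatum` binder of `Theorems.missingUpperBoundAt_of_classX11b_of_inertSet_of_extraPlace_odd_of_twinLowerD`). -/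
def UpToOneSharpDatum (W : WeierstrassCurve ℚ) [W.IsElliptic] [W.IsGloballyMinimal] (p : ℕ) [Fact p.Prime] : Prop :=
  ∃ (q₁ : ℕ) (_ : Fact q₁.Prime) (S : Finset ℕ), W.HasSplitMultiplicativeReductionAtPrime q₁ ∧
    p ∣ padicValInt q₁ W.minimalDiscriminantInt ∧
    (∀ ℓ ∈ S, ∃ _ : Fact ℓ.Prime, Mult W ℓ) ∧ Even S.card ∧ p ∈ S ∧ q₁ ∉ S ∧
    (∀ (ℓ : ℕ) [Fact ℓ.Prime], ℓ ∉ S → ℓ ≠ q₁ → W.HasSplitMultiplicativeReductionAtPrime ℓ →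
      ¬ p ∣ padicValInt ℓ W.minimalDiscriminantInt) ∧
    ((∃ (ℓ₁ : ℕ) (_ : Fact ℓ₁.Prime), Mult W ℓ₁ ∧ ¬ p ∣ padicValInt ℓ₁ W.minimalDiscriminantInt ∧
        (ℓ₁ ∈ S ∨ ∃ (t : ℕ) (_ : Fact t.Prime), Mult W t ∧ t ∉ S ∧ t ≠ ℓ₁)) ∨
      ∃ R ⊆ S, S.card = 2 * R.card ∧ ∀ q ∈ R, q ≠ 2 ∧ ¬ p ∣ q - 1)

/-- (B) ⟹ (B♯) (the PR half is the second disjunct). -/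
theorem upToOneSharpDatum_of_upToOneDatum (W : WeierstrassCurve ℚ) [W.IsElliptic] [W.IsGloballyMinimal]
    (p : ℕ) [Fact p.Prime] (h : UpToOneDatum W p) : UpToOneSharpDatum W p := by
  obtain ⟨q₁, _, S, hq₁, hoff, hSmult, hSeven, hpS, hq₁S, hFC, hdeg⟩ := h
  exact ⟨q₁, ‹_›, S, hq₁, hoff, hSmult, hSeven, hpS, hq₁S, hFC, Or.inr hdeg⟩

/-! ### §1 GAIN 1 (free widening, PROVED): the (B♯) road -/

/-- **Pair level, (B♯):** p616118's `missingUpperBoundAt_of_classX11b_of_not_ram_of_upToOne_of_savedDisplayD` with the degree datum widened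
to (W) ∨ (P) — the core took it all along. Same binders; CONDITIONAL on `hSavD` (typed object), `hX11a` (open crux) and the printed inputs.
[cite: Jetchev2008, Cor. 1.5] [cite: PastenShimura2024, §6.6, L6.18] -/
theorem missingUpperBoundAt_of_classX11b_of_not_ram_of_upToOneSharp_of_savedDisplayD
    (hGZK : rank_eq_analyticRank_of_analyticRank_le_one) (hmod : hasEntireLFunction_rat)
    (hnf : exists_isNewformOf) (hFH : friedbergHoffstein_exists_twist_ne_zero_inertAt)
    (hMaz : mazur_not_dvd_maninConstant_of_odd)
    (hBR : localTamagawaNumber_quadraticTwist_two_mem_of_goodReduction)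
    (hJL : nonempty_shimuraParametrizationData)
    (hCO : PastenShimura2024_componentOrders)
    (W : WeierstrassCurve ℚ) [W.IsElliptic] [W.IsGloballyMinimal] (p : ℕ) [Fact p.Prime]
    (hX : ClassX11b W p) (hp5 : 5 ≤ p) (hnram : ¬ Ram W p)
    (hX11a : ∀ (Wd : WeierstrassCurve ℚ) [Wd.IsElliptic] [Wd.IsGloballyMinimal],
      ClassX11a Wd p → Typed.MissingLowerBoundAt Wd p)
    (q₁ : ℕ) [Fact q₁.Prime] (hq₁ : W.HasSplitMultiplicativeReductionAtPrime q₁)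
    (hSavD : Theorems.ShimuraInertSavedDisplayAtD W p q₁)
    (hdat : ∃ S : Finset ℕ, (∀ ℓ ∈ S, ∃ _ : Fact ℓ.Prime, Mult W ℓ) ∧ Even S.card ∧ p ∈ S ∧ q₁ ∉ S ∧
      (∀ (ℓ : ℕ) [Fact ℓ.Prime], ℓ ∉ S → ℓ ≠ q₁ → W.HasSplitMultiplicativeReductionAtPrime ℓ →
        ¬ p ∣ padicValInt ℓ W.minimalDiscriminantInt) ∧
      ((∃ (ℓ₁ : ℕ) (_ : Fact ℓ₁.Prime), Mult W ℓ₁ ∧ ¬ p ∣ padicValInt ℓ₁ W.minimalDiscriminantInt ∧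
          (ℓ₁ ∈ S ∨ ∃ (t : ℕ) (_ : Fact t.Prime), Mult W t ∧ t ∉ S ∧ t ≠ ℓ₁)) ∨
        ∃ R ⊆ S, S.card = 2 * R.card ∧ ∀ q ∈ R, q ≠ 2 ∧ ¬ p ∣ q - 1)) :
    Typed.MissingUpperBoundAt W p := by
  obtain ⟨S, hSmult, hSeven, hpS, hq₁S, hFC, hdeg⟩ := hdat
  have hbad₁ : ¬ W.HasGoodReductionAtPrime q₁ :=
    WeierstrassCurve.HasMultiplicativeReduction.not_hasGoodReduction (R := ℤ_[q₁]) hq₁.hasMultiplicativeReductionAtPrime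
  have hshape : ∀ (q : ℕ) [Fact q.Prime], q ≠ q₁ → p ∣ (W.baseChange ℚ_[q]).localTamagawaNumber ℤ_[q] →
      W.HasSplitMultiplicativeReductionAtPrime q := by
    intro q _ _ hdvd
    haveI : (W.baseChange ℚ_[q]).IsElliptic := inferInstanceAs (W.map (algebraMap ℚ ℚ_[q])).IsElliptic
    exact hasSplitMultiplicativeReduction_of_five_le_of_dvd_localTamagawaNumber q (W.baseChange ℚ_[q]) hp5 hdvd
  exact Theorems.missingUpperBoundAt_of_classX11b_of_inertSet_of_extraPlace_odd_of_twinLowerD hGZK hmod hnf hMaz hBR hJL hCO W p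
    hX q₁ hbad₁ hshape hSavD (Theorems.fhTwinLowerSupplyAt_of_friedbergHoffstein_of_x11aLowerHalf hGZK hmod hnf hFH W p hX hnram hX11a)
    S hSmult hSeven hpS hq₁S (fun ℓ _ hℓS hℓq hs ↦ hFC ℓ hℓS hℓq hs) hdeg

/-- **Class level, (B♯):** the S2b′-shaped up-to-one road for every pair with the SHARP datum, saved display as v6's ∀-form typed stub.
[cite: Jetchev2008, Cor. 1.5] [cite: PastenShimura2024, §6.6] -/
theorem res_upToOneSharpAtFive_of_savedDisplayD_of_lowerX11a
    (hGZK : rank_eq_analyticRank_of_analyticRank_le_one) (hmod : hasEntireLFunction_rat)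
    (hnf : exists_isNewformOf) (hFH : friedbergHoffstein_exists_twist_ne_zero_inertAt)
    (hMaz : mazur_not_dvd_maninConstant_of_odd)
    (hBR : localTamagawaNumber_quadraticTwist_two_mem_of_goodReduction)
    (hJL : nonempty_shimuraParametrizationData)
    (hCO : PastenShimura2024_componentOrders)
    (hX11a : ∀ (Wd : WeierstrassCurve ℚ) [Wd.IsElliptic] [Wd.IsGloballyMinimal] (p : ℕ) [Fact p.Prime],
      ClassX11a Wd p → Typed.MissingLowerBoundAt Wd p)
    (hSavD : ∀ (W : WeierstrassCurve ℚ) [W.IsElliptic] [W.IsGloballyMinimal] (p : ℕ) [Fact p.Prime]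
      (q₁ : ℕ) [Fact q₁.Prime], ClassX11b W p → 5 ≤ p → Surj W p → ¬ Ram W p →
      W.HasSplitMultiplicativeReductionAtPrime q₁ → p ∣ padicValInt q₁ W.minimalDiscriminantInt →
      Theorems.ShimuraInertSavedDisplayAtD W p q₁) :
    ∀ (W : WeierstrassCurve ℚ) [W.IsElliptic] [W.IsGloballyMinimal] (p : ℕ) [Fact p.Prime],
      ClassX11b W p → 5 ≤ p → Surj W p → ¬ Ram W p → UpToOneSharpDatum W p →
      Typed.MissingUpperBoundAt W p := by
  intro W _ _ p _ hX hp5 hsurj hnram hdat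
  obtain ⟨q₁, _, S, hq₁, hoff, hSmult, hSeven, hpS, hq₁S, hFC, hdeg⟩ := hdat
  exact missingUpperBoundAt_of_classX11b_of_not_ram_of_upToOneSharp_of_savedDisplayD hGZK hmod hnf hFH hMaz hBR hJL hCO W p hX hp5
    hnram (fun Wd _ _ hXa ↦ hX11a Wd p hXa) q₁ hq₁ (hSavD W p q₁ hX hp5 hsurj hnram hq₁ hoff)
    ⟨S, hSmult, hSeven, hpS, hq₁S, hFC, hdeg⟩

/-! ### §2 The exhaustion lemma (PROVED): outside (A) ∪ (B♯) every multiplicative prime is a `p`-carrier -/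

/-- **Exhaustion.** `p ≥ 5` multiplicative, some multiplicative `ℓ ≠ p`, no inert-set datum (A), no sharp up-to-one datum (B♯) ⟹ every
multiplicative prime `ℓ₁` of `W` has `p ∣ ord_{ℓ₁}(Δ_min)`. Proof (O = the offending split carriers): if `O ⊆ {p}`, `S = {p, x}`, `R = {p}` is an
(A) datum (`p ≠ 2`, `p ∤ p − 1`); else pick `q₁ ∈ O ∖ {p}` and `S₀ = {p} ∪ (O ∖ {q₁})`; a non-carrier `ℓ₁` gives the (B♯) datum `S₀` (even case) or
`S₀ ∪ {ℓ₁}` (odd case, `ℓ₁ ≠ p`) with witness `ℓ₁` and second outside prime `t = q₁`, or the (A) datum `S₀ ∪ {q₁}` with `p ∤ ord_p Δ` (odd case, `ℓ₁ = p`).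
[cite: PastenShimura2024, §6.6 (the admissible factorisations N = DM, D of even cardinality)] -/
theorem allCarriers_of_not_inertSetDatum_of_not_upToOneSharpDatum
    (W : WeierstrassCurve ℚ) [W.IsElliptic] [W.IsGloballyMinimal] (p : ℕ) [Fact p.Prime]
    (hp5 : 5 ≤ p) (hMp : Mult W p)
    (hother : ∃ ℓ : ℕ, ∃ _ : Fact ℓ.Prime, ℓ ≠ p ∧ W.HasMultiplicativeReductionAtPrime ℓ)
    (hnoP : ¬ InertSetDatum W p) (hnoB : ¬ UpToOneSharpDatum W p) :
    ∀ (ℓ₁ : ℕ) [Fact ℓ₁.Prime], Mult W ℓ₁ → p ∣ padicValInt ℓ₁ W.minimalDiscriminantInt := by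
  intro ℓ₁ _ hℓ₁
  by_contra hnc
  have hp : p.Prime := Fact.out
  have hN0 : W.conductorNorm ℤ ≠ 0 := (W.conductorNorm_pos_holds).ne'
  have hp2 : p ≠ 2 := by omega
  have hpp1 : ¬ p ∣ p - 1 := Nat.not_dvd_of_pos_of_lt (by omega) (by omega)
  -- the finite set `O` of offending split carriers
  obtain ⟨O, hOin, hOmem⟩ : ∃ O : Finset ℕ,
      (∀ ℓ ∈ O, ∃ _ : Fact ℓ.Prime, W.HasSplitMultiplicativeReductionAtPrime ℓ ∧ p ∣ padicValInt ℓ W.minimalDiscriminantInt) ∧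
      (∀ (ℓ : ℕ) [Fact ℓ.Prime], W.HasSplitMultiplicativeReductionAtPrime ℓ → p ∣ padicValInt ℓ W.minimalDiscriminantInt → ℓ ∈ O) := by
    refine ⟨(W.conductorNorm ℤ).primeFactors.filter (fun ℓ ↦ ∃ h : ℓ.Prime,
        @WeierstrassCurve.HasSplitMultiplicativeReductionAtPrime W ℓ ⟨h⟩ ∧ p ∣ padicValInt ℓ W.minimalDiscriminantInt), ?_, ?_⟩
    · intro ℓ hℓ
      obtain ⟨-, hℓP, hs, hc⟩ := Finset.mem_filter.mp hℓ
      exact ⟨⟨hℓP⟩, hs, hc⟩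
    · intro ℓ hℓ hs hc
      have hℓN : ℓ ∣ W.conductorNorm ℤ :=
        (W.dvd_conductorNorm_iff_not_hasGoodReductionAtPrime ℓ).mpr
          (WeierstrassCurve.HasMultiplicativeReduction.not_hasGoodReduction (R := ℤ_[ℓ]) hs.hasMultiplicativeReductionAtPrime)
      exact Finset.mem_filter.mpr ⟨Nat.mem_primeFactors.mpr ⟨hℓ.out, hℓN, hN0⟩, hℓ.out, hs, hc⟩
  have hOmult : ∀ ℓ ∈ O, ∃ _ : Fact ℓ.Prime, Mult W ℓ := fun ℓ hℓ ↦ by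
    obtain ⟨i, hs, -⟩ := hOin ℓ hℓ
    exact ⟨i, hs.hasMultiplicativeReductionAtPrime⟩
  -- `ℓ₁` is not offending
  have hℓ₁O : ℓ₁ ∉ O := fun h ↦ by
    obtain ⟨_, -, hc⟩ := hOin ℓ₁ h
    exact hnc hc
  obtain ⟨x, _, hxp, hxm⟩ := hother
  by_cases hO : ∀ q ∈ O, q = p
  · -- Case O ⊆ {p}: the (A) datum S = {p, x}, R = {p}
    refine hnoP ⟨{p, x}, ?_, ?_, by simp, ?_, Or.inr ⟨{p}, by simp, ?_, ?_⟩⟩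
    · intro ℓ hℓ
      rcases Finset.mem_insert.mp hℓ with rfl | hℓ
      · exact ⟨‹_›, hMp⟩
      · rw [Finset.mem_singleton] at hℓ
        subst hℓ
        exact ⟨‹_›, hxm⟩
    · rw [Finset.card_pair (Ne.symm hxp)]
      exact even_two
    · intro ℓ _ hℓS hs hc
      have := hO ℓ (hOmem ℓ hs hc)
      subst this
      simp at hℓS
    · rw [Finset.card_pair (Ne.symm hxp), Finset.card_singleton]
    · intro q hq
      rw [Finset.mem_singleton] at hq
      subst hq
      exact ⟨hp2, hpp1⟩
  · -- Case ∃ q₁ ∈ O, q₁ ≠ p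
    push Not at hO
    obtain ⟨q₁, hq₁O, hq₁p⟩ := hO
    obtain ⟨iq₁, hq₁s, hq₁c⟩ := hOin q₁ hq₁O
    have hq₁ℓ₁ : q₁ ≠ ℓ₁ := fun h ↦ hℓ₁O (h ▸ hq₁O)
    set S₀ : Finset ℕ := insert p (O.erase q₁) with hS₀
    have hS₀mult : ∀ ℓ ∈ S₀, ∃ _ : Fact ℓ.Prime, Mult W ℓ := by
      intro ℓ hℓ
      rcases Finset.mem_insert.mp hℓ with rfl | hℓ
      · exact ⟨‹_›, hMp⟩
      · exact hOmult ℓ (Finset.mem_of_mem_erase hℓ)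
    have hpS₀ : p ∈ S₀ := Finset.mem_insert_self _ _
    have hq₁S₀ : q₁ ∉ S₀ := by
      intro h
      rcases Finset.mem_insert.mp h with h | h
      · exact hq₁p h
      · exact (Finset.notMem_erase q₁ O) h
    have hℓ₁S₀ : ℓ₁ ∈ S₀ → ℓ₁ = p := by
      intro h
      rcases Finset.mem_insert.mp h with h | h
      · exact h
      · exact absurd (Finset.mem_of_mem_erase h) hℓ₁O
    -- every offending split carrier other than q₁ lies in S₀
    have hFC₀ : ∀ (ℓ : ℕ) [Fact ℓ.Prime], ℓ ∉ S₀ → ℓ ≠ q₁ → W.HasSplitMultiplicativeReductionAtPrime ℓ →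
        ¬ p ∣ padicValInt ℓ W.minimalDiscriminantInt := by
      intro ℓ _ hℓS hℓq hs hc
      exact hℓS (Finset.mem_insert_of_mem (Finset.mem_erase.mpr ⟨hℓq, hOmem ℓ hs hc⟩))
    rcases Nat.even_or_odd S₀.card with he | ho
    · -- even: (B♯) with S = S₀, witness ℓ₁ outside S with second outside prime t = q₁ (or inside if ℓ₁ = p)
      refine hnoB ⟨q₁, iq₁, S₀, hq₁s, hq₁c, hS₀mult, he, hpS₀, hq₁S₀, hFC₀, Or.inl ⟨ℓ₁, ‹_›, hℓ₁, hnc, ?_⟩⟩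
      by_cases h : ℓ₁ ∈ S₀
      · exact Or.inl h
      · exact Or.inr ⟨q₁, iq₁, hq₁s.hasMultiplicativeReductionAtPrime, hq₁S₀, hq₁ℓ₁⟩
    · by_cases hℓp : ℓ₁ = p
      · -- odd, ℓ₁ = p: the (A) datum S = S₀ ∪ {q₁} with p ∤ ord_p Δ
        subst hℓp
        refine hnoP ⟨insert q₁ S₀, ?_, ?_, Finset.mem_insert_of_mem hpS₀, ?_, Or.inl hnc⟩
        · intro ℓ hℓ
          rcases Finset.mem_insert.mp hℓ with rfl | hℓ
          · exact ⟨iq₁, hq₁s.hasMultiplicativeReductionAtPrime⟩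
          · exact hS₀mult ℓ hℓ
        · rw [Finset.card_insert_of_notMem hq₁S₀]
          exact ho.add_one
        · intro ℓ _ hℓS hs hc
          have hℓq : ℓ ≠ q₁ := fun h ↦ hℓS (h ▸ Finset.mem_insert_self q₁ S₀)
          exact hFC₀ ℓ (fun h ↦ hℓS (Finset.mem_insert_of_mem h)) hℓq hs hc
      · -- odd, ℓ₁ ≠ p: (B♯) with S = S₀ ∪ {ℓ₁}, witness ℓ₁ ∈ S
        have hℓ₁S₀' : ℓ₁ ∉ S₀ := fun h ↦ hℓp (hℓ₁S₀ h)
        refine hnoB ⟨q₁, iq₁, insert ℓ₁ S₀, hq₁s, hq₁c, ?_, ?_, Finset.mem_insert_of_mem hpS₀, ?_, ?_,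
          Or.inl ⟨ℓ₁, ‹_›, hℓ₁, hnc, Or.inl (Finset.mem_insert_self _ _)⟩⟩
        · intro ℓ hℓ
          rcases Finset.mem_insert.mp hℓ with rfl | hℓ
          · exact ⟨‹_›, hℓ₁⟩
          · exact hS₀mult ℓ hℓ
        · rw [Finset.card_insert_of_notMem hℓ₁S₀']
          exact ho.add_one
        · intro h
          rcases Finset.mem_insert.mp h with h | h
          · exact hq₁ℓ₁ h
          · exact hq₁S₀ h
        · intro ℓ _ hℓS hℓq hs hc
          exact hFC₀ ℓ (fun h ↦ hℓS (Finset.mem_insert_of_mem h)) hℓq hs hc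


/-! ### §3 NEW (g3, idea 3 «level-lowering cut», PROVED): on SEMISTABLE curves the self-carrier `p ∣ ord_p Δ_min` is excluded -/

/-- **(W)-witness at `p` for free on semistable curves.** `E` semistable, `p ≥ 5` multiplicative, `E[p]` irreducible and NO (ram) prime
⟹ `p ∤ ord_p(Δ_min)` (très ramifié at `p`): otherwise `E[p] ⊗ 𝔽̄_p` is irreducible, odd, modular, of Serre level `1` and Serre weight `2`,
and Ribet–Diamond level lowering produces a weight-2 cusp form of level `1`. Contrapositive of the TREE theorem
`ram_of_semistable_of_irr_of_mult_of_dvd`. [cite: Ribet1990, Thm. 1.1] [cite: Diamond1995RefinedSerre, Thm. 1.1] [cite: Serre1987, §4.1 (4.1.12)] -/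
theorem not_dvd_ordp_of_semistable_of_not_ram (hnf : exists_isNewformOf) (hLL : diamond1995_refinedSerre)
    (W : WeierstrassCurve ℚ) [W.IsElliptic] [W.IsGloballyMinimal] (p : ℕ) [Fact p.Prime]
    (hp5 : 5 ≤ p) (hMp : Mult W p) (hirr : Irr W p) (hsst : Semistable W) (hnram : ¬ Ram W p) :
    ¬ p ∣ padicValInt p W.minimalDiscriminantInt := fun h ↦
  hnram (ram_of_semistable_of_irr_of_mult_of_dvd hnf hLL W p (by omega) hMp h hsst hirr)

/-- **At `p ∈ {5, 7}` the ¬(ram) locus is EMPTY on semistable curves** (tree theorem `ram_of_semistable_of_irr_of_le_seven`: Serre weight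
`≤ p + 1 ≤ 8 < 12`, no level-one forms), so 19715 is vacuous there. [cite: Ribet1990, Thm. 1.1] [cite: Serre1987, §2.8 Prop. 3–4] -/
theorem ram_of_semistable_of_le_seven_atFive (hnf : exists_isNewformOf) (hLL : diamond1995_refinedSerre)
    (W : WeierstrassCurve ℚ) [W.IsElliptic] [W.IsGloballyMinimal] (p : ℕ) [Fact p.Prime]
    (hp5 : 5 ≤ p) (hp7 : p ≤ 7) (hirr : Irr W p) (hsst : Semistable W) : Ram W p :=
  ram_of_semistable_of_irr_of_le_seven hnf hLL W p (by omega) hp7 hsst hirr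

/-- **§3c A second multiplicative prime on the Tamagawa locus (S1b ∩ semistable ∩ {p ∣ ∏ c} = ∅).** `p ≥ 5` divides `∏ c_ℓ` iff some SPLIT
multiplicative `ℓ` has `p ∣ ord_ℓ(Δ_min)` (tree: `dvd_tamagawaProduct_iff_exists_split`); `ℓ = p` is excluded by `not_dvd_ordp_of_semistable_of_not_ram`.
[cite: SilvermanATAEC1994, Cor. IV.9.2(d)] -/
theorem exists_otherMult_of_semistable_of_dvd_tamagawaProduct (hnf : exists_isNewformOf) (hLL : diamond1995_refinedSerre)
    (W : WeierstrassCurve ℚ) [W.IsElliptic] [W.IsGloballyMinimal] (p : ℕ) [Fact p.Prime]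
    (hp5 : 5 ≤ p) (hMp : Mult W p) (hirr : Irr W p) (hsst : Semistable W) (hnram : ¬ Ram W p)
    (htam : p ∣ W.tamagawaProduct) :
    ∃ ℓ : ℕ, ∃ _ : Fact ℓ.Prime, ℓ ≠ p ∧ W.HasMultiplicativeReductionAtPrime ℓ := by
  have hp : p.Prime := Fact.out
  obtain ⟨ℓ, _, hs, hd⟩ := (dvd_tamagawaProduct_iff_exists_split W hp hp5).mp htam
  refine ⟨ℓ, ‹_›, ?_, hs.hasMultiplicativeReductionAtPrime⟩
  rintro rfl
  exact not_dvd_ordp_of_semistable_of_not_ram hnf hLL W ℓ hp5 hMp hirr hsst hnram hd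

/-- **§3d The (B♯) datum is FORCED on a semistable pair of 19715's locus without an (A) datum** (exhaustion lemma §2 at `ℓ₁ = p` + §3a). -/
theorem upToOneSharpDatum_of_semistable_of_not_inertSetDatum (hnf : exists_isNewformOf) (hLL : diamond1995_refinedSerre)
    (W : WeierstrassCurve ℚ) [W.IsElliptic] [W.IsGloballyMinimal] (p : ℕ) [Fact p.Prime]
    (hp5 : 5 ≤ p) (hMp : Mult W p) (hirr : Irr W p) (hsst : Semistable W) (hnram : ¬ Ram W p)
    (htam : p ∣ W.tamagawaProduct) (hnoA : ¬ InertSetDatum W p) : UpToOneSharpDatum W p := by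
  by_contra hnoB
  exact not_dvd_ordp_of_semistable_of_not_ram hnf hLL W p hp5 hMp hirr hsst hnram
    (allCarriers_of_not_inertSetDatum_of_not_upToOneSharpDatum W p hp5 hMp
      (exists_otherMult_of_semistable_of_dvd_tamagawaProduct hnf hLL W p hp5 hMp hirr hsst hnram htam) hnoA hnoB p hMp)

/-- **§3e 19715 ON SEMISTABLE CURVES (PROVED modulo HOLE 1 + print; K1♭-free, residual-stub-free, Jetchev-at-`p`-free).** Binders: the
printed inputs (conjuncts of `PublishedInputsFive`), Barrios (`hBR`, a tree theorem), the Shimura-parametrization item, the ORIGINAL Pasten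
component-orders item, the crux `X11aLowerHalf` (as `hX11a`), the saved display (HOLE 1, v9's ∀-stub VERBATIM) and the printed level-lowering fact
`diamond1995_refinedSerre` BY NAME; conclusion = the statement of 19715 with the extra binder `Semistable W` (the (A)-clause spelled VERBATIM).
CONDITIONAL on the binders; nothing booked; 19715 NOT closed. [cite: Ribet1990, Thm. 1.1] [cite: Diamond1995RefinedSerre, Thm. 1.1]
[cite: Jetchev2008, Cor. 1.5] [cite: PastenShimura2024, §6.6] -/
theorem res_semistableAtFive_of_levelLowering
    (hGZK : rank_eq_analyticRank_of_analyticRank_le_one) (hmod : hasEntireLFunction_rat)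
    (hnf : exists_isNewformOf) (hFH : friedbergHoffstein_exists_twist_ne_zero_inertAt)
    (hMaz : mazur_not_dvd_maninConstant_of_odd)
    (hBR : localTamagawaNumber_quadraticTwist_two_mem_of_goodReduction)
    (hJL : nonempty_shimuraParametrizationData)
    (hCO : PastenShimura2024_componentOrders)
    (hLL : diamond1995_refinedSerre)
    (hX11a : ∀ (Wd : WeierstrassCurve ℚ) [Wd.IsElliptic] [Wd.IsGloballyMinimal] (p : ℕ) [Fact p.Prime],
      ClassX11a Wd p → Typed.MissingLowerBoundAt Wd p)
    (hSavD : ∀ (W : WeierstrassCurve ℚ) [W.IsElliptic] [W.IsGloballyMinimal] (p : ℕ) [Fact p.Prime]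
      (q₁ : ℕ) [Fact q₁.Prime], ClassX11b W p → 5 ≤ p → Surj W p → ¬ Ram W p →
      W.HasSplitMultiplicativeReductionAtPrime q₁ → p ∣ padicValInt q₁ W.minimalDiscriminantInt →
      Theorems.ShimuraInertSavedDisplayAtD W p q₁) :
    ∀ (W : WeierstrassCurve ℚ) [W.IsElliptic] [W.IsGloballyMinimal] (p : ℕ) [Fact p.Prime],
      ClassX11b W p → 5 ≤ p → Surj W p → ¬ Ram W p → p ∣ W.tamagawaProduct → Semistable W →
      ¬ (∃ S : Finset ℕ, (∀ ℓ ∈ S, ∃ _ : Fact ℓ.Prime, Mult W ℓ) ∧ Even S.card ∧ p ∈ S ∧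
          (∀ (ℓ : ℕ) [Fact ℓ.Prime], ℓ ∉ S → W.HasSplitMultiplicativeReductionAtPrime ℓ →
            ¬ p ∣ padicValInt ℓ W.minimalDiscriminantInt) ∧
          (¬ p ∣ padicValInt p W.minimalDiscriminantInt ∨
            ∃ R ⊆ S, S.card = 2 * R.card ∧ ∀ q ∈ R, q ≠ 2 ∧ ¬ p ∣ q - 1)) →
      Typed.MissingUpperBoundAt W p := by
  intro W _ _ p _ hX hp5 hsurj hnram htam hsst hnoA
  obtain ⟨-, -, hMp, hirr⟩ := id hX
  exact res_upToOneSharpAtFive_of_savedDisplayD_of_lowerX11a hGZK hmod hnf hFH hMaz hBR hJL hCO hX11a hSavD W p hX hp5 hsurj hnram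
    (upToOneSharpDatum_of_semistable_of_not_inertSetDatum hnf hLL W p hp5 hMp hirr hsst hnram htam hnoA)

/-- **§3f The same, over the ROUTE ITEMS of `Theses/ErratumRoadFive.lean`** (`PublishedInputsFive` destructured as in the line of record;
`ShimuraParametrizationDataNonempty`, `PastenComponentOrdersInput`, `X11aLowerHalf` by name; Barrios = tree theorem `_holds`): 19715's binders
VERBATIM + `Semistable W`. CONDITIONAL; nothing booked; 19715 NOT closed; BSD NOT proved. -/
theorem res_semistableAtFive_of_items
    (h₅ : Summit.BirchSwinnertonDyer.BirchSwinnertonDyer.Theses.ErratumRoadFive.PublishedInputsFive)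
    (h₃ : Summit.BirchSwinnertonDyer.BirchSwinnertonDyer.Theses.ErratumRoadFive.X11aLowerHalf)
    (hJL : Summit.BirchSwinnertonDyer.BirchSwinnertonDyer.Theses.ErratumRoadFive.ShimuraParametrizationDataNonempty)
    (hCO : Summit.BirchSwinnertonDyer.BirchSwinnertonDyer.Theses.ErratumRoadFive.PastenComponentOrdersInput)
    (hLL : diamond1995_refinedSerre)
    (hSav : ∀ (W : WeierstrassCurve ℚ) [W.IsElliptic] [W.IsGloballyMinimal] (p : ℕ) [Fact p.Prime]
      (q₁ : ℕ) [Fact q₁.Prime], ClassX11b W p → 5 ≤ p → Surj W p → ¬ Ram W p →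
      W.HasSplitMultiplicativeReductionAtPrime q₁ → p ∣ padicValInt q₁ W.minimalDiscriminantInt →
      Theorems.ShimuraInertSavedDisplayAtD W p q₁) :
    ∀ (W : WeierstrassCurve ℚ) [W.IsElliptic] [W.IsGloballyMinimal] (p : ℕ) [Fact p.Prime],
      Summit.BirchSwinnertonDyer.Rank1Residual.ClassX11b W p → 5 ≤ p →
      Literature.NumberTheory.EllipticCurves.Rank1Residual.Surj W p →
      ¬ Literature.NumberTheory.EllipticCurves.Rank1Residual.Ram W p → p ∣ W.tamagawaProduct →
      ¬ (∃ S : Finset ℕ, (∀ ℓ ∈ S, ∃ _ : Fact ℓ.Prime, Literature.NumberTheory.EllipticCurves.Rank1Residual.Mult W ℓ) ∧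
          Even S.card ∧ p ∈ S ∧
          (∀ (ℓ : ℕ) [Fact ℓ.Prime], ℓ ∉ S → W.HasSplitMultiplicativeReductionAtPrime ℓ →
            ¬ p ∣ padicValInt ℓ W.minimalDiscriminantInt) ∧
          (¬ p ∣ padicValInt p W.minimalDiscriminantInt ∨
            ∃ R ⊆ S, S.card = 2 * R.card ∧ ∀ q ∈ R, q ≠ 2 ∧ ¬ p ∣ q - 1)) →
      Semistable W →
      Literature.NumberTheory.EllipticCurves.Rank1Residual.Typed.MissingUpperBoundAt W p := by
  intro W _ _ p _ hX hp5 hsurj hnram htam hnoA hsst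
  obtain ⟨-, -, -, -, -, hGZK, hmod, hnf, -, -, hMaz, -, hFH, -, -⟩ := h₅
  exact res_semistableAtFive_of_levelLowering hGZK hmod hnf hFH hMaz
    localTamagawaNumber_quadraticTwist_two_mem_of_goodReduction_holds hJL hCO hLL (fun Wd _ _ p _ hXa ↦ h₃ Wd p hXa) hSav
    W p hX hp5 hsurj hnram htam hsst hnoA

/-- **§3g … and at `p ≤ 7` even the saved display is not needed** (the locus is empty). -/
theorem res_semistable_le_seven_vacuous (hnf : exists_isNewformOf) (hLL : diamond1995_refinedSerre)
    (W : WeierstrassCurve ℚ) [W.IsElliptic] [W.IsGloballyMinimal] (p : ℕ) [Fact p.Prime]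
    (hX : ClassX11b W p) (hp5 : 5 ≤ p) (hp7 : p ≤ 7) (hnram : ¬ Ram W p) (hsst : Semistable W) :
    Typed.MissingUpperBoundAt W p :=
  (hnram (ram_of_semistable_of_le_seven_atFive hnf hLL W p hp5 hp7 hX.2.2.2 hsst)).elim

/-! ### §4 Next rung (TYPED in v1; PROVED in v2, §4c): additive conductor a power of two dividing 16 -/

/-- **`SelfCarrierFreeOnTwoPowerAdditiveAtFive` (TYPED; PROVED in §4c from `exists_isNewformOf`, `diamond1995_refinedSerre` and Ogg–Saito).** On 19715's locus (`p ≥ 5` multiplicative, `E[p]` irreducible,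
no (ram) prime) with every odd bad prime multiplicative and `2⁵ ∤ N` (so `N_add ∣ 16`): `p ∤ ord_p(Δ_min)`. Road (all tools in the tree):
`ρ̄ = E[p] ⊗ 𝔽̄_p` (`exists_isTorsionGaloisRep`), absolutely irreducible (`isAbsolutelyIrreducible_of_hasIrreducibleModPGaloisRep`), odd, modular
(`IsModular.isModular_of_isTorsionGaloisRep''` from `exists_isNewformOf`); `k(ρ̄) = 2` (`serreWeight_eq_two_of_hasMultiplicativeReductionAt_of_dvd`);
`ℓ ∤ N(ρ̄)` at multiplicative carriers (`not_dvd_serreLevel_baseChange_of_hasMultiplicativeReductionAt_of_dvd_int`), `p ∤ N(ρ̄)` (`not_dvd_serreLevel`),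
`N(ρ̄) ∣ N_E` (`serreLevel_baseChange_dvd_conductorNorm_of_tate`, needs the Ogg–Saito identity `artinConductorExponent_tate_eq_conductorExponent_of_isElliptic`,
a named fact) ⟹ `N(ρ̄) ∣ 16`; Diamond's refined level lowering (`diamond1995_refinedSerre`) ⟹ newform on `Γ₁(M)`, `M ∣ 16`, weight 2; nebentypus
trivial (`nebentypus_eq_one_of_isGaloisRepOfNewform1Int_of_not_dvd_totient`, `p ∤ φ(M) ∣ 8`), descend to `Γ₀(M)`
(`exists_isNewform0_coe_eq_of_nebentypus_eq_one`), `S₂(Γ₀(M)) = 0` (`cuspForm_two_gamma0_eq_zero_of_dvd_sixteen`). Size M (the Dénes Serre road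
`DenesEquationSerreRoadProofs.lean` l.409–470 is the template). Why it might fail as typed: only a slip in the `N(ρ̄) ∣ N_add` bookkeeping at `2`
(Ogg–Saito is the load-bearing print). -/
def SelfCarrierFreeOnTwoPowerAdditiveAtFive : Prop :=
  ∀ (W : WeierstrassCurve ℚ) [W.IsElliptic] [W.IsGloballyMinimal] (p : ℕ) [Fact p.Prime],
    5 ≤ p → Mult W p → Irr W p → ¬ Ram W p →
    (∀ (ℓ : ℕ) [Fact ℓ.Prime], ℓ ≠ 2 → W.HasGoodReductionAtPrime ℓ ∨ W.HasMultiplicativeReductionAtPrime ℓ) →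
    ¬ 2 ^ 5 ∣ W.conductorNorm ℤ →
    ¬ p ∣ padicValInt p W.minimalDiscriminantInt

/-- **§4b Its consequence (PROVED): 19715 on the `N_add ∣ 16` locus from `SelfCarrierFreeOnTwoPowerAdditiveAtFive`** + the same binders as §3e. -/
theorem res_twoPowerAdditiveAtFive_of_selfCarrierFree
    (hGZK : rank_eq_analyticRank_of_analyticRank_le_one) (hmod : hasEntireLFunction_rat)
    (hnf : exists_isNewformOf) (hFH : friedbergHoffstein_exists_twist_ne_zero_inertAt)
    (hMaz : mazur_not_dvd_maninConstant_of_odd)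
    (hBR : localTamagawaNumber_quadraticTwist_two_mem_of_goodReduction)
    (hJL : nonempty_shimuraParametrizationData)
    (hCO : PastenShimura2024_componentOrders)
    (hSCF : SelfCarrierFreeOnTwoPowerAdditiveAtFive)
    (hX11a : ∀ (Wd : WeierstrassCurve ℚ) [Wd.IsElliptic] [Wd.IsGloballyMinimal] (p : ℕ) [Fact p.Prime],
      ClassX11a Wd p → Typed.MissingLowerBoundAt Wd p)
    (hSavD : ∀ (W : WeierstrassCurve ℚ) [W.IsElliptic] [W.IsGloballyMinimal] (p : ℕ) [Fact p.Prime]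
      (q₁ : ℕ) [Fact q₁.Prime], ClassX11b W p → 5 ≤ p → Surj W p → ¬ Ram W p →
      W.HasSplitMultiplicativeReductionAtPrime q₁ → p ∣ padicValInt q₁ W.minimalDiscriminantInt →
      Theorems.ShimuraInertSavedDisplayAtD W p q₁) :
    ∀ (W : WeierstrassCurve ℚ) [W.IsElliptic] [W.IsGloballyMinimal] (p : ℕ) [Fact p.Prime],
      ClassX11b W p → 5 ≤ p → Surj W p → ¬ Ram W p → p ∣ W.tamagawaProduct →
      (∀ (ℓ : ℕ) [Fact ℓ.Prime], ℓ ≠ 2 → W.HasGoodReductionAtPrime ℓ ∨ W.HasMultiplicativeReductionAtPrime ℓ) →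
      ¬ 2 ^ 5 ∣ W.conductorNorm ℤ →
      ¬ InertSetDatum W p → Typed.MissingUpperBoundAt W p := by
  intro W _ _ p _ hX hp5 hsurj hnram htam hodd h32 hnoA
  obtain ⟨-, -, hMp, hirr⟩ := id hX
  have hp : p.Prime := Fact.out
  have hW : ¬ p ∣ padicValInt p W.minimalDiscriminantInt := hSCF W p hp5 hMp hirr hnram hodd h32
  -- a second multiplicative prime: the split `ℓ` with `p ∣ ord_ℓ Δ` dividing `∏ c` is not `p`
  have hother : ∃ ℓ : ℕ, ∃ _ : Fact ℓ.Prime, ℓ ≠ p ∧ W.HasMultiplicativeReductionAtPrime ℓ := by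
    obtain ⟨ℓ, _, hs, hd⟩ := (dvd_tamagawaProduct_iff_exists_split W hp hp5).mp htam
    refine ⟨ℓ, ‹_›, ?_, hs.hasMultiplicativeReductionAtPrime⟩
    rintro rfl
    exact hW hd
  have hB : UpToOneSharpDatum W p := by
    by_contra hnoB
    exact hW (allCarriers_of_not_inertSetDatum_of_not_upToOneSharpDatum W p hp5 hMp hother hnoA hnoB p hMp)
  exact res_upToOneSharpAtFive_of_savedDisplayD_of_lowerX11a hGZK hmod hnf hFH hMaz hBR hJL hCO hX11a hSavD W p hX hp5 hsurj hnram hB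

/-! ### §4c (v2, PROVED) The 2-power rung: `SelfCarrierFreeOnTwoPowerAdditiveAtFive` from modularity, Diamond's refined Serre and Ogg–Saito -/

section TwoPowerProof

open scoped MatrixGroups ModularForm NumberField
open CongruenceSubgroup Polynomial
open _root_.WeierstrassCurve Literature.NumberTheory Literature.NumberTheory.GaloisRepresentations
  Literature.NumberTheory.EllipticCurves Literature.NumberTheory.EllipticCurves.ModularForms
  Rat.HeightOneSpectrum IsDedekindDomain IsDedekindDomain.HeightOneSpectrum
  Literature.NumberTheory.Automorphic Literature.NumberTheory.Automorphic.BCDT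
  Literature.NumberTheory.DiophantineGeometry Literature.NumberTheory.EllipticCurves.Rank1Residual
  Literature.NumberTheory.GaloisRepresentations.ModPGaloisRep
  Literature.NumberTheory.GaloisRepresentations.IsNonarchimedeanLocalField
  Literature.NumberTheory.EllipticCurves.SkinnerUrban2014 ValuativeRel

/-- Arithmetic: a non-zero natural number all of whose prime factors equal the prime `r`, dividing a
number not divisible by `r^(k+1)`, divides `r^k`. -/
theorem dvd_primePow_of_forall_prime_dvd_eq {L N r k : ℕ} (hL0 : L ≠ 0)
    (hq : ∀ q : ℕ, q.Prime → q ∣ L → q = r) (hLN : L ∣ N) (hk : ¬ r ^ (k + 1) ∣ N) :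
    L ∣ r ^ k := by
  have hL : L = r ^ L.primeFactorsList.length :=
    Nat.eq_prime_pow_of_unique_prime_dvd hL0 (fun hd hdL ↦ hq _ hd hdL)
  set a := L.primeFactorsList.length with ha
  have hak : a ≤ k := by
    by_contra hak
    exact hk ((Nat.pow_dvd_pow r (by omega)).trans (hL ▸ hLN))
  rw [hL]
  exact Nat.pow_dvd_pow r hak

/-- Arithmetic: a non-zero natural number all of whose prime factors are `2`, dividing a number
not divisible by `2⁵`, divides `16`. -/
theorem dvd_sixteen_of_forall_prime_dvd_eq_two {L N : ℕ} (hL0 : L ≠ 0)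
    (h2 : ∀ q : ℕ, q.Prime → q ∣ L → q = 2) (hLN : L ∣ N) (h32 : ¬ 2 ^ 5 ∣ N) : L ∣ 16 :=
  dvd_primePow_of_forall_prime_dvd_eq (k := 4) hL0 h2 hLN h32

/-- `p ∤ φ(M)` for `M ∣ 9` and `p ≥ 5` prime (`φ(M) ∈ {1, 2, 6}`). -/
theorem not_dvd_totient_of_dvd_nine {M p : ℕ} (hM : M ∣ 9) (hp : p.Prime) (hp5 : 5 ≤ p) :
    ¬ p ∣ Nat.totient M := by
  intro h
  obtain ⟨i, hi, rfl⟩ := (Nat.dvd_prime_pow Nat.prime_three).mp (show M ∣ 3 ^ 2 by simpa using hM)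
  have hφ : Nat.totient (3 ^ i) ∣ 6 := by
    interval_cases i <;> decide
  rcases (Nat.Prime.dvd_mul hp).mp (show p ∣ 2 * 3 from h.trans hφ) with h2 | h3
  · have := (Nat.prime_dvd_prime_iff_eq hp Nat.prime_two).mp h2; omega
  · have := (Nat.prime_dvd_prime_iff_eq hp Nat.prime_three).mp h3; omega

/-- `p ∤ φ(M)` for `M ∣ 25` and `p ≥ 7` prime (`φ(M) ∈ {1, 4, 20}`). -/
theorem not_dvd_totient_of_dvd_twentyFive {M p : ℕ} (hM : M ∣ 25) (hp : p.Prime) (hp7 : 7 ≤ p) :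
    ¬ p ∣ Nat.totient M := by
  intro h
  obtain ⟨i, hi, rfl⟩ := (Nat.dvd_prime_pow Nat.prime_five).mp (show M ∣ 5 ^ 2 by simpa using hM)
  have hφ : Nat.totient (5 ^ i) ∣ 20 := by
    interval_cases i <;> decide
  rcases (Nat.Prime.dvd_mul hp).mp (show p ∣ 2 ^ 2 * 5 from h.trans hφ) with h2 | h5
  · have := (Nat.prime_dvd_prime_iff_eq hp Nat.prime_two).mp (hp.dvd_of_dvd_pow h2); omega
  · have := (Nat.prime_dvd_prime_iff_eq hp Nat.prime_five).mp h5; omega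

/-- **`S₂(Γ₀(M)) = 0` for `M ∣ 25`** (`X₀(1), X₀(5), X₀(25)` have genus `0`; in the tree by the cuspidal Sturm
bound: `cuspForm_two_gamma0_eq_zero_of_le_ten`, `finrank_cuspForm_two_eq_genusX0_of_mem`, `gamma0_data_25`).
[cite: DiamondShurman2005, Thm. 3.5.1] -/
theorem cuspForm_two_gamma0_eq_zero_of_dvd_twentyFive {M : ℕ} [NeZero M] (hM : M ∣ 25)
    (f : CuspForm (Gamma0 M) 2) : f = 0 := by
  have hM' : M = 1 ∨ M = 5 ∨ M = 25 := by
    obtain ⟨i, hi, hMi⟩ := (Nat.dvd_prime_pow Nat.prime_five).mp (show M ∣ 5 ^ 2 by simpa using hM)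
    interval_cases i
    · exact Or.inl (by rw [hMi]; rfl)
    · exact Or.inr (Or.inl (by rw [hMi]; rfl))
    · exact Or.inr (Or.inr (by rw [hMi]; rfl))
  rcases hM' with rfl | rfl | rfl
  · exact cuspForm_two_gamma0_eq_zero_of_le_ten (by norm_num) f
  · exact cuspForm_two_gamma0_eq_zero_of_le_ten (by norm_num) f
  · have hfd : FiniteDimensional ℂ (CuspForm (Gamma0 25) 2) := finiteDimensional_cuspForm_gamma0 25 2
    have h := finrank_cuspForm_two_eq_genusX0_of_mem (N := 25) (by decide)
    obtain ⟨hμ, hν, h₂, h₃⟩ := gamma0_data_25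
    have hg : genusX0 25 = 0 := by rw [genusX0, hμ, hν, h₂, h₃]
    rw [finrank_cuspForm_two_eq_genusX0, hg] at h
    exact finrank_zero_iff_forall_zero.mp h f

/-- **The prime-power-additive rung (core), proved.**  For `E/ℚ` elliptic (global minimal model `W`),
`p ≥ 5` of multiplicative reduction with `E[p]` irreducible, `¬ (ram)` (every multiplicative `ℓ ≠ p` is a
`p`-carrier), every prime `≠ r` semistable for `E` and `r^(k+1) ∤ N_E` (`r` is meant to be a prime; for
composite `r` the hypotheses force `N(ρ̄) = 1`), PROVIDED the levels `M ∣ r^k`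
carry no weight-2 cusp forms on `Γ₀(M)` (`hvan`) and have `p ∤ φ(M)` (`htot`): `p ∤ ord_p(Δ_min)`.
Proof = `ram_of_semistable_of_irr_of_mult_of_dvd` (Serre–Ribet–Diamond road) with the level bound
`N(ρ̄ ⊗ 𝔽̄_p) ∣ r^k` (primes `q ≠ r`: good ⟹ unramified, multiplicative ⟹ carrier ⟹ Tate, `p` never;
at `r`: `N(ρ̄) ∣ N_E`, Ogg–Saito `hOS`) in place of `N(ρ̄) = 1`, and the end-game of the Dénes road:
`p ∤ φ(M)` forces trivial nebentypus, the newform descends to `Γ₀(M)`, `M ∣ r^k`, and `S₂(Γ₀(M)) = 0`. -/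
theorem not_dvd_ordp_of_primePowerAdditive_of_not_ram
    (hmod : exists_isNewformOf) (hLL : diamond1995_refinedSerre)
    (hOS : ∀ (W : WeierstrassCurve ℚ) (ℓ : ℕ) [Fact ℓ.Prime],
      W.artinConductorExponent_tate_eq_conductorExponent_of_isElliptic ℓ)
    (W : WeierstrassCurve ℚ) [W.IsElliptic] [W.IsGloballyMinimal]
    (p : ℕ) [Fact p.Prime] (hp5 : 5 ≤ p) (hmultp : Mult W p) (hirr : Irr W p) (hnram : ¬ Ram W p)
    {r k : ℕ}
    (hsemi : ∀ (ℓ : ℕ) [Fact ℓ.Prime], ℓ ≠ r →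
      W.HasGoodReductionAtPrime ℓ ∨ W.HasMultiplicativeReductionAtPrime ℓ)
    (hk : ¬ r ^ (k + 1) ∣ W.conductorNorm ℤ)
    (htot : ∀ M : ℕ, M ∣ r ^ k → ¬ p ∣ Nat.totient M)
    (hvan : ∀ (M : ℕ) [NeZero M], M ∣ r ^ k → ∀ f : CuspForm (Gamma0 M) 2, f = 0) :
    ¬ p ∣ padicValInt p W.minimalDiscriminantInt := by
  classical
  intro hpeu
  have hp : p.Prime := Fact.out
  have hp2 : p ≠ 2 := by omega
  have hodd : Odd p := hp.odd_of_ne_two hp2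
  -- `ord_u Δ_min = v_{ℓ}(Δ_min)` at every place `u` of `ℤ`
  have hordZ : ∀ u : HeightOneSpectrum ℤ,
      W.ordMinimalDiscriminant u = padicValInt (natGenerator u) W.minimalDiscriminantInt := by
    intro u
    rw [← W.factorization_minimalDiscriminantNorm_holds u,
      minimalDiscriminantNorm_int_eq_natAbs_minimalDiscriminantInt_holds W,
      Nat.factorization_def _ (show (natGenerator u).Prime from (primesEquiv u).2)]
    rfl
  -- `¬ Ram`: at every multiplicative place `u ∤ p` of `ℤ`, `p ∣ ord_u Δ_min`
  have hunr : ∀ u : HeightOneSpectrum ℤ, natGenerator u ≠ p → W.HasMultiplicativeReductionAt u →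
      p ∣ W.ordMinimalDiscriminant u := by
    intro u hup hmu
    by_contra hdiv
    apply hnram
    refine ⟨natGenerator u, ⟨(primesEquiv u).2⟩, hup,
      (hasMultiplicativeReductionAtPrime_primesEquiv_iff_hasMultiplicativeReductionAt W u).mpr hmu,
      ?_⟩
    rwa [hordZ u] at hdiv
  -- every place `≠ r` of `ℤ` is semistable
  have hsstZ : ∀ u : HeightOneSpectrum ℤ, natGenerator u ≠ r →
      W.HasGoodReductionAt u ∨ W.HasMultiplicativeReductionAt u := by
    intro u hu2
    haveI : Fact (natGenerator u).Prime := ⟨(primesEquiv u).2⟩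
    rcases hsemi (natGenerator u) hu2 with hg | hm
    · exact Or.inl ((hasGoodReductionAtPrime_primesEquiv_iff_hasGoodReductionAt W u).mp hg)
    · exact Or.inr
        ((hasMultiplicativeReductionAtPrime_primesEquiv_iff_hasMultiplicativeReductionAt W u).mp hm)
  /- Step 1. A framed model `ρ̄` of `E[p]` and `ρ̄' = ρ̄ ⊗ 𝔽̄_p`: irreducible and odd. -/
  haveI : NeZero ((p : ℕ) : ℚ) := ⟨by exact_mod_cast hp.ne_zero⟩
  obtain ⟨ρ, hρ⟩ := W.exists_isTorsionGaloisRep p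
  letI : TopologicalSpace (AlgebraicClosure (ZMod p)) := ⊥
  haveI : DiscreteTopology (AlgebraicClosure (ZMod p)) := ⟨rfl⟩
  set j : ZMod p →+* AlgebraicClosure (ZMod p) := algebraMap (ZMod p) (AlgebraicClosure (ZMod p))
    with hj
  set ρ' : ModPGaloisRep ℚ (AlgebraicClosure (ZMod p)) 2 :=
    FramedRep.baseChange j continuous_of_discreteTopology ρ with hρ'
  have habs := isAbsolutelyIrreducible_of_hasIrreducibleModPGaloisRep W hp2 hirr hρ
  have hirr' : ρ'.toGaloisRep.IsIrreducible := by
    rw [← ModPGaloisRep.isIrreducible_iff_toGaloisRep]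
    exact habs.isIrreducible_baseChange (AlgebraicClosure (ZMod p)) j _
  have hodd' : FramedGaloisRep.IsOdd ρ' :=
    (ModPGaloisRep.isOdd_of_det_eq_modPCyclotomicCharacterZMod ρ
      (W.det_eq_modPCyclotomicCharacter_of_isTorsionGaloisRep_holds p ρ hρ)).baseChange j _
  /- Step 2. `ρ̄` and `ρ̄'` are modular, `E` being modular (`hmod`). -/
  haveI : NeZero (W.conductorNorm ℤ) := ⟨(conductorNorm_pos_holds W).ne'⟩
  have hWmod : BCDT.IsModular W := exists_isNewformOf_iff.mp hmod W
  have hρmod : ModPGaloisRep.IsModular ρ := hWmod.isModular_of_isTorsionGaloisRep'' hρ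
  have hρ'mod : ModPGaloisRep.IsModular ρ' := hρmod.baseChange_algebraicClosure
  /- Step 3. The canonical local datum at the place `v` above `p`; the weight is `2`
     (multiplicative, peu ramifié). -/
  obtain ⟨v, hv⟩ : ∃ v : HeightOneSpectrum (𝓞 ℚ), primesEquiv v = ⟨p, hp⟩ :=
    ⟨(primesEquiv (R := 𝓞 ℚ)).symm ⟨p, hp⟩, Equiv.apply_symm_apply _ _⟩
  have hpv' : (p : 𝓞 ℚ) ∈ v.asIdeal := (natCast_mem_asIdeal_iff_primesEquiv_eq v hp).mpr (by rw [hv])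
  have hvs : v = (primesEquiv (R := 𝓞 ℚ)).symm ⟨p, hp⟩ := by
    rw [Equiv.eq_symm_apply]; exact hv
  -- the place of `ℤ` above `p`
  set uZ : HeightOneSpectrum ℤ := (primesEquiv (R := ℤ)).symm ⟨p, hp⟩ with huZ
  have huZp : natGenerator uZ = p := Rat.natGenerator_primesEquiv_symm ⟨p, hp⟩
  have hpe : (primesEquiv uZ : Nat.Primes) = ⟨p, hp⟩ := Equiv.apply_symm_apply _ _
  have hmultZ : W.HasMultiplicativeReductionAt uZ := by
    have h := hasMultiplicativeReductionAtPrime_primesEquiv_iff_hasMultiplicativeReductionAt W uZ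
    rw [hpe] at h
    exact h.mp hmultp
  have hmultv : W.HasMultiplicativeReductionAt v := by
    rw [hvs]; exact hasMultiplicativeReductionAt_of_int W ⟨p, hp⟩ hmultZ
  have hpordv : p ∣ W.ordMinimalDiscriminant v := by
    rw [hvs, ordMinimalDiscriminant_eq_of_int, ← huZ, hordZ uZ, huZp]; exact hpeu
  set loc : LocalRestrictionAt p ρ' :=
    { F := v.adicCompletion ℚ
      residueFieldCard_eq := residueFieldCard_adicCompletion_eq_of_natCast_mem hpv'
      irreducible_natCast := irreducible_natCast_valuativeInteger_adicCompletion_of_natCast_mem hpv'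
      rep := FramedGaloisRep.restrictField (v.adicCompletion ℚ) ρ'
      rep_eq_restrictField := rfl } with hloc
  obtain ⟨ι⟩ := nonempty_ringHom_residue (k := AlgebraicClosure (ZMod p)) p (v.adicCompletion ℚ)
    (residueFieldCard_adicCompletion_eq_of_natCast_mem hpv')
  have hw : (serreWeight p ρ' loc ι : ℤ) = 2 := by
    have h2 : serreWeight p ρ' loc ι = 2 :=
      serreWeight_eq_two_of_hasMultiplicativeReductionAt_of_dvd W p hp2 v hpv' hmultv hpordv hρ
        (AlgebraicClosure (ZMod p)) j ι
    rw [h2]; rfl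
  /- Step 4. Level-lowering: `ρ̄'` arises from a newform `f` of weight `2` and level `M ∣ N(ρ̄')`. -/
  obtain ⟨M, hMz, hMN, f, ιf, hf, hgal⟩ :=
    hLL p hodd (AlgebraicClosure (ZMod p)) ρ' hirr' hodd' hρ'mod loc ι
  revert hgal hf ιf f
  rw [hw]
  intro f ιf hf hgal
  /- Step 5'. `N(ρ̄') ∣ r^k`: no prime `q ≠ r` divides it (good ⟹ unramified; multiplicative ⟹
     `p`-carrier ⟹ Tate; `p` itself never), and `N(ρ̄') ∣ N_E` with `r^(k+1) ∤ N_E` (Ogg–Saito). -/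
  have hN0 : serreLevel p ρ' ≠ 0 := fun h0' ↦ not_dvd_serreLevel p ρ' (h0' ▸ dvd_zero p)
  have hlevN : serreLevel p ρ' ∣ W.conductorNorm ℤ :=
    serreLevel_baseChange_dvd_conductorNorm_of_tate hOS W p ρ hρ (AlgebraicClosure (ZMod p)) j
  have hNrk : serreLevel p ρ' ∣ r ^ k := by
    refine dvd_primePow_of_forall_prime_dvd_eq hN0 (fun q hq hqN ↦ ?_) hlevN hk
    by_contra hq2
    rcases eq_or_ne q p with rfl | hqp
    · exact not_dvd_serreLevel q ρ' hqN
    · obtain ⟨u, hu⟩ : ∃ u : HeightOneSpectrum ℤ, natGenerator u = q :=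
        ⟨(primesEquiv (R := ℤ)).symm ⟨q, hq⟩, Rat.natGenerator_primesEquiv_symm ⟨q, hq⟩⟩
      rcases hsstZ u (by rw [hu]; exact hq2) with hgu | hmu
      · exact not_dvd_serreLevel_baseChange_of_hasGoodReductionAt_int W p hρ j _ u
          (by rw [hu]; exact hqp) hgu (by rw [hu]; exact hqN)
      · exact not_dvd_serreLevel_baseChange_of_hasMultiplicativeReductionAt_of_dvd_int W p hρ j _ u
          (by rw [hu]; exact hqp) hmu (hunr u (by rw [hu]; exact hqp) hmu) (by rw [hu]; exact hqN)
  /- Step 6'. `M ∣ r^k`; `p ∤ φ(M)` so the nebentypus of `f` is trivial; descend to `Γ₀(M)`, where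
     there are no weight-2 cusp forms. -/
  haveI : NeZero M := hMz
  have hMrk : M ∣ r ^ k := hMN.trans hNrk
  have hε : nebentypus f = 1 :=
    nebentypus_eq_one_of_isGaloisRepOfNewform1Int_of_not_dvd_totient W hρ j (htot M hMrk) ιf hgal
      (W.conductorNorm ℤ)
      fun q _ hqB hqd ↦ absurd (Nat.le_of_dvd (conductorNorm_pos_holds W) hqd) (not_le.mpr hqB)
  obtain ⟨g, hg, -⟩ := exists_isNewform0_coe_eq_of_nebentypus_eq_one hf hε
  exact hg.ne_zero (hvan M hMrk g)

/-- **The 2-power rung, proved** (`r = 2`, `k = 4`): every ODD prime semistable and `2⁵ ∤ N_E` ⟹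
`p ∤ ord_p(Δ_min)`; levels `M ∣ 16` have `φ(M) ∣ 8` (`not_dvd_totient_of_dvd_thirtyTwo`) and
`S₂(Γ₀(M)) = 0` (`cuspForm_two_gamma0_eq_zero_of_dvd_sixteen`). -/
theorem not_dvd_ordp_of_twoPowerAdditive_of_not_ram
    (hmod : exists_isNewformOf) (hLL : diamond1995_refinedSerre)
    (hOS : ∀ (W : WeierstrassCurve ℚ) (ℓ : ℕ) [Fact ℓ.Prime],
      W.artinConductorExponent_tate_eq_conductorExponent_of_isElliptic ℓ)
    (W : WeierstrassCurve ℚ) [W.IsElliptic] [W.IsGloballyMinimal]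
    (p : ℕ) [Fact p.Prime] (hp5 : 5 ≤ p) (hmultp : Mult W p) (hirr : Irr W p) (hnram : ¬ Ram W p)
    (hodd2 : ∀ (ℓ : ℕ) [Fact ℓ.Prime], ℓ ≠ 2 →
      W.HasGoodReductionAtPrime ℓ ∨ W.HasMultiplicativeReductionAtPrime ℓ)
    (h32 : ¬ 2 ^ 5 ∣ W.conductorNorm ℤ) :
    ¬ p ∣ padicValInt p W.minimalDiscriminantInt :=
  have hp : p.Prime := Fact.out
  not_dvd_ordp_of_primePowerAdditive_of_not_ram hmod hLL hOS W p hp5 hmultp hirr hnram (k := 4)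
    hodd2 h32
    (fun M hM ↦ not_dvd_totient_of_dvd_thirtyTwo (hM.trans (by norm_num)) hp (by omega))
    (fun M _ hM f ↦ cuspForm_two_gamma0_eq_zero_of_dvd_sixteen hM f)

/-- **The 3-square rung, proved** (`r = 3`, `k = 2`): every prime `≠ 3` semistable and `3³ ∤ N_E`
(so `N_add ∣ 9`) ⟹ `p ∤ ord_p(Δ_min)`; levels `M ∣ 9` have `φ(M) ∈ {1, 2, 6}`
(`not_dvd_totient_of_dvd_nine`) and `S₂(Γ₀(M)) = 0` (`cuspForm_two_gamma0_eq_zero_of_le_ten`).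
This rung CONTAINS the semistable cut of §3 (`N(ρ̄) = 1 ∣ 9`) but uses Ogg–Saito. -/
theorem not_dvd_ordp_of_threeSquareAdditive_of_not_ram
    (hmod : exists_isNewformOf) (hLL : diamond1995_refinedSerre)
    (hOS : ∀ (W : WeierstrassCurve ℚ) (ℓ : ℕ) [Fact ℓ.Prime],
      W.artinConductorExponent_tate_eq_conductorExponent_of_isElliptic ℓ)
    (W : WeierstrassCurve ℚ) [W.IsElliptic] [W.IsGloballyMinimal]
    (p : ℕ) [Fact p.Prime] (hp5 : 5 ≤ p) (hmultp : Mult W p) (hirr : Irr W p) (hnram : ¬ Ram W p)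
    (hsemi3 : ∀ (ℓ : ℕ) [Fact ℓ.Prime], ℓ ≠ 3 →
      W.HasGoodReductionAtPrime ℓ ∨ W.HasMultiplicativeReductionAtPrime ℓ)
    (h27 : ¬ 3 ^ 3 ∣ W.conductorNorm ℤ) :
    ¬ p ∣ padicValInt p W.minimalDiscriminantInt :=
  have hp : p.Prime := Fact.out
  not_dvd_ordp_of_primePowerAdditive_of_not_ram hmod hLL hOS W p hp5 hmultp hirr hnram (k := 2)
    hsemi3 h27
    (fun M hM ↦ not_dvd_totient_of_dvd_nine (by simpa using hM) hp hp5)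
    (fun M _ hM f ↦ cuspForm_two_gamma0_eq_zero_of_le_ten
      ((Nat.le_of_dvd (by norm_num) hM).trans (by norm_num)) f)


/-- **The 5-square rung, proved** (`r = 5`, `k = 2`, `p ≥ 7`): every prime `≠ 5` semistable and `5³ ∤ N_E`
(so `N_add ∣ 25`) ⟹ `p ∤ ord_p(Δ_min)`; levels `M ∣ 25` have `φ(M) ∈ {1, 4, 20}`
(`not_dvd_totient_of_dvd_twentyFive`) and `S₂(Γ₀(M)) = 0` (`cuspForm_two_gamma0_eq_zero_of_dvd_twentyFive`).
(At `p = 5` the locus consists of semistable curves — `5` is multiplicative — and §3 applies without Ogg–Saito.) -/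
theorem not_dvd_ordp_of_fiveSquareAdditive_of_not_ram
    (hmod : exists_isNewformOf) (hLL : diamond1995_refinedSerre)
    (hOS : ∀ (W : WeierstrassCurve ℚ) (ℓ : ℕ) [Fact ℓ.Prime],
      W.artinConductorExponent_tate_eq_conductorExponent_of_isElliptic ℓ)
    (W : WeierstrassCurve ℚ) [W.IsElliptic] [W.IsGloballyMinimal]
    (p : ℕ) [Fact p.Prime] (hp7 : 7 ≤ p) (hmultp : Mult W p) (hirr : Irr W p) (hnram : ¬ Ram W p)
    (hsemi5 : ∀ (ℓ : ℕ) [Fact ℓ.Prime], ℓ ≠ 5 →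
      W.HasGoodReductionAtPrime ℓ ∨ W.HasMultiplicativeReductionAtPrime ℓ)
    (h125 : ¬ 5 ^ 3 ∣ W.conductorNorm ℤ) :
    ¬ p ∣ padicValInt p W.minimalDiscriminantInt :=
  have hp : p.Prime := Fact.out
  not_dvd_ordp_of_primePowerAdditive_of_not_ram hmod hLL hOS W p (by omega) hmultp hirr hnram (k := 2)
    hsemi5 h125
    (fun M hM ↦ not_dvd_totient_of_dvd_twentyFive (by simpa using hM) hp hp7)
    (fun M _ hM f ↦ cuspForm_two_gamma0_eq_zero_of_dvd_twentyFive (by simpa using hM) f)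

/-- **§4c, packaged: the typed rung `SelfCarrierFreeOnTwoPowerAdditiveAtFive` HOLDS** given the three printed named facts. -/
theorem selfCarrierFreeOnTwoPowerAdditiveAtFive_of (hnf : exists_isNewformOf) (hLL : diamond1995_refinedSerre)
    (hOS : ∀ (W : WeierstrassCurve ℚ) (ℓ : ℕ) [Fact ℓ.Prime],
      W.artinConductorExponent_tate_eq_conductorExponent_of_isElliptic ℓ) :
    SelfCarrierFreeOnTwoPowerAdditiveAtFive :=
  fun W _ _ p _ hp5 hM hI hnram hodd h32 ↦
    not_dvd_ordp_of_twoPowerAdditive_of_not_ram hnf hLL hOS W p hp5 hM hI hnram hodd h32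

/-- **`SelfCarrierFreeOnThreeSquareAdditiveAtFive` (TYPED and PROVED, v2):** on 19715's locus (`p ≥ 5` multiplicative, `E[p]` irreducible,
no (ram) prime) with every bad prime `≠ 3` multiplicative and `3³ ∤ N_E` (so `N_add ∣ 9`; semistable curves included): `p ∤ ord_p(Δ_min)`. -/
def SelfCarrierFreeOnThreeSquareAdditiveAtFive : Prop :=
  ∀ (W : WeierstrassCurve ℚ) [W.IsElliptic] [W.IsGloballyMinimal] (p : ℕ) [Fact p.Prime],
    5 ≤ p → Mult W p → Irr W p → ¬ Ram W p →
    (∀ (ℓ : ℕ) [Fact ℓ.Prime], ℓ ≠ 3 → W.HasGoodReductionAtPrime ℓ ∨ W.HasMultiplicativeReductionAtPrime ℓ) →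
    ¬ 3 ^ 3 ∣ W.conductorNorm ℤ →
    ¬ p ∣ padicValInt p W.minimalDiscriminantInt

/-- **§4c, packaged: `SelfCarrierFreeOnThreeSquareAdditiveAtFive` HOLDS** given the three printed named facts. -/
theorem selfCarrierFreeOnThreeSquareAdditiveAtFive_of (hnf : exists_isNewformOf) (hLL : diamond1995_refinedSerre)
    (hOS : ∀ (W : WeierstrassCurve ℚ) (ℓ : ℕ) [Fact ℓ.Prime],
      W.artinConductorExponent_tate_eq_conductorExponent_of_isElliptic ℓ) :
    SelfCarrierFreeOnThreeSquareAdditiveAtFive :=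
  fun W _ _ p _ hp5 hM hI hnram hsemi h27 ↦
    not_dvd_ordp_of_threeSquareAdditive_of_not_ram hnf hLL hOS W p hp5 hM hI hnram hsemi h27

/-- **`SelfCarrierFreeOnFiveSquareAdditiveAtFive` (TYPED and PROVED, v3):** on 19715's locus with every bad prime `≠ 5` multiplicative and
`5³ ∤ N_E` (so `N_add ∣ 25`): `p ∤ ord_p(Δ_min)` — at `p ≥ 7` by the 5-square rung, at `p = 5` the curve is semistable (§3, no Ogg–Saito). -/
def SelfCarrierFreeOnFiveSquareAdditiveAtFive : Prop :=
  ∀ (W : WeierstrassCurve ℚ) [W.IsElliptic] [W.IsGloballyMinimal] (p : ℕ) [Fact p.Prime],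
    5 ≤ p → Mult W p → Irr W p → ¬ Ram W p →
    (∀ (ℓ : ℕ) [Fact ℓ.Prime], ℓ ≠ 5 → W.HasGoodReductionAtPrime ℓ ∨ W.HasMultiplicativeReductionAtPrime ℓ) →
    ¬ 5 ^ 3 ∣ W.conductorNorm ℤ →
    ¬ p ∣ padicValInt p W.minimalDiscriminantInt

/-- **§4c, packaged: `SelfCarrierFreeOnFiveSquareAdditiveAtFive` HOLDS** given the three printed named facts (`by_cases p = 5`). -/
theorem selfCarrierFreeOnFiveSquareAdditiveAtFive_of (hnf : exists_isNewformOf) (hLL : diamond1995_refinedSerre)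
    (hOS : ∀ (W : WeierstrassCurve ℚ) (ℓ : ℕ) [Fact ℓ.Prime],
      W.artinConductorExponent_tate_eq_conductorExponent_of_isElliptic ℓ) :
    SelfCarrierFreeOnFiveSquareAdditiveAtFive := by
  intro W _ _ p _ hp5 hM hI hnram hsemi h125
  have hp : p.Prime := Fact.out
  by_cases hp5e : p = 5
  · subst hp5e
    have hsst : Semistable W := fun ℓ hℓ ↦ by
      haveI : Fact ℓ.Prime := ⟨hℓ⟩
      by_cases h5 : ℓ = 5
      · subst h5; exact Or.inr hM
      · exact hsemi ℓ h5
    exact not_dvd_ordp_of_semistable_of_not_ram hnf hLL W 5 hp5 hM hI hsst hnram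
  · have hp7 : 7 ≤ p := by
      rcases (show 6 ≤ p by omega).eq_or_lt with h6 | h6
      · exact absurd hp (h6 ▸ by decide)
      · omega
    exact not_dvd_ordp_of_fiveSquareAdditive_of_not_ram hnf hLL hOS W p hp7 hM hI hnram hsemi h125

end TwoPowerProof

/-- **§4d 19715 on the locus «every odd bad prime multiplicative, `2⁵ ∤ N_E`», over the ROUTE ITEMS** (+ `hLL`, `hOS` printed by name, HOLE 1 `hSav`):
19715's binders VERBATIM + the two extra hypotheses — PROVED. CONDITIONAL; nothing booked; 19715 NOT closed; BSD NOT proved. -/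
theorem res_twoPowerAdditiveAtFive_of_items
    (h₅ : Summit.BirchSwinnertonDyer.BirchSwinnertonDyer.Theses.ErratumRoadFive.PublishedInputsFive)
    (h₃ : Summit.BirchSwinnertonDyer.BirchSwinnertonDyer.Theses.ErratumRoadFive.X11aLowerHalf)
    (hJL : Summit.BirchSwinnertonDyer.BirchSwinnertonDyer.Theses.ErratumRoadFive.ShimuraParametrizationDataNonempty)
    (hCO : Summit.BirchSwinnertonDyer.BirchSwinnertonDyer.Theses.ErratumRoadFive.PastenComponentOrdersInput)
    (hLL : diamond1995_refinedSerre)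
    (hOS : ∀ (W : WeierstrassCurve ℚ) (ℓ : ℕ) [Fact ℓ.Prime],
      W.artinConductorExponent_tate_eq_conductorExponent_of_isElliptic ℓ)
    (hSav : ∀ (W : WeierstrassCurve ℚ) [W.IsElliptic] [W.IsGloballyMinimal] (p : ℕ) [Fact p.Prime]
      (q₁ : ℕ) [Fact q₁.Prime], ClassX11b W p → 5 ≤ p → Surj W p → ¬ Ram W p →
      W.HasSplitMultiplicativeReductionAtPrime q₁ → p ∣ padicValInt q₁ W.minimalDiscriminantInt →
      Theorems.ShimuraInertSavedDisplayAtD W p q₁) :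
    ∀ (W : WeierstrassCurve ℚ) [W.IsElliptic] [W.IsGloballyMinimal] (p : ℕ) [Fact p.Prime],
      Summit.BirchSwinnertonDyer.Rank1Residual.ClassX11b W p → 5 ≤ p →
      Literature.NumberTheory.EllipticCurves.Rank1Residual.Surj W p →
      ¬ Literature.NumberTheory.EllipticCurves.Rank1Residual.Ram W p → p ∣ W.tamagawaProduct →
      ¬ (∃ S : Finset ℕ, (∀ ℓ ∈ S, ∃ _ : Fact ℓ.Prime, Literature.NumberTheory.EllipticCurves.Rank1Residual.Mult W ℓ) ∧
          Even S.card ∧ p ∈ S ∧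
          (∀ (ℓ : ℕ) [Fact ℓ.Prime], ℓ ∉ S → W.HasSplitMultiplicativeReductionAtPrime ℓ →
            ¬ p ∣ padicValInt ℓ W.minimalDiscriminantInt) ∧
          (¬ p ∣ padicValInt p W.minimalDiscriminantInt ∨
            ∃ R ⊆ S, S.card = 2 * R.card ∧ ∀ q ∈ R, q ≠ 2 ∧ ¬ p ∣ q - 1)) →
      (∀ (ℓ : ℕ) [Fact ℓ.Prime], ℓ ≠ 2 → W.HasGoodReductionAtPrime ℓ ∨ W.HasMultiplicativeReductionAtPrime ℓ) →
      ¬ 2 ^ 5 ∣ W.conductorNorm ℤ →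
      Literature.NumberTheory.EllipticCurves.Rank1Residual.Typed.MissingUpperBoundAt W p := by
  intro W _ _ p _ hX hp5 hsurj hnram htam hnoA hodd h32
  obtain ⟨-, -, -, -, -, hGZK, hmod, hnf, -, -, hMaz, -, hFH, -, -⟩ := h₅
  exact res_twoPowerAdditiveAtFive_of_selfCarrierFree hGZK hmod hnf hFH hMaz
    localTamagawaNumber_quadraticTwist_two_mem_of_goodReduction_holds hJL hCO
    (selfCarrierFreeOnTwoPowerAdditiveAtFive_of hnf hLL hOS) (fun Wd _ _ p _ hXa ↦ h₃ Wd p hXa) hSav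
    W p hX hp5 hsurj hnram htam hodd h32 hnoA

/-- **§4b′ (v2) 19715 on the `N_add ∣ 9` locus from `SelfCarrierFreeOnThreeSquareAdditiveAtFive`** (same proof as §4b). -/
theorem res_threeSquareAdditiveAtFive_of_selfCarrierFree
    (hGZK : rank_eq_analyticRank_of_analyticRank_le_one) (hmod : hasEntireLFunction_rat)
    (hnf : exists_isNewformOf) (hFH : friedbergHoffstein_exists_twist_ne_zero_inertAt)
    (hMaz : mazur_not_dvd_maninConstant_of_odd)
    (hBR : localTamagawaNumber_quadraticTwist_two_mem_of_goodReduction)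
    (hJL : nonempty_shimuraParametrizationData)
    (hCO : PastenShimura2024_componentOrders)
    (hSCF : SelfCarrierFreeOnThreeSquareAdditiveAtFive)
    (hX11a : ∀ (Wd : WeierstrassCurve ℚ) [Wd.IsElliptic] [Wd.IsGloballyMinimal] (p : ℕ) [Fact p.Prime],
      ClassX11a Wd p → Typed.MissingLowerBoundAt Wd p)
    (hSavD : ∀ (W : WeierstrassCurve ℚ) [W.IsElliptic] [W.IsGloballyMinimal] (p : ℕ) [Fact p.Prime]
      (q₁ : ℕ) [Fact q₁.Prime], ClassX11b W p → 5 ≤ p → Surj W p → ¬ Ram W p →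
      W.HasSplitMultiplicativeReductionAtPrime q₁ → p ∣ padicValInt q₁ W.minimalDiscriminantInt →
      Theorems.ShimuraInertSavedDisplayAtD W p q₁) :
    ∀ (W : WeierstrassCurve ℚ) [W.IsElliptic] [W.IsGloballyMinimal] (p : ℕ) [Fact p.Prime],
      ClassX11b W p → 5 ≤ p → Surj W p → ¬ Ram W p → p ∣ W.tamagawaProduct →
      (∀ (ℓ : ℕ) [Fact ℓ.Prime], ℓ ≠ 3 → W.HasGoodReductionAtPrime ℓ ∨ W.HasMultiplicativeReductionAtPrime ℓ) →
      ¬ 3 ^ 3 ∣ W.conductorNorm ℤ →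
      ¬ InertSetDatum W p → Typed.MissingUpperBoundAt W p := by
  intro W _ _ p _ hX hp5 hsurj hnram htam hodd h32 hnoA
  obtain ⟨-, -, hMp, hirr⟩ := id hX
  have hp : p.Prime := Fact.out
  have hW : ¬ p ∣ padicValInt p W.minimalDiscriminantInt := hSCF W p hp5 hMp hirr hnram hodd h32
  -- a second multiplicative prime: the split `ℓ` with `p ∣ ord_ℓ Δ` dividing `∏ c` is not `p`
  have hother : ∃ ℓ : ℕ, ∃ _ : Fact ℓ.Prime, ℓ ≠ p ∧ W.HasMultiplicativeReductionAtPrime ℓ := by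
    obtain ⟨ℓ, _, hs, hd⟩ := (dvd_tamagawaProduct_iff_exists_split W hp hp5).mp htam
    refine ⟨ℓ, ‹_›, ?_, hs.hasMultiplicativeReductionAtPrime⟩
    rintro rfl
    exact hW hd
  have hB : UpToOneSharpDatum W p := by
    by_contra hnoB
    exact hW (allCarriers_of_not_inertSetDatum_of_not_upToOneSharpDatum W p hp5 hMp hother hnoA hnoB p hMp)
  exact res_upToOneSharpAtFive_of_savedDisplayD_of_lowerX11a hGZK hmod hnf hFH hMaz hBR hJL hCO hX11a hSavD W p hX hp5 hsurj hnram hB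

/-- **§4d′ (v2) 19715 on the locus «every bad prime `≠ 3` multiplicative, `3³ ∤ N_E`» over the ROUTE ITEMS** (+ `hLL`, `hOS`, HOLE 1) — PROVED.
CONDITIONAL; nothing booked; 19715 NOT closed; BSD NOT proved. -/
theorem res_threeSquareAdditiveAtFive_of_items
    (h₅ : Summit.BirchSwinnertonDyer.BirchSwinnertonDyer.Theses.ErratumRoadFive.PublishedInputsFive)
    (h₃ : Summit.BirchSwinnertonDyer.BirchSwinnertonDyer.Theses.ErratumRoadFive.X11aLowerHalf)
    (hJL : Summit.BirchSwinnertonDyer.BirchSwinnertonDyer.Theses.ErratumRoadFive.ShimuraParametrizationDataNonempty)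
    (hCO : Summit.BirchSwinnertonDyer.BirchSwinnertonDyer.Theses.ErratumRoadFive.PastenComponentOrdersInput)
    (hLL : diamond1995_refinedSerre)
    (hOS : ∀ (W : WeierstrassCurve ℚ) (ℓ : ℕ) [Fact ℓ.Prime],
      W.artinConductorExponent_tate_eq_conductorExponent_of_isElliptic ℓ)
    (hSav : ∀ (W : WeierstrassCurve ℚ) [W.IsElliptic] [W.IsGloballyMinimal] (p : ℕ) [Fact p.Prime]
      (q₁ : ℕ) [Fact q₁.Prime], ClassX11b W p → 5 ≤ p → Surj W p → ¬ Ram W p →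
      W.HasSplitMultiplicativeReductionAtPrime q₁ → p ∣ padicValInt q₁ W.minimalDiscriminantInt →
      Theorems.ShimuraInertSavedDisplayAtD W p q₁) :
    ∀ (W : WeierstrassCurve ℚ) [W.IsElliptic] [W.IsGloballyMinimal] (p : ℕ) [Fact p.Prime],
      Summit.BirchSwinnertonDyer.Rank1Residual.ClassX11b W p → 5 ≤ p →
      Literature.NumberTheory.EllipticCurves.Rank1Residual.Surj W p →
      ¬ Literature.NumberTheory.EllipticCurves.Rank1Residual.Ram W p → p ∣ W.tamagawaProduct →
      ¬ (∃ S : Finset ℕ, (∀ ℓ ∈ S, ∃ _ : Fact ℓ.Prime, Literature.NumberTheory.EllipticCurves.Rank1Residual.Mult W ℓ) ∧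
          Even S.card ∧ p ∈ S ∧
          (∀ (ℓ : ℕ) [Fact ℓ.Prime], ℓ ∉ S → W.HasSplitMultiplicativeReductionAtPrime ℓ →
            ¬ p ∣ padicValInt ℓ W.minimalDiscriminantInt) ∧
          (¬ p ∣ padicValInt p W.minimalDiscriminantInt ∨
            ∃ R ⊆ S, S.card = 2 * R.card ∧ ∀ q ∈ R, q ≠ 2 ∧ ¬ p ∣ q - 1)) →
      (∀ (ℓ : ℕ) [Fact ℓ.Prime], ℓ ≠ 3 → W.HasGoodReductionAtPrime ℓ ∨ W.HasMultiplicativeReductionAtPrime ℓ) →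
      ¬ 3 ^ 3 ∣ W.conductorNorm ℤ →
      Literature.NumberTheory.EllipticCurves.Rank1Residual.Typed.MissingUpperBoundAt W p := by
  intro W _ _ p _ hX hp5 hsurj hnram htam hnoA hsemi h27
  obtain ⟨-, -, -, -, -, hGZK, hmod, hnf, -, -, hMaz, -, hFH, -, -⟩ := h₅
  exact res_threeSquareAdditiveAtFive_of_selfCarrierFree hGZK hmod hnf hFH hMaz
    localTamagawaNumber_quadraticTwist_two_mem_of_goodReduction_holds hJL hCO
    (selfCarrierFreeOnThreeSquareAdditiveAtFive_of hnf hLL hOS) (fun Wd _ _ p _ hXa ↦ h₃ Wd p hXa) hSav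
    W p hX hp5 hsurj hnram htam hsemi h27 hnoA

/-- **§4b″ (v3) 19715 on the `N_add ∣ 25` locus from `SelfCarrierFreeOnFiveSquareAdditiveAtFive`** (same proof as §4b). -/
theorem res_fiveSquareAdditiveAtFive_of_selfCarrierFree
    (hGZK : rank_eq_analyticRank_of_analyticRank_le_one) (hmod : hasEntireLFunction_rat)
    (hnf : exists_isNewformOf) (hFH : friedbergHoffstein_exists_twist_ne_zero_inertAt)
    (hMaz : mazur_not_dvd_maninConstant_of_odd)
    (hBR : localTamagawaNumber_quadraticTwist_two_mem_of_goodReduction)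
    (hJL : nonempty_shimuraParametrizationData)
    (hCO : PastenShimura2024_componentOrders)
    (hSCF : SelfCarrierFreeOnFiveSquareAdditiveAtFive)
    (hX11a : ∀ (Wd : WeierstrassCurve ℚ) [Wd.IsElliptic] [Wd.IsGloballyMinimal] (p : ℕ) [Fact p.Prime],
      ClassX11a Wd p → Typed.MissingLowerBoundAt Wd p)
    (hSavD : ∀ (W : WeierstrassCurve ℚ) [W.IsElliptic] [W.IsGloballyMinimal] (p : ℕ) [Fact p.Prime]
      (q₁ : ℕ) [Fact q₁.Prime], ClassX11b W p → 5 ≤ p → Surj W p → ¬ Ram W p →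
      W.HasSplitMultiplicativeReductionAtPrime q₁ → p ∣ padicValInt q₁ W.minimalDiscriminantInt →
      Theorems.ShimuraInertSavedDisplayAtD W p q₁) :
    ∀ (W : WeierstrassCurve ℚ) [W.IsElliptic] [W.IsGloballyMinimal] (p : ℕ) [Fact p.Prime],
      ClassX11b W p → 5 ≤ p → Surj W p → ¬ Ram W p → p ∣ W.tamagawaProduct →
      (∀ (ℓ : ℕ) [Fact ℓ.Prime], ℓ ≠ 5 → W.HasGoodReductionAtPrime ℓ ∨ W.HasMultiplicativeReductionAtPrime ℓ) →
      ¬ 5 ^ 3 ∣ W.conductorNorm ℤ →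
      ¬ InertSetDatum W p → Typed.MissingUpperBoundAt W p := by
  intro W _ _ p _ hX hp5 hsurj hnram htam hodd h32 hnoA
  obtain ⟨-, -, hMp, hirr⟩ := id hX
  have hp : p.Prime := Fact.out
  have hW : ¬ p ∣ padicValInt p W.minimalDiscriminantInt := hSCF W p hp5 hMp hirr hnram hodd h32
  -- a second multiplicative prime: the split `ℓ` with `p ∣ ord_ℓ Δ` dividing `∏ c` is not `p`
  have hother : ∃ ℓ : ℕ, ∃ _ : Fact ℓ.Prime, ℓ ≠ p ∧ W.HasMultiplicativeReductionAtPrime ℓ := by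
    obtain ⟨ℓ, _, hs, hd⟩ := (dvd_tamagawaProduct_iff_exists_split W hp hp5).mp htam
    refine ⟨ℓ, ‹_›, ?_, hs.hasMultiplicativeReductionAtPrime⟩
    rintro rfl
    exact hW hd
  have hB : UpToOneSharpDatum W p := by
    by_contra hnoB
    exact hW (allCarriers_of_not_inertSetDatum_of_not_upToOneSharpDatum W p hp5 hMp hother hnoA hnoB p hMp)
  exact res_upToOneSharpAtFive_of_savedDisplayD_of_lowerX11a hGZK hmod hnf hFH hMaz hBR hJL hCO hX11a hSavD W p hX hp5 hsurj hnram hB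

/-- **§4d″ (v3) 19715 on the locus «every bad prime `≠ 5` multiplicative, `5³ ∤ N_E`» over the ROUTE ITEMS** (+ `hLL`, `hOS`, HOLE 1) — PROVED.
CONDITIONAL; nothing booked; 19715 NOT closed; BSD NOT proved. -/
theorem res_fiveSquareAdditiveAtFive_of_items
    (h₅ : Summit.BirchSwinnertonDyer.BirchSwinnertonDyer.Theses.ErratumRoadFive.PublishedInputsFive)
    (h₃ : Summit.BirchSwinnertonDyer.BirchSwinnertonDyer.Theses.ErratumRoadFive.X11aLowerHalf)
    (hJL : Summit.BirchSwinnertonDyer.BirchSwinnertonDyer.Theses.ErratumRoadFive.ShimuraParametrizationDataNonempty)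
    (hCO : Summit.BirchSwinnertonDyer.BirchSwinnertonDyer.Theses.ErratumRoadFive.PastenComponentOrdersInput)
    (hLL : diamond1995_refinedSerre)
    (hOS : ∀ (W : WeierstrassCurve ℚ) (ℓ : ℕ) [Fact ℓ.Prime],
      W.artinConductorExponent_tate_eq_conductorExponent_of_isElliptic ℓ)
    (hSav : ∀ (W : WeierstrassCurve ℚ) [W.IsElliptic] [W.IsGloballyMinimal] (p : ℕ) [Fact p.Prime]
      (q₁ : ℕ) [Fact q₁.Prime], ClassX11b W p → 5 ≤ p → Surj W p → ¬ Ram W p →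
      W.HasSplitMultiplicativeReductionAtPrime q₁ → p ∣ padicValInt q₁ W.minimalDiscriminantInt →
      Theorems.ShimuraInertSavedDisplayAtD W p q₁) :
    ∀ (W : WeierstrassCurve ℚ) [W.IsElliptic] [W.IsGloballyMinimal] (p : ℕ) [Fact p.Prime],
      Summit.BirchSwinnertonDyer.Rank1Residual.ClassX11b W p → 5 ≤ p →
      Literature.NumberTheory.EllipticCurves.Rank1Residual.Surj W p →
      ¬ Literature.NumberTheory.EllipticCurves.Rank1Residual.Ram W p → p ∣ W.tamagawaProduct →
      ¬ (∃ S : Finset ℕ, (∀ ℓ ∈ S, ∃ _ : Fact ℓ.Prime, Literature.NumberTheory.EllipticCurves.Rank1Residual.Mult W ℓ) ∧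
          Even S.card ∧ p ∈ S ∧
          (∀ (ℓ : ℕ) [Fact ℓ.Prime], ℓ ∉ S → W.HasSplitMultiplicativeReductionAtPrime ℓ →
            ¬ p ∣ padicValInt ℓ W.minimalDiscriminantInt) ∧
          (¬ p ∣ padicValInt p W.minimalDiscriminantInt ∨
            ∃ R ⊆ S, S.card = 2 * R.card ∧ ∀ q ∈ R, q ≠ 2 ∧ ¬ p ∣ q - 1)) →
      (∀ (ℓ : ℕ) [Fact ℓ.Prime], ℓ ≠ 5 → W.HasGoodReductionAtPrime ℓ ∨ W.HasMultiplicativeReductionAtPrime ℓ) →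
      ¬ 5 ^ 3 ∣ W.conductorNorm ℤ →
      Literature.NumberTheory.EllipticCurves.Rank1Residual.Typed.MissingUpperBoundAt W p := by
  intro W _ _ p _ hX hp5 hsurj hnram htam hnoA hsemi h27
  obtain ⟨-, -, -, -, -, hGZK, hmod, hnf, -, -, hMaz, -, hFH, -, -⟩ := h₅
  exact res_fiveSquareAdditiveAtFive_of_selfCarrierFree hGZK hmod hnf hFH hMaz
    localTamagawaNumber_quadraticTwist_two_mem_of_goodReduction_holds hJL hCO
    (selfCarrierFreeOnFiveSquareAdditiveAtFive_of hnf hLL hOS) (fun Wd _ _ p _ hXa ↦ h₃ Wd p hXa) hSav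
    W p hX hp5 hsurj hnram htam hsemi h27 hnoA

/-! ### §5 The v9 residual stub S2c″ restricted to SEMISTABLE curves is CLOSED by the cut; the honest remaining residual is its NON-semistable part -/

/-- **v9's `stub_res_otherMultThreeBadOffendingAtFive` (S2c″) statement VERBATIM with ONE extra hypothesis `Semistable W` — PROVED** from §3f (the three
bad offenders, the split-set and up-to-one exclusions are not even used: on a semistable pair the (W)-witness at `p` is free, so ¬(A) forces (B♯)).
CONDITIONAL on the items, HOLE 1 (`hSav`) and the printed `diamond1995_refinedSerre`; nothing booked; 19715 NOT closed. -/
theorem res_threeBadOffending_semistable_of_items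
    (h₅ : Summit.BirchSwinnertonDyer.BirchSwinnertonDyer.Theses.ErratumRoadFive.PublishedInputsFive)
    (h₃ : Summit.BirchSwinnertonDyer.BirchSwinnertonDyer.Theses.ErratumRoadFive.X11aLowerHalf)
    (hJL : Summit.BirchSwinnertonDyer.BirchSwinnertonDyer.Theses.ErratumRoadFive.ShimuraParametrizationDataNonempty)
    (hCO : Summit.BirchSwinnertonDyer.BirchSwinnertonDyer.Theses.ErratumRoadFive.PastenComponentOrdersInput)
    (hLL : diamond1995_refinedSerre)
    (hSav : ∀ (W : WeierstrassCurve ℚ) [W.IsElliptic] [W.IsGloballyMinimal] (p : ℕ) [Fact p.Prime]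
      (q₁ : ℕ) [Fact q₁.Prime], ClassX11b W p → 5 ≤ p → Surj W p → ¬ Ram W p →
      W.HasSplitMultiplicativeReductionAtPrime q₁ → p ∣ padicValInt q₁ W.minimalDiscriminantInt →
      Theorems.ShimuraInertSavedDisplayAtD W p q₁) :
    ∀ (W : WeierstrassCurve ℚ) [W.IsElliptic] [W.IsGloballyMinimal] (p : ℕ) [Fact p.Prime], Summit.BirchSwinnertonDyer.Rank1Residual.ClassX11b W p → 5 ≤ p → Literature.NumberTheory.EllipticCurves.Rank1Residual.Surj W p → ¬ Literature.NumberTheory.EllipticCurves.Rank1Residual.Ram W p → p ∣ W.tamagawaProduct → (∃ ℓ : ℕ, ∃ _ : Fact ℓ.Prime, ℓ ≠ p ∧ W.HasMultiplicativeReductionAtPrime ℓ) → 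
      (∃ (q₁ q₂ q₃ : ℕ) (_ : Fact q₁.Prime) (_ : Fact q₂.Prime) (_ : Fact q₃.Prime),
        q₁ ≠ p ∧ q₂ ≠ p ∧ q₃ ≠ p ∧ q₁ ≠ q₂ ∧ q₁ ≠ q₃ ∧ q₂ ≠ q₃ ∧
        (W.HasSplitMultiplicativeReductionAtPrime q₁ ∧ p ∣ padicValInt q₁ W.minimalDiscriminantInt ∧ (q₁ = 2 ∨ p ∣ q₁ - 1)) ∧
        (W.HasSplitMultiplicativeReductionAtPrime q₂ ∧ p ∣ padicValInt q₂ W.minimalDiscriminantInt ∧ (q₂ = 2 ∨ p ∣ q₂ - 1)) ∧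
        (W.HasSplitMultiplicativeReductionAtPrime q₃ ∧ p ∣ padicValInt q₃ W.minimalDiscriminantInt ∧ (q₃ = 2 ∨ p ∣ q₃ - 1))) →
      ¬ (∃ S : Finset ℕ, (∀ ℓ ∈ S, ∃ _ : Fact ℓ.Prime, Literature.NumberTheory.EllipticCurves.Rank1Residual.Mult W ℓ) ∧ Even S.card ∧ p ∈ S ∧ (∀ (ℓ : ℕ) [Fact ℓ.Prime], ℓ ∉ S → W.HasSplitMultiplicativeReductionAtPrime ℓ → ¬ p ∣ padicValInt ℓ W.minimalDiscriminantInt) ∧ (¬ p ∣ padicValInt p W.minimalDiscriminantInt ∨ ∃ R ⊆ S, S.card = 2 * R.card ∧ ∀ q ∈ R, q ≠ 2 ∧ ¬ p ∣ q - 1)) → ¬ (∃ S : Finset ℕ, (∀ ℓ ∈ S, ∃ _ : Fact ℓ.Prime, Literature.NumberTheory.EllipticCurves.Rank1Residual.Mult W ℓ) ∧ Even S.card ∧ p ∉ S ∧ (∀ (ℓ : ℕ) [Fact ℓ.Prime], ℓ ∉ S → W.HasSplitMultiplicativeReductionAtPrime ℓ → ¬ p ∣ padicValInt ℓ W.minimalDiscriminantInt)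 ∧ ((∃ (ℓ₀ : ℕ) (_ : Fact ℓ₀.Prime), Literature.NumberTheory.EllipticCurves.Rank1Residual.Mult W ℓ₀ ∧ ℓ₀ ≠ p ∧ ¬ p ∣ padicValInt ℓ₀ W.minimalDiscriminantInt) ∨ ∃ R ⊆ S, S.card = 2 * R.card ∧ ∀ q ∈ R, ¬ p ∣ q - 1)) →
      ¬ (∃ (q₁ : ℕ) (_ : Fact q₁.Prime) (S : Finset ℕ), W.HasSplitMultiplicativeReductionAtPrime q₁ ∧
        p ∣ padicValInt q₁ W.minimalDiscriminantInt ∧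
        (∀ ℓ ∈ S, ∃ _ : Fact ℓ.Prime, Literature.NumberTheory.EllipticCurves.Rank1Residual.Mult W ℓ) ∧ Even S.card ∧ p ∈ S ∧ q₁ ∉ S ∧
        (∀ (ℓ : ℕ) [Fact ℓ.Prime], ℓ ∉ S → ℓ ≠ q₁ → W.HasSplitMultiplicativeReductionAtPrime ℓ →
          ¬ p ∣ padicValInt ℓ W.minimalDiscriminantInt) ∧
        ∃ R ⊆ S, S.card = 2 * R.card ∧ ∀ q ∈ R, q ≠ 2 ∧ ¬ p ∣ q - 1) →
      Literature.NumberTheory.EllipticCurves.Rank1Residual.Semistable W →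
      Literature.NumberTheory.EllipticCurves.Rank1Residual.Typed.MissingUpperBoundAt W p :=
  fun W _ _ p _ hX hp5 hsurj hnram htam _ _ hnoA _ _ hsst ↦
    res_semistableAtFive_of_items h₅ h₃ hJL hCO hLL hSav W p hX hp5 hsurj hnram htam hnoA hsst

/-- **`ResThreeBadOffendingNonSemistableAtFive` (TYPED `def`, nothing asserted): the HONEST residual of S2c″ after the level-lowering cut** — v9's S2c″
statement VERBATIM with the extra hypothesis `¬ Semistable W` (at least one additive prime). This is where level lowering to level `N(ρ̄) ∣ N_add` meets
weight-2 newforms (e.g. `N_add = 27, 49, 121, …` in the lead's census) and gives no contradiction by itself. -/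
def ResThreeBadOffendingNonSemistableAtFive : Prop :=
    ∀ (W : WeierstrassCurve ℚ) [W.IsElliptic] [W.IsGloballyMinimal] (p : ℕ) [Fact p.Prime], Summit.BirchSwinnertonDyer.Rank1Residual.ClassX11b W p → 5 ≤ p → Literature.NumberTheory.EllipticCurves.Rank1Residual.Surj W p → ¬ Literature.NumberTheory.EllipticCurves.Rank1Residual.Ram W p → p ∣ W.tamagawaProduct → (∃ ℓ : ℕ, ∃ _ : Fact ℓ.Prime, ℓ ≠ p ∧ W.HasMultiplicativeReductionAtPrime ℓ) → 
      (∃ (q₁ q₂ q₃ : ℕ) (_ : Fact q₁.Prime) (_ : Fact q₂.Prime) (_ : Fact q₃.Prime),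
        q₁ ≠ p ∧ q₂ ≠ p ∧ q₃ ≠ p ∧ q₁ ≠ q₂ ∧ q₁ ≠ q₃ ∧ q₂ ≠ q₃ ∧
        (W.HasSplitMultiplicativeReductionAtPrime q₁ ∧ p ∣ padicValInt q₁ W.minimalDiscriminantInt ∧ (q₁ = 2 ∨ p ∣ q₁ - 1)) ∧
        (W.HasSplitMultiplicativeReductionAtPrime q₂ ∧ p ∣ padicValInt q₂ W.minimalDiscriminantInt ∧ (q₂ = 2 ∨ p ∣ q₂ - 1)) ∧
        (W.HasSplitMultiplicativeReductionAtPrime q₃ ∧ p ∣ padicValInt q₃ W.minimalDiscriminantInt ∧ (q₃ = 2 ∨ p ∣ q₃ - 1))) →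
      ¬ (∃ S : Finset ℕ, (∀ ℓ ∈ S, ∃ _ : Fact ℓ.Prime, Literature.NumberTheory.EllipticCurves.Rank1Residual.Mult W ℓ) ∧ Even S.card ∧ p ∈ S ∧ (∀ (ℓ : ℕ) [Fact ℓ.Prime], ℓ ∉ S → W.HasSplitMultiplicativeReductionAtPrime ℓ → ¬ p ∣ padicValInt ℓ W.minimalDiscriminantInt) ∧ (¬ p ∣ padicValInt p W.minimalDiscriminantInt ∨ ∃ R ⊆ S, S.card = 2 * R.card ∧ ∀ q ∈ R, q ≠ 2 ∧ ¬ p ∣ q - 1)) → ¬ (∃ S : Finset ℕ, (∀ ℓ ∈ S, ∃ _ : Fact ℓ.Prime, Literature.NumberTheory.EllipticCurves.Rank1Residual.Mult W ℓ) ∧ Even S.card ∧ p ∉ S ∧ (∀ (ℓ : ℕ) [Fact ℓ.Prime], ℓ ∉ S → W.HasSplitMultiplicativeReductionAtPrime ℓ → ¬ p ∣ padicValInt ℓ W.minimalDiscriminantInt) ∧ ((∃ (ℓ₀ : ℕ) (_ : Fact ℓ₀.Prime), Literature.NumberTheory.EllipticCurves.Rank1Residual.Mult W ℓ₀ ∧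 ℓ₀ ≠ p ∧ ¬ p ∣ padicValInt ℓ₀ W.minimalDiscriminantInt) ∨ ∃ R ⊆ S, S.card = 2 * R.card ∧ ∀ q ∈ R, ¬ p ∣ q - 1)) →
      ¬ (∃ (q₁ : ℕ) (_ : Fact q₁.Prime) (S : Finset ℕ), W.HasSplitMultiplicativeReductionAtPrime q₁ ∧
        p ∣ padicValInt q₁ W.minimalDiscriminantInt ∧
        (∀ ℓ ∈ S, ∃ _ : Fact ℓ.Prime, Literature.NumberTheory.EllipticCurves.Rank1Residual.Mult W ℓ) ∧ Even S.card ∧ p ∈ S ∧ q₁ ∉ S ∧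
        (∀ (ℓ : ℕ) [Fact ℓ.Prime], ℓ ∉ S → ℓ ≠ q₁ → W.HasSplitMultiplicativeReductionAtPrime ℓ →
          ¬ p ∣ padicValInt ℓ W.minimalDiscriminantInt) ∧
        ∃ R ⊆ S, S.card = 2 * R.card ∧ ∀ q ∈ R, q ≠ 2 ∧ ¬ p ∣ q - 1) →
      ¬ Literature.NumberTheory.EllipticCurves.Rank1Residual.Semistable W →
      Literature.NumberTheory.EllipticCurves.Rank1Residual.Typed.MissingUpperBoundAt W p

/-- **S2c″ ⟸ its non-semistable part** (given the items, HOLE 1 and `diamond1995_refinedSerre`): the v10 graft option — replace the residual stub by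
`ResThreeBadOffendingNonSemistableAtFive` at the price of ONE printed by-name input. Bookkeeping (`by_cases` on `Semistable W`). -/
theorem res_threeBadOffending_of_nonSemistable_of_items
    (h₅ : Summit.BirchSwinnertonDyer.BirchSwinnertonDyer.Theses.ErratumRoadFive.PublishedInputsFive)
    (h₃ : Summit.BirchSwinnertonDyer.BirchSwinnertonDyer.Theses.ErratumRoadFive.X11aLowerHalf)
    (hJL : Summit.BirchSwinnertonDyer.BirchSwinnertonDyer.Theses.ErratumRoadFive.ShimuraParametrizationDataNonempty)
    (hCO : Summit.BirchSwinnertonDyer.BirchSwinnertonDyer.Theses.ErratumRoadFive.PastenComponentOrdersInput)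
    (hLL : diamond1995_refinedSerre)
    (hSav : ∀ (W : WeierstrassCurve ℚ) [W.IsElliptic] [W.IsGloballyMinimal] (p : ℕ) [Fact p.Prime]
      (q₁ : ℕ) [Fact q₁.Prime], ClassX11b W p → 5 ≤ p → Surj W p → ¬ Ram W p →
      W.HasSplitMultiplicativeReductionAtPrime q₁ → p ∣ padicValInt q₁ W.minimalDiscriminantInt →
      Theorems.ShimuraInertSavedDisplayAtD W p q₁)
    (hNS : ResThreeBadOffendingNonSemistableAtFive) :
    ∀ (W : WeierstrassCurve ℚ) [W.IsElliptic] [W.IsGloballyMinimal] (p : ℕ) [Fact p.Prime], Summit.BirchSwinnertonDyer.Rank1Residual.ClassX11b W p → 5 ≤ p → Literature.NumberTheory.EllipticCurves.Rank1Residual.Surj W p → ¬ Literature.NumberTheory.EllipticCurves.Rank1Residual.Ram W p → p ∣ W.tamagawaProduct → (∃ ℓ : ℕ, ∃ _ : Fact ℓ.Prime, ℓ ≠ p ∧ W.HasMultiplicativeReductionAtPrime ℓ) → 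
      (∃ (q₁ q₂ q₃ : ℕ) (_ : Fact q₁.Prime) (_ : Fact q₂.Prime) (_ : Fact q₃.Prime),
        q₁ ≠ p ∧ q₂ ≠ p ∧ q₃ ≠ p ∧ q₁ ≠ q₂ ∧ q₁ ≠ q₃ ∧ q₂ ≠ q₃ ∧
        (W.HasSplitMultiplicativeReductionAtPrime q₁ ∧ p ∣ padicValInt q₁ W.minimalDiscriminantInt ∧ (q₁ = 2 ∨ p ∣ q₁ - 1)) ∧
        (W.HasSplitMultiplicativeReductionAtPrime q₂ ∧ p ∣ padicValInt q₂ W.minimalDiscriminantInt ∧ (q₂ = 2 ∨ p ∣ q₂ - 1)) ∧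
        (W.HasSplitMultiplicativeReductionAtPrime q₃ ∧ p ∣ padicValInt q₃ W.minimalDiscriminantInt ∧ (q₃ = 2 ∨ p ∣ q₃ - 1))) →
      ¬ (∃ S : Finset ℕ, (∀ ℓ ∈ S, ∃ _ : Fact ℓ.Prime, Literature.NumberTheory.EllipticCurves.Rank1Residual.Mult W ℓ) ∧ Even S.card ∧ p ∈ S ∧ (∀ (ℓ : ℕ) [Fact ℓ.Prime], ℓ ∉ S → W.HasSplitMultiplicativeReductionAtPrime ℓ → ¬ p ∣ padicValInt ℓ W.minimalDiscriminantInt) ∧ (¬ p ∣ padicValInt p W.minimalDiscriminantInt ∨ ∃ R ⊆ S, S.card = 2 * R.card ∧ ∀ q ∈ R, q ≠ 2 ∧ ¬ p ∣ q - 1)) → ¬ (∃ S : Finset ℕ, (∀ ℓ ∈ S, ∃ _ : Fact ℓ.Prime, Literature.NumberTheory.EllipticCurves.Rank1Residual.Mult W ℓ) ∧ Even S.card ∧ p ∉ S ∧ (∀ (ℓ : ℕ) [Fact ℓ.Prime], ℓ ∉ S → W.HasSplitMultiplicativeReductionAtPrime ℓ → ¬ p ∣ padicValInt ℓ W.minimalDiscriminantInt)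 ∧ ((∃ (ℓ₀ : ℕ) (_ : Fact ℓ₀.Prime), Literature.NumberTheory.EllipticCurves.Rank1Residual.Mult W ℓ₀ ∧ ℓ₀ ≠ p ∧ ¬ p ∣ padicValInt ℓ₀ W.minimalDiscriminantInt) ∨ ∃ R ⊆ S, S.card = 2 * R.card ∧ ∀ q ∈ R, ¬ p ∣ q - 1)) →
      ¬ (∃ (q₁ : ℕ) (_ : Fact q₁.Prime) (S : Finset ℕ), W.HasSplitMultiplicativeReductionAtPrime q₁ ∧
        p ∣ padicValInt q₁ W.minimalDiscriminantInt ∧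
        (∀ ℓ ∈ S, ∃ _ : Fact ℓ.Prime, Literature.NumberTheory.EllipticCurves.Rank1Residual.Mult W ℓ) ∧ Even S.card ∧ p ∈ S ∧ q₁ ∉ S ∧
        (∀ (ℓ : ℕ) [Fact ℓ.Prime], ℓ ∉ S → ℓ ≠ q₁ → W.HasSplitMultiplicativeReductionAtPrime ℓ →
          ¬ p ∣ padicValInt ℓ W.minimalDiscriminantInt) ∧
        ∃ R ⊆ S, S.card = 2 * R.card ∧ ∀ q ∈ R, q ≠ 2 ∧ ¬ p ∣ q - 1) →
      Literature.NumberTheory.EllipticCurves.Rank1Residual.Typed.MissingUpperBoundAt W p := by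
  intro W _ _ p _ hX hp5 hsurj hnram htam hother h3 hnoA hnoD hnoB
  by_cases hsst : Semistable W
  · exact res_semistableAtFive_of_items h₅ h₃ hJL hCO hLL hSav W p hX hp5 hsurj hnram htam hnoA hsst
  · exact hNS W p hX hp5 hsurj hnram htam hother h3 hnoA hnoD hnoB hsst

/-! ### §4e (v2) The v9 residual stub S2c″ on the locus «odd bad primes multiplicative, `2⁵ ∤ N_E`» is CLOSED too; the honest residual RE-TYPED -/

/-- **`ResThreeBadOffendingOddAdditiveOrDeepTwoAtFive` (TYPED `def`, nothing asserted): the HONEST residual of S2c″ after BOTH cuts (§3 semistable, §4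
2-power)** — v9's S2c″ statement VERBATIM with the extra hypothesis «NOT (every odd bad prime is multiplicative and `2⁵ ∤ N_E`)», i.e. the curve has an
odd additive prime or `2⁵ ∣ N_E`. (A semistable curve satisfies the negated clause, so this def also absorbs `ResThreeBadOffendingNonSemistableAtFive`.) -/
def ResThreeBadOffendingOddAdditiveOrDeepTwoAtFive : Prop :=
    ∀ (W : WeierstrassCurve ℚ) [W.IsElliptic] [W.IsGloballyMinimal] (p : ℕ) [Fact p.Prime], Summit.BirchSwinnertonDyer.Rank1Residual.ClassX11b W p → 5 ≤ p → Literature.NumberTheory.EllipticCurves.Rank1Residual.Surj W p → ¬ Literature.NumberTheory.EllipticCurves.Rank1Residual.Ram W p → p ∣ W.tamagawaProduct → (∃ ℓ : ℕ, ∃ _ : Fact ℓ.Prime, ℓ ≠ p ∧ W.HasMultiplicativeReductionAtPrime ℓ) → 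
      (∃ (q₁ q₂ q₃ : ℕ) (_ : Fact q₁.Prime) (_ : Fact q₂.Prime) (_ : Fact q₃.Prime),
        q₁ ≠ p ∧ q₂ ≠ p ∧ q₃ ≠ p ∧ q₁ ≠ q₂ ∧ q₁ ≠ q₃ ∧ q₂ ≠ q₃ ∧
        (W.HasSplitMultiplicativeReductionAtPrime q₁ ∧ p ∣ padicValInt q₁ W.minimalDiscriminantInt ∧ (q₁ = 2 ∨ p ∣ q₁ - 1)) ∧
        (W.HasSplitMultiplicativeReductionAtPrime q₂ ∧ p ∣ padicValInt q₂ W.minimalDiscriminantInt ∧ (q₂ = 2 ∨ p ∣ q₂ - 1)) ∧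
        (W.HasSplitMultiplicativeReductionAtPrime q₃ ∧ p ∣ padicValInt q₃ W.minimalDiscriminantInt ∧ (q₃ = 2 ∨ p ∣ q₃ - 1))) →
      ¬ (∃ S : Finset ℕ, (∀ ℓ ∈ S, ∃ _ : Fact ℓ.Prime, Literature.NumberTheory.EllipticCurves.Rank1Residual.Mult W ℓ) ∧ Even S.card ∧ p ∈ S ∧ (∀ (ℓ : ℕ) [Fact ℓ.Prime], ℓ ∉ S → W.HasSplitMultiplicativeReductionAtPrime ℓ → ¬ p ∣ padicValInt ℓ W.minimalDiscriminantInt) ∧ (¬ p ∣ padicValInt p W.minimalDiscriminantInt ∨ ∃ R ⊆ S, S.card = 2 * R.card ∧ ∀ q ∈ R, q ≠ 2 ∧ ¬ p ∣ q - 1)) → ¬ (∃ S : Finset ℕ, (∀ ℓ ∈ S, ∃ _ : Fact ℓ.Prime, Literature.NumberTheory.EllipticCurves.Rank1Residual.Mult W ℓ) ∧ Even S.card ∧ p ∉ S ∧ (∀ (ℓ : ℕ) [Fact ℓ.Prime], ℓ ∉ S → W.HasSplitMultiplicativeReductionAtPrime ℓ → ¬ p ∣ padicValInt ℓ W.minimalDiscriminantInt)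 ∧ ((∃ (ℓ₀ : ℕ) (_ : Fact ℓ₀.Prime), Literature.NumberTheory.EllipticCurves.Rank1Residual.Mult W ℓ₀ ∧ ℓ₀ ≠ p ∧ ¬ p ∣ padicValInt ℓ₀ W.minimalDiscriminantInt) ∨ ∃ R ⊆ S, S.card = 2 * R.card ∧ ∀ q ∈ R, ¬ p ∣ q - 1)) →
      ¬ (∃ (q₁ : ℕ) (_ : Fact q₁.Prime) (S : Finset ℕ), W.HasSplitMultiplicativeReductionAtPrime q₁ ∧
        p ∣ padicValInt q₁ W.minimalDiscriminantInt ∧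
        (∀ ℓ ∈ S, ∃ _ : Fact ℓ.Prime, Literature.NumberTheory.EllipticCurves.Rank1Residual.Mult W ℓ) ∧ Even S.card ∧ p ∈ S ∧ q₁ ∉ S ∧
        (∀ (ℓ : ℕ) [Fact ℓ.Prime], ℓ ∉ S → ℓ ≠ q₁ → W.HasSplitMultiplicativeReductionAtPrime ℓ →
          ¬ p ∣ padicValInt ℓ W.minimalDiscriminantInt) ∧
        ∃ R ⊆ S, S.card = 2 * R.card ∧ ∀ q ∈ R, q ≠ 2 ∧ ¬ p ∣ q - 1) →
      ¬ ((∀ (ℓ : ℕ) [Fact ℓ.Prime], ℓ ≠ 2 → W.HasGoodReductionAtPrime ℓ ∨ W.HasMultiplicativeReductionAtPrime ℓ) ∧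
          ¬ 2 ^ 5 ∣ W.conductorNorm ℤ) →
      Literature.NumberTheory.EllipticCurves.Rank1Residual.Typed.MissingUpperBoundAt W p

/-- **S2c″ ⟸ `ResThreeBadOffendingOddAdditiveOrDeepTwoAtFive`** (given the items, HOLE 1, `hLL`, `hOS`): the sharper v10 graft option — PROVED
(`by_cases` on the 2-power locus; on it §4d closes the pair outright). Nothing booked; 19715 NOT closed; BSD NOT proved. -/
theorem res_threeBadOffending_of_oddAdditiveOrDeepTwo_of_items
    (h₅ : Summit.BirchSwinnertonDyer.BirchSwinnertonDyer.Theses.ErratumRoadFive.PublishedInputsFive)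
    (h₃ : Summit.BirchSwinnertonDyer.BirchSwinnertonDyer.Theses.ErratumRoadFive.X11aLowerHalf)
    (hJL : Summit.BirchSwinnertonDyer.BirchSwinnertonDyer.Theses.ErratumRoadFive.ShimuraParametrizationDataNonempty)
    (hCO : Summit.BirchSwinnertonDyer.BirchSwinnertonDyer.Theses.ErratumRoadFive.PastenComponentOrdersInput)
    (hLL : diamond1995_refinedSerre)
    (hOS : ∀ (W : WeierstrassCurve ℚ) (ℓ : ℕ) [Fact ℓ.Prime],
      W.artinConductorExponent_tate_eq_conductorExponent_of_isElliptic ℓ)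
    (hSav : ∀ (W : WeierstrassCurve ℚ) [W.IsElliptic] [W.IsGloballyMinimal] (p : ℕ) [Fact p.Prime]
      (q₁ : ℕ) [Fact q₁.Prime], ClassX11b W p → 5 ≤ p → Surj W p → ¬ Ram W p →
      W.HasSplitMultiplicativeReductionAtPrime q₁ → p ∣ padicValInt q₁ W.minimalDiscriminantInt →
      Theorems.ShimuraInertSavedDisplayAtD W p q₁)
    (hRes : ResThreeBadOffendingOddAdditiveOrDeepTwoAtFive) :
    ∀ (W : WeierstrassCurve ℚ) [W.IsElliptic] [W.IsGloballyMinimal] (p : ℕ) [Fact p.Prime], Summit.BirchSwinnertonDyer.Rank1Residual.ClassX11b W p → 5 ≤ p → Literature.NumberTheory.EllipticCurves.Rank1Residual.Surj W p → ¬ Literature.NumberTheory.EllipticCurves.Rank1Residual.Ram W p → p ∣ W.tamagawaProduct → (∃ ℓ : ℕ, ∃ _ : Fact ℓ.Prime, ℓ ≠ p ∧ W.HasMultiplicativeReductionAtPrime ℓ) → 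
      (∃ (q₁ q₂ q₃ : ℕ) (_ : Fact q₁.Prime) (_ : Fact q₂.Prime) (_ : Fact q₃.Prime),
        q₁ ≠ p ∧ q₂ ≠ p ∧ q₃ ≠ p ∧ q₁ ≠ q₂ ∧ q₁ ≠ q₃ ∧ q₂ ≠ q₃ ∧
        (W.HasSplitMultiplicativeReductionAtPrime q₁ ∧ p ∣ padicValInt q₁ W.minimalDiscriminantInt ∧ (q₁ = 2 ∨ p ∣ q₁ - 1)) ∧
        (W.HasSplitMultiplicativeReductionAtPrime q₂ ∧ p ∣ padicValInt q₂ W.minimalDiscriminantInt ∧ (q₂ = 2 ∨ p ∣ q₂ - 1)) ∧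
        (W.HasSplitMultiplicativeReductionAtPrime q₃ ∧ p ∣ padicValInt q₃ W.minimalDiscriminantInt ∧ (q₃ = 2 ∨ p ∣ q₃ - 1))) →
      ¬ (∃ S : Finset ℕ, (∀ ℓ ∈ S, ∃ _ : Fact ℓ.Prime, Literature.NumberTheory.EllipticCurves.Rank1Residual.Mult W ℓ) ∧ Even S.card ∧ p ∈ S ∧ (∀ (ℓ : ℕ) [Fact ℓ.Prime], ℓ ∉ S → W.HasSplitMultiplicativeReductionAtPrime ℓ → ¬ p ∣ padicValInt ℓ W.minimalDiscriminantInt) ∧ (¬ p ∣ padicValInt p W.minimalDiscriminantInt ∨ ∃ R ⊆ S, S.card = 2 * R.card ∧ ∀ q ∈ R, q ≠ 2 ∧ ¬ p ∣ q - 1)) → ¬ (∃ S : Finset ℕ, (∀ ℓ ∈ S, ∃ _ : Fact ℓ.Prime, Literature.NumberTheory.EllipticCurves.Rank1Residual.Mult W ℓ) ∧ Even S.card ∧ p ∉ S ∧ (∀ (ℓ : ℕ) [Fact ℓ.Prime], ℓ ∉ S → W.HasSplitMultiplicativeReductionAtPrime ℓ → ¬ p ∣ padicValInt ℓ W.minimalDiscriminantInt)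 ∧ ((∃ (ℓ₀ : ℕ) (_ : Fact ℓ₀.Prime), Literature.NumberTheory.EllipticCurves.Rank1Residual.Mult W ℓ₀ ∧ ℓ₀ ≠ p ∧ ¬ p ∣ padicValInt ℓ₀ W.minimalDiscriminantInt) ∨ ∃ R ⊆ S, S.card = 2 * R.card ∧ ∀ q ∈ R, ¬ p ∣ q - 1)) →
      ¬ (∃ (q₁ : ℕ) (_ : Fact q₁.Prime) (S : Finset ℕ), W.HasSplitMultiplicativeReductionAtPrime q₁ ∧
        p ∣ padicValInt q₁ W.minimalDiscriminantInt ∧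
        (∀ ℓ ∈ S, ∃ _ : Fact ℓ.Prime, Literature.NumberTheory.EllipticCurves.Rank1Residual.Mult W ℓ) ∧ Even S.card ∧ p ∈ S ∧ q₁ ∉ S ∧
        (∀ (ℓ : ℕ) [Fact ℓ.Prime], ℓ ∉ S → ℓ ≠ q₁ → W.HasSplitMultiplicativeReductionAtPrime ℓ →
          ¬ p ∣ padicValInt ℓ W.minimalDiscriminantInt) ∧
        ∃ R ⊆ S, S.card = 2 * R.card ∧ ∀ q ∈ R, q ≠ 2 ∧ ¬ p ∣ q - 1) →
      Literature.NumberTheory.EllipticCurves.Rank1Residual.Typed.MissingUpperBoundAt W p := by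
  intro W _ _ p _ hX hp5 hsurj hnram htam hother h3 hnoA hnoD hnoB
  by_cases h2 : (∀ (ℓ : ℕ) [Fact ℓ.Prime], ℓ ≠ 2 → W.HasGoodReductionAtPrime ℓ ∨ W.HasMultiplicativeReductionAtPrime ℓ) ∧
      ¬ 2 ^ 5 ∣ W.conductorNorm ℤ
  · exact res_twoPowerAdditiveAtFive_of_items h₅ h₃ hJL hCO hLL hOS hSav W p hX hp5 hsurj hnram htam hnoA
      (fun ℓ _ hℓ ↦ h2.1 ℓ hℓ) h2.2
  · exact hRes W p hX hp5 hsurj hnram htam hother h3 hnoA hnoD hnoB h2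


/-- **`ResThreeBadOffendingAfterCutsAtFive` (TYPED `def`, nothing asserted; v2): the HONEST residual of S2c″ after ALL the cuts of this file** —
v9's S2c″ VERBATIM with three extra hypotheses: NOT on the 2-power locus (§4d), NOT on the 3-square locus (§4d′; semistable curves lie on it), NOT on
the 5-square locus (§4d″). Equivalently: the curve has an additive prime `∉ {2, 3, 5}`, or two additive primes, or `2⁵ ∣ N_E`, or `3³ ∣ N_E`, or `5³ ∣ N_E`
— exactly the curves whose prime-to-`p` Serre level `N(ρ̄) ∣ N_add` may be a level of POSITIVE genus (or `13`), where weight-2 forms exist. -/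
def ResThreeBadOffendingAfterCutsAtFive : Prop :=
    ∀ (W : WeierstrassCurve ℚ) [W.IsElliptic] [W.IsGloballyMinimal] (p : ℕ) [Fact p.Prime], Summit.BirchSwinnertonDyer.Rank1Residual.ClassX11b W p → 5 ≤ p → Literature.NumberTheory.EllipticCurves.Rank1Residual.Surj W p → ¬ Literature.NumberTheory.EllipticCurves.Rank1Residual.Ram W p → p ∣ W.tamagawaProduct → (∃ ℓ : ℕ, ∃ _ : Fact ℓ.Prime, ℓ ≠ p ∧ W.HasMultiplicativeReductionAtPrime ℓ) → 
      (∃ (q₁ q₂ q₃ : ℕ) (_ : Fact q₁.Prime) (_ : Fact q₂.Prime) (_ : Fact q₃.Prime),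
        q₁ ≠ p ∧ q₂ ≠ p ∧ q₃ ≠ p ∧ q₁ ≠ q₂ ∧ q₁ ≠ q₃ ∧ q₂ ≠ q₃ ∧
        (W.HasSplitMultiplicativeReductionAtPrime q₁ ∧ p ∣ padicValInt q₁ W.minimalDiscriminantInt ∧ (q₁ = 2 ∨ p ∣ q₁ - 1)) ∧
        (W.HasSplitMultiplicativeReductionAtPrime q₂ ∧ p ∣ padicValInt q₂ W.minimalDiscriminantInt ∧ (q₂ = 2 ∨ p ∣ q₂ - 1)) ∧
        (W.HasSplitMultiplicativeReductionAtPrime q₃ ∧ p ∣ padicValInt q₃ W.minimalDiscriminantInt ∧ (q₃ = 2 ∨ p ∣ q₃ - 1))) →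
      ¬ (∃ S : Finset ℕ, (∀ ℓ ∈ S, ∃ _ : Fact ℓ.Prime, Literature.NumberTheory.EllipticCurves.Rank1Residual.Mult W ℓ) ∧ Even S.card ∧ p ∈ S ∧ (∀ (ℓ : ℕ) [Fact ℓ.Prime], ℓ ∉ S → W.HasSplitMultiplicativeReductionAtPrime ℓ → ¬ p ∣ padicValInt ℓ W.minimalDiscriminantInt) ∧ (¬ p ∣ padicValInt p W.minimalDiscriminantInt ∨ ∃ R ⊆ S, S.card = 2 * R.card ∧ ∀ q ∈ R, q ≠ 2 ∧ ¬ p ∣ q - 1)) → ¬ (∃ S : Finset ℕ, (∀ ℓ ∈ S, ∃ _ : Fact ℓ.Prime, Literature.NumberTheory.EllipticCurves.Rank1Residual.Mult W ℓ) ∧ Even S.card ∧ p ∉ S ∧ (∀ (ℓ : ℕ) [Fact ℓ.Prime], ℓ ∉ S → W.HasSplitMultiplicativeReductionAtPrime ℓ → ¬ p ∣ padicValInt ℓ W.minimalDiscriminantInt) ∧ ((∃ (ℓ₀ : ℕ) (_ : Fact ℓ₀.Prime), Literature.NumberTheory.EllipticCurves.Rank1Residual.Mult W ℓ₀ ∧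 ℓ₀ ≠ p ∧ ¬ p ∣ padicValInt ℓ₀ W.minimalDiscriminantInt) ∨ ∃ R ⊆ S, S.card = 2 * R.card ∧ ∀ q ∈ R, ¬ p ∣ q - 1)) →
      ¬ (∃ (q₁ : ℕ) (_ : Fact q₁.Prime) (S : Finset ℕ), W.HasSplitMultiplicativeReductionAtPrime q₁ ∧
        p ∣ padicValInt q₁ W.minimalDiscriminantInt ∧
        (∀ ℓ ∈ S, ∃ _ : Fact ℓ.Prime, Literature.NumberTheory.EllipticCurves.Rank1Residual.Mult W ℓ) ∧ Even S.card ∧ p ∈ S ∧ q₁ ∉ S ∧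
        (∀ (ℓ : ℕ) [Fact ℓ.Prime], ℓ ∉ S → ℓ ≠ q₁ → W.HasSplitMultiplicativeReductionAtPrime ℓ →
          ¬ p ∣ padicValInt ℓ W.minimalDiscriminantInt) ∧
        ∃ R ⊆ S, S.card = 2 * R.card ∧ ∀ q ∈ R, q ≠ 2 ∧ ¬ p ∣ q - 1) →
      ¬ ((∀ (ℓ : ℕ) [Fact ℓ.Prime], ℓ ≠ 2 → W.HasGoodReductionAtPrime ℓ ∨ W.HasMultiplicativeReductionAtPrime ℓ) ∧
          ¬ 2 ^ 5 ∣ W.conductorNorm ℤ) →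
      ¬ ((∀ (ℓ : ℕ) [Fact ℓ.Prime], ℓ ≠ 3 → W.HasGoodReductionAtPrime ℓ ∨ W.HasMultiplicativeReductionAtPrime ℓ) ∧
          ¬ 3 ^ 3 ∣ W.conductorNorm ℤ) →
      ¬ ((∀ (ℓ : ℕ) [Fact ℓ.Prime], ℓ ≠ 5 → W.HasGoodReductionAtPrime ℓ ∨ W.HasMultiplicativeReductionAtPrime ℓ) ∧
          ¬ 5 ^ 3 ∣ W.conductorNorm ℤ) →
      Literature.NumberTheory.EllipticCurves.Rank1Residual.Typed.MissingUpperBoundAt W p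

/-- **S2c″ ⟸ `ResThreeBadOffendingAfterCutsAtFive`** (given the items, HOLE 1, `hLL`, `hOS`): the sharpest v10 graft option of this file — PROVED.
Nothing booked; 19715 NOT closed; BSD NOT proved. -/
theorem res_threeBadOffending_of_afterCuts_of_items
    (h₅ : Summit.BirchSwinnertonDyer.BirchSwinnertonDyer.Theses.ErratumRoadFive.PublishedInputsFive)
    (h₃ : Summit.BirchSwinnertonDyer.BirchSwinnertonDyer.Theses.ErratumRoadFive.X11aLowerHalf)
    (hJL : Summit.BirchSwinnertonDyer.BirchSwinnertonDyer.Theses.ErratumRoadFive.ShimuraParametrizationDataNonempty)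
    (hCO : Summit.BirchSwinnertonDyer.BirchSwinnertonDyer.Theses.ErratumRoadFive.PastenComponentOrdersInput)
    (hLL : diamond1995_refinedSerre)
    (hOS : ∀ (W : WeierstrassCurve ℚ) (ℓ : ℕ) [Fact ℓ.Prime],
      W.artinConductorExponent_tate_eq_conductorExponent_of_isElliptic ℓ)
    (hSav : ∀ (W : WeierstrassCurve ℚ) [W.IsElliptic] [W.IsGloballyMinimal] (p : ℕ) [Fact p.Prime]
      (q₁ : ℕ) [Fact q₁.Prime], ClassX11b W p → 5 ≤ p → Surj W p → ¬ Ram W p →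
      W.HasSplitMultiplicativeReductionAtPrime q₁ → p ∣ padicValInt q₁ W.minimalDiscriminantInt →
      Theorems.ShimuraInertSavedDisplayAtD W p q₁)
    (hRes : ResThreeBadOffendingAfterCutsAtFive) :
    ∀ (W : WeierstrassCurve ℚ) [W.IsElliptic] [W.IsGloballyMinimal] (p : ℕ) [Fact p.Prime], Summit.BirchSwinnertonDyer.Rank1Residual.ClassX11b W p → 5 ≤ p → Literature.NumberTheory.EllipticCurves.Rank1Residual.Surj W p → ¬ Literature.NumberTheory.EllipticCurves.Rank1Residual.Ram W p → p ∣ W.tamagawaProduct → (∃ ℓ : ℕ, ∃ _ : Fact ℓ.Prime, ℓ ≠ p ∧ W.HasMultiplicativeReductionAtPrime ℓ) → 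
      (∃ (q₁ q₂ q₃ : ℕ) (_ : Fact q₁.Prime) (_ : Fact q₂.Prime) (_ : Fact q₃.Prime),
        q₁ ≠ p ∧ q₂ ≠ p ∧ q₃ ≠ p ∧ q₁ ≠ q₂ ∧ q₁ ≠ q₃ ∧ q₂ ≠ q₃ ∧
        (W.HasSplitMultiplicativeReductionAtPrime q₁ ∧ p ∣ padicValInt q₁ W.minimalDiscriminantInt ∧ (q₁ = 2 ∨ p ∣ q₁ - 1)) ∧
        (W.HasSplitMultiplicativeReductionAtPrime q₂ ∧ p ∣ padicValInt q₂ W.minimalDiscriminantInt ∧ (q₂ = 2 ∨ p ∣ q₂ - 1)) ∧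
        (W.HasSplitMultiplicativeReductionAtPrime q₃ ∧ p ∣ padicValInt q₃ W.minimalDiscriminantInt ∧ (q₃ = 2 ∨ p ∣ q₃ - 1))) →
      ¬ (∃ S : Finset ℕ, (∀ ℓ ∈ S, ∃ _ : Fact ℓ.Prime, Literature.NumberTheory.EllipticCurves.Rank1Residual.Mult W ℓ) ∧ Even S.card ∧ p ∈ S ∧ (∀ (ℓ : ℕ) [Fact ℓ.Prime], ℓ ∉ S → W.HasSplitMultiplicativeReductionAtPrime ℓ → ¬ p ∣ padicValInt ℓ W.minimalDiscriminantInt) ∧ (¬ p ∣ padicValInt p W.minimalDiscriminantInt ∨ ∃ R ⊆ S, S.card = 2 * R.card ∧ ∀ q ∈ R, q ≠ 2 ∧ ¬ p ∣ q - 1)) → ¬ (∃ S : Finset ℕ, (∀ ℓ ∈ S, ∃ _ : Fact ℓ.Prime, Literature.NumberTheory.EllipticCurves.Rank1Residual.Mult W ℓ) ∧ Even S.card ∧ p ∉ S ∧ (∀ (ℓ : ℕ) [Fact ℓ.Prime], ℓ ∉ S → W.HasSplitMultiplicativeReductionAtPrime ℓ → ¬ p ∣ padicValInt ℓ W.minimalDiscriminantInt)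 ∧ ((∃ (ℓ₀ : ℕ) (_ : Fact ℓ₀.Prime), Literature.NumberTheory.EllipticCurves.Rank1Residual.Mult W ℓ₀ ∧ ℓ₀ ≠ p ∧ ¬ p ∣ padicValInt ℓ₀ W.minimalDiscriminantInt) ∨ ∃ R ⊆ S, S.card = 2 * R.card ∧ ∀ q ∈ R, ¬ p ∣ q - 1)) →
      ¬ (∃ (q₁ : ℕ) (_ : Fact q₁.Prime) (S : Finset ℕ), W.HasSplitMultiplicativeReductionAtPrime q₁ ∧
        p ∣ padicValInt q₁ W.minimalDiscriminantInt ∧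
        (∀ ℓ ∈ S, ∃ _ : Fact ℓ.Prime, Literature.NumberTheory.EllipticCurves.Rank1Residual.Mult W ℓ) ∧ Even S.card ∧ p ∈ S ∧ q₁ ∉ S ∧
        (∀ (ℓ : ℕ) [Fact ℓ.Prime], ℓ ∉ S → ℓ ≠ q₁ → W.HasSplitMultiplicativeReductionAtPrime ℓ →
          ¬ p ∣ padicValInt ℓ W.minimalDiscriminantInt) ∧
        ∃ R ⊆ S, S.card = 2 * R.card ∧ ∀ q ∈ R, q ≠ 2 ∧ ¬ p ∣ q - 1) →
      Literature.NumberTheory.EllipticCurves.Rank1Residual.Typed.MissingUpperBoundAt W p := by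
  intro W _ _ p _ hX hp5 hsurj hnram htam hother h3 hnoA hnoD hnoB
  by_cases h2 : (∀ (ℓ : ℕ) [Fact ℓ.Prime], ℓ ≠ 2 → W.HasGoodReductionAtPrime ℓ ∨ W.HasMultiplicativeReductionAtPrime ℓ) ∧
      ¬ 2 ^ 5 ∣ W.conductorNorm ℤ
  · exact res_twoPowerAdditiveAtFive_of_items h₅ h₃ hJL hCO hLL hOS hSav W p hX hp5 hsurj hnram htam hnoA
      (fun ℓ _ hℓ ↦ h2.1 ℓ hℓ) h2.2
  by_cases h3' : (∀ (ℓ : ℕ) [Fact ℓ.Prime], ℓ ≠ 3 → W.HasGoodReductionAtPrime ℓ ∨ W.HasMultiplicativeReductionAtPrime ℓ) ∧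
      ¬ 3 ^ 3 ∣ W.conductorNorm ℤ
  · exact res_threeSquareAdditiveAtFive_of_items h₅ h₃ hJL hCO hLL hOS hSav W p hX hp5 hsurj hnram htam hnoA
      (fun ℓ _ hℓ ↦ h3'.1 ℓ hℓ) h3'.2
  by_cases h5' : (∀ (ℓ : ℕ) [Fact ℓ.Prime], ℓ ≠ 5 → W.HasGoodReductionAtPrime ℓ ∨ W.HasMultiplicativeReductionAtPrime ℓ) ∧
      ¬ 5 ^ 3 ∣ W.conductorNorm ℤ
  · exact res_fiveSquareAdditiveAtFive_of_items h₅ h₃ hJL hCO hLL hOS hSav W p hX hp5 hsurj hnram htam hnoA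
      (fun ℓ _ hℓ ↦ h5'.1 ℓ hℓ) h5'.2
  · exact hRes W p hX hp5 hsurj hnram htam hother h3 hnoA hnoD hnoB h2 h3' h5'

/-- **A semistable curve lies on the 3-square locus** (bookkeeping): so `ResThreeBadOffendingAfterCutsAtFive` also absorbs
`ResThreeBadOffendingNonSemistableAtFive`. -/
theorem threeSquareLocus_of_semistable (W : WeierstrassCurve ℚ) [W.IsElliptic] [W.IsGloballyMinimal] (hsst : Semistable W) :
    (∀ (ℓ : ℕ) [Fact ℓ.Prime], ℓ ≠ 3 → W.HasGoodReductionAtPrime ℓ ∨ W.HasMultiplicativeReductionAtPrime ℓ) ∧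
      ¬ 3 ^ 3 ∣ W.conductorNorm ℤ := by
  refine ⟨fun ℓ _ _ ↦ hsst ℓ Fact.out, fun h27 ↦ ?_⟩
  -- semistable ⟹ `N_E` squarefree ⟹ `9 ∤ N_E`
  have hsq : Squarefree (W.conductorNorm ℤ) :=
    (W.isSemistable_iff_squarefree_conductorNorm).mp ((semistable_iff_isSemistable_int W).mp hsst)
  have h9 : 3 * 3 ∣ W.conductorNorm ℤ := (show (3 * 3 : ℕ) ∣ 3 ^ 3 by norm_num).trans h27
  exact absurd (hsq 3 h9) (by decide)


/-! ## §6 (v4, NEW) THE CM-LEVEL CUT — Serre levels `27`, `32`, `49`; the first use of `Surj`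

On 19715's locus a self-carrier `p ∣ ord_p(Δ_min)` forces (§4, Steps 1–6′) a weight-2 newform `g` on `Γ₀(M)`, `M ∣ N_add`, with
`ρ̄_{E,p} ≅ ρ̄_{g,𝔭}`. When `S₂(Γ₀(M))` is ONE-dimensional and `m² ∣ M` for the conductor `m` of a quadratic character `χ`, the twist
`g ⊗ χ ∈ S₂(Γ₀(M))` is `g` itself, so `a_q(g) = 0` at every `q` with `χ(q) = −1`; then `a_q(E) ≡ 0 (mod p)` at all such good `q` — impossible
for a SURJECTIVE `ρ̄_{E,p}` (Chebotarev: HOLE 2). Inputs by name: `exists_isNewformOf`, `diamond1995_refinedSerre`, Ogg–Saito exponentwise,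
HOLE 2 (`SurjInertTraceWitnessAtFive`, typed here), and at level 49 the dimension formula `finrank_cuspForm_two_eq_genusX0 49`.
Nothing booked; 19715 NOT closed; BSD NOT proved. -/

section CMLevelProof

open scoped MatrixGroups ModularForm NumberField
open CongruenceSubgroup Polynomial
open _root_.WeierstrassCurve Literature.NumberTheory Literature.NumberTheory.GaloisRepresentations
  Literature.NumberTheory.EllipticCurves Literature.NumberTheory.EllipticCurves.ModularForms
  Rat.HeightOneSpectrum IsDedekindDomain IsDedekindDomain.HeightOneSpectrum
  Literature.NumberTheory.Automorphic Literature.NumberTheory.Automorphic.BCDT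
  Literature.NumberTheory.DiophantineGeometry Literature.NumberTheory.EllipticCurves.Rank1Residual
  Literature.NumberTheory.GaloisRepresentations.ModPGaloisRep
  Literature.NumberTheory.GaloisRepresentations.IsNonarchimedeanLocalField
  Literature.NumberTheory.EllipticCurves.SkinnerUrban2014 ValuativeRel
  Literature.NumberTheory.QuadraticFields

/-! ### HOLE 2 (typed, PRINTED — Chebotarev): a surjective `ρ̄_{E,p}` has a Frobenius of non-zero trace
in the non-trivial coset of any quadratic character -/

/-- **HOLE 2 (typed here; PRINTED — Chebotarev's density theorem in the torsion field `ℚ(E[mp])`).** For `p ≥ 5`, `ρ̄_{E,p}`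
SURJECTIVE, and any non-trivial primitive quadratic Dirichlet character `χ mod m`: there are arbitrarily large primes `q` with `χ(q) = −1`
and `a_q(E) ≢ 0 (mod p)`.  Proof in print: `χ` is a character of `Gal(ℚ(ζ_m)∕ℚ)` and `ℚ(ζ_m) ⊂ ℚ(E[m])` (Weil pairing), so both `χ(Frob_q)`
and `ρ̄_{E,p}(Frob_q)` are read off the image `H` of `Γ_ℚ` in `GL₂(𝔽_p) × (ℤ∕m)ˣ`, which projects ONTO both factors; the fibre subgroup
`N = H ∩ (GL₂(𝔽_p) × 1)` is normal in `GL₂(𝔽_p)` with abelian quotient, hence `N ⊇ SL₂(𝔽_p)` (`p ≥ 5`), so the fibre of `H` over any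
`a ∈ (ℤ∕m)ˣ` with `χ(a) = −1` is a union of cosets `{det = d}`, each containing an element of non-zero trace (`diag(d, 1)` for `d ≠ −1`,
`[[1,1],[2,1]]` for `d = −1`); Chebotarev (tree, by name: `Literature.NumberTheory.EllipticCurves.chebotarev_geomTorsion`, Tate GCFT §2.4)
applied to `ℚ(E[mp])` and such an element gives infinitely many good `q ≠ p` with `Frob_q` in that class, and `a_q(E) ≡ tr ρ̄_{E,p}(Frob_q)
(mod p)`.  v5: PROVED below (`surjInertTraceWitnessAtFive_holds`, `section HoleTwo`) — by a shorter route than the sketch above: for ANY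
`σ` with `χ(σ) = −1` the coset `ρ̄(σ) · {ρ̄(τ)² : τ}` ⊇ `ρ̄(σ) · {A² : A ∈ GL₂(𝔽_p)}` (surjectivity) contains a non-zero-trace element
(`exists_trace_mul_sq_ne_zero`), and `χ(στ²) = χ(σ)`; Chebotarev = the tree's `chebotarev_geomTorsion`. [cite: Serre1972, §5.1 and Thm. 2] [cite: TateGCFT1967, §2.4] [cite: SilvermanAEC2009, III.8.1.1, V.2.3.1] -/
def SurjInertTraceWitnessAtFive : Prop :=
  ∀ (W : WeierstrassCurve ℚ) [W.IsElliptic] [W.IsGloballyMinimal] (p : ℕ) [Fact p.Prime],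
    5 ≤ p → Surj W p →
    ∀ (m : ℕ) [NeZero m] (χ : DirichletCharacter ℂ m), χ.IsQuadratic → χ.IsPrimitive → χ ≠ 1 →
    ∀ B : ℕ, ∃ q : ℕ, q.Prime ∧ B < q ∧ χ q = -1 ∧ ((W.LFunction q : ℤ) : ZMod p) ≠ 0

section HoleTwo

open Matrix NumberField IsDedekindDomain Field
open Literature.NumberTheory.EllipticCurves.DokchitserDokchitser2012
open Literature.NumberTheory.EllipticCurves.Rank1Residual (Surj)

/-! #### Group theory in `GL₂(𝔽_p)`, `p ≥ 5`: every coset `M · {squares}` meets the non-zero-trace locus -/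

/-- For `p ≥ 5` prime and `M ∈ GL₂(𝔽_p)` there is an invertible `A` with `tr(M A²) ≠ 0`
(`A ∈ {1, [[1,1],[0,1]], [[1,0],[1,1]], diag(2,1)}`; uses `2 ≠ 0`, `3 ≠ 0` in `𝔽_p`). [folklore] -/
theorem exists_trace_mul_sq_ne_zero {p : ℕ} [Fact p.Prime] (hp5 : 5 ≤ p)
    (M : Matrix (Fin 2) (Fin 2) (ZMod p)) (hM : M.det ≠ 0) :
    ∃ A : Matrix (Fin 2) (Fin 2) (ZMod p), A.det ≠ 0 ∧ (M * (A * A)).trace ≠ 0 := by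
  have hp : p.Prime := Fact.out
  have h2 : (2 : ZMod p) ≠ 0 := by
    intro h
    have h' : ((2 : ℕ) : ZMod p) = 0 := by exact_mod_cast h
    rw [CharP.cast_eq_zero_iff (ZMod p) p] at h'
    have := Nat.le_of_dvd two_pos h'
    omega
  have h3 : (3 : ZMod p) ≠ 0 := by
    intro h
    have h' : ((3 : ℕ) : ZMod p) = 0 := by exact_mod_cast h
    rw [CharP.cast_eq_zero_iff (ZMod p) p] at h'
    have := Nat.le_of_dvd three_pos h'
    omega
  by_cases htr : M.trace ≠ 0
  · exact ⟨1, by simp, by simpa using htr⟩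
  rw [not_ne_iff, Matrix.trace_fin_two] at htr
  have hd : M 1 1 = -M 0 0 := eq_neg_of_add_eq_zero_right htr
  by_cases hc : M 1 0 ≠ 0
  · refine ⟨!![1, 1; 0, 1], by simp [Matrix.det_fin_two], ?_⟩
    have : (M * (!![1, 1; 0, 1] * !![1, 1; 0, 1])).trace = 2 * M 1 0 := by
      simp [Matrix.trace_fin_two, Matrix.mul_apply, Fin.sum_univ_two, hd]; ring
    rw [this]
    exact mul_ne_zero h2 hc
  rw [not_ne_iff] at hc
  by_cases hb : M 0 1 ≠ 0
  · refine ⟨!![1, 0; 1, 1], by simp [Matrix.det_fin_two], ?_⟩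
    have : (M * (!![1, 0; 1, 1] * !![1, 0; 1, 1])).trace = 2 * M 0 1 := by
      simp [Matrix.trace_fin_two, Matrix.mul_apply, Fin.sum_univ_two, hd]; ring
    rw [this]
    exact mul_ne_zero h2 hb
  rw [not_ne_iff] at hb
  have ha : M 0 0 ≠ 0 := by
    intro ha
    apply hM
    rw [Matrix.det_fin_two, hb, hc, ha, zero_mul, mul_zero, sub_zero]
  refine ⟨!![2, 0; 0, 1], by simpa [Matrix.det_fin_two] using h2, ?_⟩
  have : (M * (!![2, 0; 0, 1] * !![2, 0; 0, 1])).trace = 3 * M 0 0 := by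
    simp [Matrix.trace_fin_two, Matrix.mul_apply, Fin.sum_univ_two, hd]; ring
  rw [this]
  exact mul_ne_zero h3 ha

/-- A `2 × 2` matrix is determined by its action on the frame vectors `e P`. [folklore] -/
theorem matrix_eq_of_mulVec_frame {A : Type*} [AddCommGroup A] {p : ℕ}
    (e : A ≃+ (Fin 2 → ZMod p)) {M N : Matrix (Fin 2) (Fin 2) (ZMod p)}
    (h : ∀ P : A, M *ᵥ e P = N *ᵥ e P) : M = N := by
  ext i j
  have h1 := congr_fun (h (e.symm (Pi.single j 1))) i
  rw [e.apply_symm_apply] at h1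
  simpa [Matrix.mulVec, dotProduct, Pi.single_apply, Fin.sum_univ_two] using h1

/-- `tr = a` for a monic quadratic `X² - a X + b` as a characteristic polynomial. [folklore] -/
theorem trace_eq_of_charpoly_eq {p : ℕ} [Fact p.Prime] (M : Matrix (Fin 2) (Fin 2) (ZMod p))
    (a b : ZMod p) (h : M.charpoly = X ^ 2 - C a * X + C b) : M.trace = a := by
  rw [Matrix.trace_eq_neg_charpoly_coeff, h]
  simp

/-- **HOLE 2 PROVED.** For `p ≥ 5` with `ρ̄_{E,p}` onto and a non-trivial quadratic `χ mod m`, there are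
arbitrarily large good primes `q` with `χ(q) = -1` and `a_q(E) ≢ 0 (mod p)`.  Proof: pick `σ₀ ∈ Γ_ℚ` with
`χ(χ_m(σ₀)) = -1` (`χ_m` onto, `modNCyclotomicCharacter_rat_surjective`), an invertible `A` with
`tr(ρ̄(σ₀) A²) ≠ 0` (`exists_trace_mul_sq_ne_zero`) and `x` with `ρ̄(x) = A` (`Surj`,
`hasSurjectiveModNGaloisRep_iff_matrix`); `g = σ₀ x²` has `χ(χ_m(g)) = χ(χ_m(σ₀)) χ(χ_m(x))² = -1` and
`tr ρ̄(g) ≠ 0`.  Chebotarev for the Artin representation on `E[p] × (ℤ/m)ˣ`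
(`exists_framedArtinRep_geomTorsion_prod_cyclotomic`, `chebotarevArtinRep_holds`) gives a Frobenius `φ`
above a prime `q > B`, `q ∤ p m Δ_min`, with `ρ̄(φ) = ρ̄(g)` and `χ_m(φ) = χ_m(g)`; `χ_m(φ) = q`
(`Rat.modNCyclotomicCharacter_of_isArithFrobAt`) and `tr ρ̄(φ) ≡ a_q(E)`
(`IsTorsionGaloisRep.charpoly_eq_of_isArithFrobAt`, `lFunction_primesEquiv_eq_frobeniusTraceAt`).
[cite: Serre1972, §4 and Thm. 2] [cite: TateGCFT1967, §2.4] [cite: SilvermanAEC2009, III.7, C.21.3] -/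
theorem surjInertTraceWitnessAtFive_holds : SurjInertTraceWitnessAtFive := by
  intro W _ _ p _ hp5 hS m _ χ hχ2 _ hχ1 B
  classical
  have hp : p.Prime := Fact.out
  haveI : NeZero (p : ℚ) := ⟨by exact_mod_cast hp.ne_zero⟩
  -- (1) the framed mod-`p` representation `ρ̄` and its frame `e`
  obtain ⟨ρ, hρ⟩ := exists_isTorsionGaloisRep W p
  have hρ' := hρ
  obtain ⟨e, he⟩ := hρ'
  -- `R σ = ρ̄(σ)` as a matrix; it is `rhoMat W e σ`
  have hmat : ∀ σ : absoluteGaloisGroup ℚ, rhoMat W e σ =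
      ((ρ σ : GL (Fin 2) (ZMod p)) : Matrix (Fin 2) (Fin 2) (ZMod p)) := fun σ ↦
    matrix_eq_of_mulVec_frame e fun P ↦ by rw [← rhoMat_mulVec, he]
  have hdet : ∀ σ : absoluteGaloisGroup ℚ,
      (((ρ σ : GL (Fin 2) (ZMod p)) : Matrix (Fin 2) (Fin 2) (ZMod p))).det ≠ 0 := fun σ ↦
    (Matrix.isUnits_det_units (ρ σ)).ne_zero
  -- (2) `Surj`: every invertible matrix is some `ρ̄(x)`
  have hsurj : ∀ A : Matrix (Fin 2) (Fin 2) (ZMod p), A.det ≠ 0 →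
      ∃ x : absoluteGaloisGroup ℚ, ((ρ x : GL (Fin 2) (ZMod p)) : Matrix (Fin 2) (Fin 2) (ZMod p)) = A := by
    intro A hA
    obtain ⟨x, hx⟩ := (hasSurjectiveModNGaloisRep_iff_matrix W e).mp hS A ⟨A.det⁻¹, mul_inv_cancel₀ hA⟩
    exact ⟨x, (hmat x).symm.trans hx⟩
  -- (3) `σ₀` with `χ(χ_m(σ₀)) = -1`
  obtain ⟨u, hu⟩ : ∃ u : (ZMod m)ˣ, χ (u : ZMod m) = -1 := by
    obtain ⟨u, hu⟩ := (MulChar.ne_one_iff).mp hχ1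
    refine ⟨u, ?_⟩
    have hne : χ (u : ZMod m) ≠ 0 := by
      rw [← MulChar.coe_toUnitHom]; exact Units.ne_zero _
    rcases hχ2 (u : ZMod m) with h0 | h1 | h1
    · exact absurd h0 hne
    · exact absurd h1 hu
    · exact h1
  obtain ⟨σ₀, hσ₀⟩ := modNCyclotomicCharacter_rat_surjective m u
  -- `χ ∘ χ_m` takes values `±1`
  have hpm : ∀ τ : absoluteGaloisGroup ℚ,
      χ ((modNCyclotomicCharacter ℚ m τ : (ZMod m)ˣ) : ZMod m) = 1 ∨
        χ ((modNCyclotomicCharacter ℚ m τ : (ZMod m)ˣ) : ZMod m) = -1 := by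
    intro τ
    have hne : χ ((modNCyclotomicCharacter ℚ m τ : (ZMod m)ˣ) : ZMod m) ≠ 0 := by
      rw [← MulChar.coe_toUnitHom]; exact Units.ne_zero _
    rcases hχ2 ((modNCyclotomicCharacter ℚ m τ : (ZMod m)ˣ) : ZMod m) with h0 | h1 | h1
    · exact absurd h0 hne
    · exact Or.inl h1
    · exact Or.inr h1
  -- (4) the element `g = σ₀ x²` with `χ(χ_m(g)) = -1` and `tr ρ̄(g) ≠ 0`
  obtain ⟨A, hA, htrA⟩ := exists_trace_mul_sq_ne_zero hp5 _ (hdet σ₀)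
  obtain ⟨x, hx⟩ := hsurj A hA
  set g : absoluteGaloisGroup ℚ := σ₀ * (x * x) with hgdef
  have hRg : ((ρ g : GL (Fin 2) (ZMod p)) : Matrix (Fin 2) (Fin 2) (ZMod p)) =
      ((ρ σ₀ : GL (Fin 2) (ZMod p)) : Matrix (Fin 2) (Fin 2) (ZMod p)) * (A * A) := by
    rw [hgdef, map_mul, map_mul, Units.val_mul, Units.val_mul, hx]
  have htrg : (((ρ g : GL (Fin 2) (ZMod p)) : Matrix (Fin 2) (Fin 2) (ZMod p))).trace ≠ 0 := by
    rw [hRg]; exact htrA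
  have hχg : χ ((modNCyclotomicCharacter ℚ m g : (ZMod m)ˣ) : ZMod m) = -1 := by
    rw [hgdef, map_mul, map_mul, Units.val_mul, Units.val_mul, map_mul, map_mul, hσ₀, hu]
    rcases hpm x with h1 | h1 <;> rw [h1] <;> norm_num
  -- (5) Chebotarev in `ℚ(E[p], ζ_m)`: a Frobenius `φ` above a large good prime with `ρ̄(φ) = ρ̄(g)`, `χ_m(φ) = χ_m(g)`
  obtain ⟨m', ρA, -, hfaith⟩ :=
    exists_framedArtinRep_geomTorsion_prod_cyclotomic W (n := (p : ℤ)) (by exact_mod_cast hp.ne_zero) m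
  have hΔ0 : minimalDiscriminantInt W ≠ 0 := minimalDiscriminantInt_ne_zero W
  have hm0 : m ≠ 0 := NeZero.ne m
  let S : Set ℕ := {ℓ | ℓ ≤ B ∨ ℓ = p ∨ (ℓ : ℤ) ∣ minimalDiscriminantInt W ∨ ℓ ∣ m}
  have hS' : S.Finite := by
    refine (Set.finite_le_nat (max (max B p) (max (minimalDiscriminantInt W).natAbs m))).subset ?_
    rintro ℓ (hℓ | rfl | hℓ | hℓ)
    · exact Set.mem_setOf.mpr (le_max_of_le_left (le_max_of_le_left hℓ))
    · exact Set.mem_setOf.mpr (le_max_of_le_left (le_max_right _ _))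
    · exact Set.mem_setOf.mpr (le_max_of_le_right (le_max_of_le_left
        (Nat.le_of_dvd (Int.natAbs_pos.mpr hΔ0) (Int.natCast_dvd.mp hℓ))))
    · exact Set.mem_setOf.mpr (le_max_of_le_right (le_max_of_le_right
        (Nat.le_of_dvd (Nat.pos_of_ne_zero hm0) hℓ)))
  obtain ⟨v, ⟨-, 𝔓, h𝔓, φ, hφ, hρφ⟩, hvS⟩ :=
    (FramedArtinRep.infinite_setOf_isArithFrobAt_apply_eq ρA g).exists_notMem_finite
      (finite_setOf_place_over S hS')
  obtain ⟨ℓ, hℓ, hℓv⟩ := exists_prime_natCast_mem v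
  have hℓS : ℓ ∉ S := fun hmem ↦ hvS (Set.mem_biUnion (x := ℓ) ⟨hmem, hℓ.ne_zero⟩ hℓv)
  haveI : Fact ℓ.Prime := ⟨hℓ⟩
  have hℓB : B < ℓ := lt_of_not_ge fun h ↦ hℓS (Or.inl h)
  have hℓp : ℓ ≠ p := fun h ↦ hℓS (Or.inr (Or.inl h))
  have hℓΔ : ¬ (ℓ : ℤ) ∣ minimalDiscriminantInt W := fun h ↦ hℓS (Or.inr (Or.inr (Or.inl h)))
  have hℓm : ¬ ℓ ∣ m := fun h ↦ hℓS (Or.inr (Or.inr (Or.inr h)))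
  obtain ⟨hagree, hcyc⟩ := hfaith φ g hρφ
  -- (6) `χ(q) = -1`
  have hχℓ : χ (ℓ : ZMod m) = -1 := by
    rw [← Rat.modNCyclotomicCharacter_of_isArithFrobAt (N := m) hℓ hℓm hℓv h𝔓 hφ, hcyc, hχg]
  -- (7) `a_q(E) ≡ tr ρ̄(φ) = tr ρ̄(g) ≢ 0 (mod p)`
  have hRφ : ((ρ φ : GL (Fin 2) (ZMod p)) : Matrix (Fin 2) (Fin 2) (ZMod p)) =
      ((ρ g : GL (Fin 2) (ZMod p)) : Matrix (Fin 2) (Fin 2) (ZMod p)) :=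
    matrix_eq_of_mulVec_frame e fun P ↦ by rw [← he, ← he, hagree P]
  have hvℓ : (Rat.HeightOneSpectrum.primesEquiv v : ℕ) = ℓ :=
    Literature.NumberTheory.EllipticCurves.primesEquiv_eq_of_natCast_mem hℓ hℓv
  have hgoodℓ : W.HasGoodReductionAtPrime ℓ := hasGoodReductionAtPrime_of_not_dvd W ℓ hℓΔ
  have hgood : W.HasGoodReductionAt v :=
    (hasGoodReductionAtPrime_primesEquiv_iff_holds W v ℓ hvℓ).mp hgoodℓ
  have hpv : (p : 𝓞 ℚ) ∉ v.asIdeal := fun h ↦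
    hℓp (hvℓ.symm.trans (Literature.NumberTheory.EllipticCurves.primesEquiv_eq_of_natCast_mem hp h))
  have hch := hρ.charpoly_eq_of_isArithFrobAt
    (W.trace_galoisRepTate_frobenius_of_hasGoodReductionAt_holds p)
    (W.det_galoisRepTate_frobenius_of_hasGoodReductionAt_holds p) hpv hgood h𝔓 hφ
  rw [WeierstrassCurve.natCard_residueField_adicCompletionIntegers,
    ← W.lFunction_primesEquiv_eq_frobeniusTraceAt hgood, hvℓ] at hch
  have htrace := trace_eq_of_charpoly_eq _ _ _ hch
  refine ⟨ℓ, hℓ, hℓB, hχℓ, ?_⟩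
  rw [← htrace, hRφ]
  exact htrg

end HoleTwo

/-! ### The twist lemma: on a one-dimensional `S₂(Γ₀(L))` the newform is its own quadratic twist -/

/-- **`a_n(g) = 0` whenever `χ(n) = −1`**, for a newform `g` spanning a one-dimensional `S₂(Γ₀(L))`
and a primitive quadratic `χ mod m` with `m² ∣ L`: the twist `g ⊗ χ` (Shimura Prop. 3.64, the tree's
`charTwist`, level `L`) is a multiple `c • g`, `c = χ(1) a₁ = 1`, so `χ(n) a_n = a_n`.
(The CM phenomenon at levels `27`, `32`, `36`, `49` without CM theory.) [cite: Shimura1971, Prop. 3.64] -/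
theorem cuspCoeff_eq_zero_of_isNewform0_of_finrank_le_one {L m : ℕ} [NeZero L] [NeZero m]
    {χ : DirichletCharacter ℂ m} (hχ : χ.IsQuadratic) (hprim : χ.IsPrimitive) (hm : m ^ 2 ∣ L)
    (hdim : Module.finrank ℂ (CuspForm (Gamma0 L) 2) ≤ 1)
    {g : CuspForm (Gamma0 L) 2} (hg : IsNewform0 g) {n : ℕ} (hn : χ n = -1) :
    cuspCoeff g n = 0 := by
  haveI : FiniteDimensional ℂ (CuspForm (Gamma0 L) 2) := finiteDimensional_cuspForm_gamma0 L 2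
  have hg0 : g ≠ 0 := hg.ne_zero
  have h1 : Module.finrank ℂ (CuspForm (Gamma0 L) 2) = 1 := by
    have hpos : 0 < Module.finrank ℂ (CuspForm (Gamma0 L) 2) :=
      Module.finrank_pos_iff_exists_ne_zero.mpr ⟨g, hg0⟩
    omega
  obtain ⟨c, hc⟩ := (finrank_eq_one_iff_of_nonzero' g hg0).mp h1 (charTwist L dvd_rfl hm hχ g)
  have hn1 : cuspCoeff g 1 = 1 := hg.2.2
  have hc1 : c = 1 := by
    have h := congrArg (cuspCoeff · 1) hc
    simp only [cuspCoeff_smul, hn1, mul_one, cuspCoeff_charTwist L dvd_rfl hm hχ hprim g 1,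
      Nat.cast_one, map_one] at h
    exact h
  have h := congrArg (cuspCoeff · n) hc
  simp only [cuspCoeff_smul, hc1, one_mul, cuspCoeff_charTwist L dvd_rfl hm hχ hprim g n, hn,
    neg_one_mul] at h
  have h2 : (2 : ℂ) * cuspCoeff g n = 0 := by linear_combination h
  exact (mul_eq_zero.mp h2).resolve_left two_ne_zero

/-- `dim S₂(Γ₀(27)) ≤ 1` (cuspidal Sturm bound `⌊36/6⌋ + 1 − 6`; in fact `= 1`, `X₀(27)` has genus `1`). [folklore] -/
theorem finrank_cuspForm_two_gamma0_twentySeven_le :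
    Module.finrank ℂ (CuspForm (Gamma0 27) 2) ≤ 1 := by
  have h := finrank_cuspForm_two_gamma0_le 27
  obtain ⟨hμ, hν, -, -⟩ := gamma0_data_27
  rw [hμ, hν] at h
  exact h

/-- `dim S₂(Γ₀(49)) ≤ 1` from the dimension formula `dim S₂(Γ₀(49)) = g(X₀(49)) = 1` (named fact
`finrank_cuspForm_two_eq_genusX0 49`, Diamond–Shurman Thm. 3.5.1; the Sturm bound only gives `2` here).
[cite: DiamondShurman2005, Thm. 3.5.1 and Ex. 3.1.4] -/
theorem finrank_cuspForm_two_gamma0_fortyNine_le (h : finrank_cuspForm_two_eq_genusX0 49) :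
    Module.finrank ℂ (CuspForm (Gamma0 49) 2) ≤ 1 := by
  obtain ⟨hμ, hν, h₂, h₃⟩ := gamma0_data_49
  have hg : genusX0 49 = 1 := by rw [genusX0, hμ, hν, h₂, h₃]
  unfold finrank_cuspForm_two_eq_genusX0 at h
  rw [h, hg]

/-- `p ∤ φ(M)` for `M ∣ 27` and `p ≥ 5` prime (`φ(M) ∈ {1, 2, 6, 18}`). -/
theorem not_dvd_totient_of_dvd_twentySeven {M p : ℕ} (hM : M ∣ 27) (hp : p.Prime) (hp5 : 5 ≤ p) :
    ¬ p ∣ Nat.totient M := by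
  intro h
  obtain ⟨i, hi, rfl⟩ := (Nat.dvd_prime_pow Nat.prime_three).mp (show M ∣ 3 ^ 3 by simpa using hM)
  have hφ : Nat.totient (3 ^ i) ∣ 18 := by
    interval_cases i <;> decide
  rcases (Nat.Prime.dvd_mul hp).mp (show p ∣ 2 * 3 ^ 2 from h.trans hφ) with h2 | h3
  · have := (Nat.prime_dvd_prime_iff_eq hp Nat.prime_two).mp h2; omega
  · have := (Nat.prime_dvd_prime_iff_eq hp Nat.prime_three).mp (hp.dvd_of_dvd_pow h3); omega

/-- `p ∤ φ(M)` for `M ∣ 49` and `p ≥ 5` prime, `p ≠ 7` (`φ(M) ∈ {1, 6, 42}`). -/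
theorem not_dvd_totient_of_dvd_fortyNine {M p : ℕ} (hM : M ∣ 49) (hp : p.Prime) (hp5 : 5 ≤ p)
    (hp7 : p ≠ 7) : ¬ p ∣ Nat.totient M := by
  intro h
  obtain ⟨i, hi, rfl⟩ := (Nat.dvd_prime_pow (by norm_num : Nat.Prime 7)).mp
    (show M ∣ 7 ^ 2 by simpa using hM)
  have hφ : Nat.totient (7 ^ i) ∣ 42 := by
    interval_cases i <;> decide
  rcases (Nat.Prime.dvd_mul hp).mp (show p ∣ 6 * 7 from h.trans hφ) with h6 | h7
  · rcases (Nat.Prime.dvd_mul hp).mp (show p ∣ 2 * 3 from h6) with h2 | h3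
    · have := (Nat.prime_dvd_prime_iff_eq hp Nat.prime_two).mp h2; omega
    · have := (Nat.prime_dvd_prime_iff_eq hp Nat.prime_three).mp h3; omega
  · exact hp7 ((Nat.prime_dvd_prime_iff_eq hp (by norm_num)).mp h7)

/-- **§6b THE CM-LEVEL CORE (PROVED modulo the typed witness): prime-power additive conductor `r^k` whose top level is a CM line.**
Hypotheses: as `not_dvd_ordp_of_primePowerAdditive_of_not_ram` (modularity, Diamond 1995, Ogg–Saito; `p ≥ 5` multiplicative, `E[p]`
irreducible, no (ram) prime; every prime `≠ r` semistable, `r^(k+1) ∤ N_E`; `p ∤ φ(M)` for `M ∣ r^k`), but the vanishing oracle only at the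
PROPER divisors `M ∣ r^k`, `M ≠ r^k`; instead, at the top level: `dim S₂(Γ₀(r^k)) ≤ 1`, a primitive quadratic `χ mod m` with `m² ∣ r^k`, and a
WITNESS prime `q ∤ r p N_E` with `χ(q) = −1` and `a_q(E) ≢ 0 (mod p)` (supplied by HOLE 2 from `Surj`). Conclusion: `p ∤ ord_p(Δ_min)`.
Proof: Steps 1–6′ of §4 verbatim; Step 7 (new): at `M = r^k` the newform `g` is its own twist (`cuspCoeff_eq_zero_of_isNewform0_of_finrank_le_one`),
so `a_q(g) = 0`; the trace identity `exists_coeff_eq_lFunction_of_isGaloisRepOfNewform1Int` (Dénes Serre-road pattern) transports this to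
`a_q(E) ≡ 0 (mod p)` — contradiction. [cite: Ribet1990, Thm. 1.1] [cite: Diamond1995RefinedSerre, Thm. 1.1] [cite: Shimura1971, Prop. 3.64]
[cite: DeligneSerre1974, §6] -/
theorem not_dvd_ordp_of_cmLevelAdditive_of_not_ram
    (hmod : exists_isNewformOf) (hLL : diamond1995_refinedSerre)
    (hOS : ∀ (W : WeierstrassCurve ℚ) (ℓ : ℕ) [Fact ℓ.Prime],
      W.artinConductorExponent_tate_eq_conductorExponent_of_isElliptic ℓ)
    (W : WeierstrassCurve ℚ) [W.IsElliptic] [W.IsGloballyMinimal]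
    (p : ℕ) [Fact p.Prime] (hp5 : 5 ≤ p) (hmultp : Mult W p) (hirr : Irr W p) (hnram : ¬ Ram W p)
    {r k : ℕ}
    (hsemi : ∀ (ℓ : ℕ) [Fact ℓ.Prime], ℓ ≠ r →
      W.HasGoodReductionAtPrime ℓ ∨ W.HasMultiplicativeReductionAtPrime ℓ)
    (hk : ¬ r ^ (k + 1) ∣ W.conductorNorm ℤ)
    (htot : ∀ M : ℕ, M ∣ r ^ k → ¬ p ∣ Nat.totient M)
    (hvan : ∀ (M : ℕ) [NeZero M], M ∣ r ^ k → M ≠ r ^ k → ∀ f : CuspForm (Gamma0 M) 2, f = 0)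
    {m : ℕ} [NeZero m] {χ : DirichletCharacter ℂ m} (hχ : χ.IsQuadratic) (hprim : χ.IsPrimitive)
    (hm : m ^ 2 ∣ r ^ k) (hdim : Module.finrank ℂ (CuspForm (Gamma0 (r ^ k)) 2) ≤ 1)
    {q : ℕ} (hq : q.Prime) (hqp : q ≠ p) (hqr : ¬ q ∣ r) (hgood : ¬ q ∣ W.conductorNorm ℤ)
    (hχq : χ q = -1) (haq : ((W.LFunction q : ℤ) : ZMod p) ≠ 0) :
    ¬ p ∣ padicValInt p W.minimalDiscriminantInt := by
  classical
  intro hpeu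
  have hp : p.Prime := Fact.out
  have hp2 : p ≠ 2 := by omega
  have hodd : Odd p := hp.odd_of_ne_two hp2
  -- `ord_u Δ_min = v_{ℓ}(Δ_min)` at every place `u` of `ℤ`
  have hordZ : ∀ u : HeightOneSpectrum ℤ,
      W.ordMinimalDiscriminant u = padicValInt (natGenerator u) W.minimalDiscriminantInt := by
    intro u
    rw [← W.factorization_minimalDiscriminantNorm_holds u,
      minimalDiscriminantNorm_int_eq_natAbs_minimalDiscriminantInt_holds W,
      Nat.factorization_def _ (show (natGenerator u).Prime from (primesEquiv u).2)]
    rfl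
  -- `¬ Ram`: at every multiplicative place `u ∤ p` of `ℤ`, `p ∣ ord_u Δ_min`
  have hunr : ∀ u : HeightOneSpectrum ℤ, natGenerator u ≠ p → W.HasMultiplicativeReductionAt u →
      p ∣ W.ordMinimalDiscriminant u := by
    intro u hup hmu
    by_contra hdiv
    apply hnram
    refine ⟨natGenerator u, ⟨(primesEquiv u).2⟩, hup,
      (hasMultiplicativeReductionAtPrime_primesEquiv_iff_hasMultiplicativeReductionAt W u).mpr hmu,
      ?_⟩
    rwa [hordZ u] at hdiv
  -- every place `≠ r` of `ℤ` is semistable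
  have hsstZ : ∀ u : HeightOneSpectrum ℤ, natGenerator u ≠ r →
      W.HasGoodReductionAt u ∨ W.HasMultiplicativeReductionAt u := by
    intro u hu2
    haveI : Fact (natGenerator u).Prime := ⟨(primesEquiv u).2⟩
    rcases hsemi (natGenerator u) hu2 with hg | hm
    · exact Or.inl ((hasGoodReductionAtPrime_primesEquiv_iff_hasGoodReductionAt W u).mp hg)
    · exact Or.inr
        ((hasMultiplicativeReductionAtPrime_primesEquiv_iff_hasMultiplicativeReductionAt W u).mp hm)
  /- Step 1. A framed model `ρ̄` of `E[p]` and `ρ̄' = ρ̄ ⊗ 𝔽̄_p`: irreducible and odd. -/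
  haveI : NeZero ((p : ℕ) : ℚ) := ⟨by exact_mod_cast hp.ne_zero⟩
  obtain ⟨ρ, hρ⟩ := W.exists_isTorsionGaloisRep p
  letI : TopologicalSpace (AlgebraicClosure (ZMod p)) := ⊥
  haveI : DiscreteTopology (AlgebraicClosure (ZMod p)) := ⟨rfl⟩
  set j : ZMod p →+* AlgebraicClosure (ZMod p) := algebraMap (ZMod p) (AlgebraicClosure (ZMod p))
    with hj
  set ρ' : ModPGaloisRep ℚ (AlgebraicClosure (ZMod p)) 2 :=
    FramedRep.baseChange j continuous_of_discreteTopology ρ with hρ'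
  have habs := isAbsolutelyIrreducible_of_hasIrreducibleModPGaloisRep W hp2 hirr hρ
  have hirr' : ρ'.toGaloisRep.IsIrreducible := by
    rw [← ModPGaloisRep.isIrreducible_iff_toGaloisRep]
    exact habs.isIrreducible_baseChange (AlgebraicClosure (ZMod p)) j _
  have hodd' : FramedGaloisRep.IsOdd ρ' :=
    (ModPGaloisRep.isOdd_of_det_eq_modPCyclotomicCharacterZMod ρ
      (W.det_eq_modPCyclotomicCharacter_of_isTorsionGaloisRep_holds p ρ hρ)).baseChange j _
  /- Step 2. `ρ̄` and `ρ̄'` are modular, `E` being modular (`hmod`). -/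
  haveI : NeZero (W.conductorNorm ℤ) := ⟨(conductorNorm_pos_holds W).ne'⟩
  have hWmod : BCDT.IsModular W := exists_isNewformOf_iff.mp hmod W
  have hρmod : ModPGaloisRep.IsModular ρ := hWmod.isModular_of_isTorsionGaloisRep'' hρ
  have hρ'mod : ModPGaloisRep.IsModular ρ' := hρmod.baseChange_algebraicClosure
  /- Step 3. The canonical local datum at the place `v` above `p`; the weight is `2`
     (multiplicative, peu ramifié). -/
  obtain ⟨v, hv⟩ : ∃ v : HeightOneSpectrum (𝓞 ℚ), primesEquiv v = ⟨p, hp⟩ :=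
    ⟨(primesEquiv (R := 𝓞 ℚ)).symm ⟨p, hp⟩, Equiv.apply_symm_apply _ _⟩
  have hpv' : (p : 𝓞 ℚ) ∈ v.asIdeal := (natCast_mem_asIdeal_iff_primesEquiv_eq v hp).mpr (by rw [hv])
  have hvs : v = (primesEquiv (R := 𝓞 ℚ)).symm ⟨p, hp⟩ := by
    rw [Equiv.eq_symm_apply]; exact hv
  -- the place of `ℤ` above `p`
  set uZ : HeightOneSpectrum ℤ := (primesEquiv (R := ℤ)).symm ⟨p, hp⟩ with huZ
  have huZp : natGenerator uZ = p := Rat.natGenerator_primesEquiv_symm ⟨p, hp⟩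
  have hpe : (primesEquiv uZ : Nat.Primes) = ⟨p, hp⟩ := Equiv.apply_symm_apply _ _
  have hmultZ : W.HasMultiplicativeReductionAt uZ := by
    have h := hasMultiplicativeReductionAtPrime_primesEquiv_iff_hasMultiplicativeReductionAt W uZ
    rw [hpe] at h
    exact h.mp hmultp
  have hmultv : W.HasMultiplicativeReductionAt v := by
    rw [hvs]; exact hasMultiplicativeReductionAt_of_int W ⟨p, hp⟩ hmultZ
  have hpordv : p ∣ W.ordMinimalDiscriminant v := by
    rw [hvs, ordMinimalDiscriminant_eq_of_int, ← huZ, hordZ uZ, huZp]; exact hpeu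
  set loc : LocalRestrictionAt p ρ' :=
    { F := v.adicCompletion ℚ
      residueFieldCard_eq := residueFieldCard_adicCompletion_eq_of_natCast_mem hpv'
      irreducible_natCast := irreducible_natCast_valuativeInteger_adicCompletion_of_natCast_mem hpv'
      rep := FramedGaloisRep.restrictField (v.adicCompletion ℚ) ρ'
      rep_eq_restrictField := rfl } with hloc
  obtain ⟨ι⟩ := nonempty_ringHom_residue (k := AlgebraicClosure (ZMod p)) p (v.adicCompletion ℚ)
    (residueFieldCard_adicCompletion_eq_of_natCast_mem hpv')
  have hw : (serreWeight p ρ' loc ι : ℤ) = 2 := by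
    have h2 : serreWeight p ρ' loc ι = 2 :=
      serreWeight_eq_two_of_hasMultiplicativeReductionAt_of_dvd W p hp2 v hpv' hmultv hpordv hρ
        (AlgebraicClosure (ZMod p)) j ι
    rw [h2]; rfl
  /- Step 4. Level-lowering: `ρ̄'` arises from a newform `f` of weight `2` and level `M ∣ N(ρ̄')`. -/
  obtain ⟨M, hMz, hMN, f, ιf, hf, hgal⟩ :=
    hLL p hodd (AlgebraicClosure (ZMod p)) ρ' hirr' hodd' hρ'mod loc ι
  revert hgal hf ιf f
  rw [hw]
  intro f ιf hf hgal
  /- Step 5'. `N(ρ̄') ∣ r^k`: no prime `q ≠ r` divides it (good ⟹ unramified; multiplicative ⟹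
     `p`-carrier ⟹ Tate; `p` itself never), and `N(ρ̄') ∣ N_E` with `r^(k+1) ∤ N_E` (Ogg–Saito). -/
  have hN0 : serreLevel p ρ' ≠ 0 := fun h0' ↦ not_dvd_serreLevel p ρ' (h0' ▸ dvd_zero p)
  have hlevN : serreLevel p ρ' ∣ W.conductorNorm ℤ :=
    serreLevel_baseChange_dvd_conductorNorm_of_tate hOS W p ρ hρ (AlgebraicClosure (ZMod p)) j
  have hNrk : serreLevel p ρ' ∣ r ^ k := by
    refine dvd_primePow_of_forall_prime_dvd_eq hN0 (fun q hq hqN ↦ ?_) hlevN hk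
    by_contra hq2
    rcases eq_or_ne q p with rfl | hqp
    · exact not_dvd_serreLevel q ρ' hqN
    · obtain ⟨u, hu⟩ : ∃ u : HeightOneSpectrum ℤ, natGenerator u = q :=
        ⟨(primesEquiv (R := ℤ)).symm ⟨q, hq⟩, Rat.natGenerator_primesEquiv_symm ⟨q, hq⟩⟩
      rcases hsstZ u (by rw [hu]; exact hq2) with hgu | hmu
      · exact not_dvd_serreLevel_baseChange_of_hasGoodReductionAt_int W p hρ j _ u
          (by rw [hu]; exact hqp) hgu (by rw [hu]; exact hqN)
      · exact not_dvd_serreLevel_baseChange_of_hasMultiplicativeReductionAt_of_dvd_int W p hρ j _ u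
          (by rw [hu]; exact hqp) hmu (hunr u (by rw [hu]; exact hqp) hmu) (by rw [hu]; exact hqN)
  /- Step 6'. `M ∣ r^k`; `p ∤ φ(M)` so the nebentypus of `f` is trivial; descend to `Γ₀(M)`;
     at a proper divisor `M` of `r^k` there are no weight-2 cusp forms. -/
  haveI : NeZero M := hMz
  have hMrk : M ∣ r ^ k := hMN.trans hNrk
  have hε : nebentypus f = 1 :=
    nebentypus_eq_one_of_isGaloisRepOfNewform1Int_of_not_dvd_totient W hρ j (htot M hMrk) ιf hgal
      (W.conductorNorm ℤ)
      fun q _ hqB hqd ↦ absurd (Nat.le_of_dvd (conductorNorm_pos_holds W) hqd) (not_le.mpr hqB)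
  obtain ⟨g, hg, hgf⟩ := exists_isNewform0_coe_eq_of_nebentypus_eq_one hf hε
  by_cases hMe : M = r ^ k
  swap
  · exact hg.ne_zero (hvan M hMrk hMe g)
  /- Step 7 (NEW, the CM-level cut). `M = r^k`: `S₂(Γ₀(r^k))` is a line, so the quadratic twist
     `g ⊗ χ` (level `lcm(r^k, m²) = r^k`) is `g` itself and `a_q(g) = 0` whenever `χ(q) = −1`;
     but `a_q(E) ≡ a_q(g) (mod 𝔭)` at the good prime `q ∤ r p`, contradicting `a_q(E) ≢ 0 (mod p)`. -/
  subst hMe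
  have hgq : cuspCoeff g q = 0 :=
    cuspCoeff_eq_zero_of_isNewform0_of_finrank_le_one hχ hprim hm hdim hg hχq
  have hqS : q ∉ {q | q ∣ r ^ k * p} := by
    intro h'
    rcases (Nat.Prime.dvd_mul hq).mp h' with h1 | h1
    · exact hqr (hq.dvd_of_dvd_pow h1)
    · exact hqp ((Nat.prime_dvd_prime_iff_eq hq hp).mp h1)
  obtain ⟨A, hAe, hAι⟩ :=
    exists_coeff_eq_lFunction_of_isGaloisRepOfNewform1Int W hρ j ιf hgal hq hqS hqp hgood
  have hcoef : (UpperHalfPlane.qExpansion 1 ⇑f).coeff q = 0 := by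
    simpa only [cuspCoeff, hgf] using hgq
  have hA : A = 0 := by
    apply algebraMap_coeffCharIntegers_complex_injective f
    rw [RingHom.comp_apply, hAe, hcoef, map_zero]
  apply haq
  apply j.injective
  rw [map_intCast, map_zero, ← hAι, hA, map_zero]


/-! ### Instances: `N_add = 27` (`χ = (·/3)`), `N_add = 32` (`χ = χ₄`), `N_add = 49` (`χ = (·/7)`) -/

/-- **The 27-rung (`3³ ∥ N_add`), proved modulo HOLE 2:** every prime `≠ 3` semistable, `3⁴ ∤ N_E`,
`ρ̄_{E,p}` surjective ⟹ `p ∤ ord_p(Δ_min)`. Levels `M ∣ 9` carry no forms; at `M = 27` the newform is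
its own twist by `(·/3)`, so `a_q = 0` at `q ≡ 2 (mod 3)`, against a Chebotarev prime. -/
theorem not_dvd_ordp_of_twentySevenAdditive_of_not_ram
    (hmod : exists_isNewformOf) (hLL : diamond1995_refinedSerre)
    (hOS : ∀ (W : WeierstrassCurve ℚ) (ℓ : ℕ) [Fact ℓ.Prime],
      W.artinConductorExponent_tate_eq_conductorExponent_of_isElliptic ℓ)
    (W : WeierstrassCurve ℚ) [W.IsElliptic] [W.IsGloballyMinimal]
    (p : ℕ) [Fact p.Prime] (hp5 : 5 ≤ p) (hmultp : Mult W p) (hirr : Irr W p) (hsurj : Surj W p)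
    (hnram : ¬ Ram W p)
    (hsemi3 : ∀ (ℓ : ℕ) [Fact ℓ.Prime], ℓ ≠ 3 →
      W.HasGoodReductionAtPrime ℓ ∨ W.HasMultiplicativeReductionAtPrime ℓ)
    (h81 : ¬ 3 ^ 4 ∣ W.conductorNorm ℤ) :
    ¬ p ∣ padicValInt p W.minimalDiscriminantInt := by
  have hp : p.Prime := Fact.out
  have hne : jacobiChar 3 ≠ 1 := jacobiChar_ne_one (by decide) Nat.prime_three.prime.squarefree (by norm_num)
  obtain ⟨q, hq, hBq, hχq, haq⟩ := surjInertTraceWitnessAtFive_holds W p hp5 hsurj 3 (jacobiChar 3) isQuadratic_jacobiChar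
    (isPrimitive_jacobiChar (by decide) Nat.prime_three.prime.squarefree) hne (p + 3 + W.conductorNorm ℤ)
  exact not_dvd_ordp_of_cmLevelAdditive_of_not_ram hmod hLL hOS W p hp5 hmultp hirr hnram (k := 3)
    hsemi3 h81 (fun M hM ↦ not_dvd_totient_of_dvd_twentySeven (by simpa using hM) hp hp5)
    (fun M _ hM hMne f ↦ by
      have hM9 : M ∣ 9 := by
        obtain ⟨i, hi, rfl⟩ := (Nat.dvd_prime_pow Nat.prime_three).mp hM
        interval_cases i
        · exact ⟨9, by norm_num⟩
        · exact ⟨3, by norm_num⟩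
        · exact dvd_rfl
        · exact absurd rfl hMne
      exact cuspForm_two_gamma0_eq_zero_of_le_ten ((Nat.le_of_dvd (by norm_num) hM9).trans (by norm_num)) f)
    isQuadratic_jacobiChar (isPrimitive_jacobiChar (by decide) Nat.prime_three.prime.squarefree)
    (by norm_num) (by simpa using finrank_cuspForm_two_gamma0_twentySeven_le) hq (by omega)
    (fun h ↦ by have := Nat.le_of_dvd (by norm_num) h; omega)
    (fun h ↦ by have := Nat.le_of_dvd (conductorNorm_pos_holds W) h; omega) hχq haq

/-- **The 32-rung (`2⁵ ∥ N_add`), proved modulo HOLE 2:** every odd prime semistable, `2⁶ ∤ N_E`,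
`ρ̄_{E,p}` surjective ⟹ `p ∤ ord_p(Δ_min)`. Levels `M ∣ 16` carry no forms; at `M = 32` the newform
(`X₀(32)`, `dim S₂(Γ₀(32)) = 1` PROVED in the tree) is its own twist by `χ₄`: `a_q = 0` at `q ≡ 3 (mod 4)`. -/
theorem not_dvd_ordp_of_thirtyTwoAdditive_of_not_ram
    (hmod : exists_isNewformOf) (hLL : diamond1995_refinedSerre)
    (hOS : ∀ (W : WeierstrassCurve ℚ) (ℓ : ℕ) [Fact ℓ.Prime],
      W.artinConductorExponent_tate_eq_conductorExponent_of_isElliptic ℓ)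
    (W : WeierstrassCurve ℚ) [W.IsElliptic] [W.IsGloballyMinimal]
    (p : ℕ) [Fact p.Prime] (hp5 : 5 ≤ p) (hmultp : Mult W p) (hirr : Irr W p) (hsurj : Surj W p)
    (hnram : ¬ Ram W p)
    (hodd2 : ∀ (ℓ : ℕ) [Fact ℓ.Prime], ℓ ≠ 2 →
      W.HasGoodReductionAtPrime ℓ ∨ W.HasMultiplicativeReductionAtPrime ℓ)
    (h64 : ¬ 2 ^ 6 ∣ W.conductorNorm ℤ) :
    ¬ p ∣ padicValInt p W.minimalDiscriminantInt := by
  have hp : p.Prime := Fact.out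
  set χ : DirichletCharacter ℂ 4 := ZMod.χ₄.ringHomComp (Int.castRingHom ℂ) with hχdef
  have h3 : χ (3 : ℕ) = -1 := by
    rw [hχdef, MulChar.ringHomComp_apply]
    have h : ZMod.χ₄ ((3 : ℕ) : ZMod 4) = -1 := by decide
    rw [h]; simp
  have hne : χ ≠ 1 := by
    intro h1
    have h := h3
    rw [h1, MulChar.one_apply (by decide : IsUnit ((3 : ℕ) : ZMod 4))] at h
    norm_num at h
  obtain ⟨q, hq, hBq, hχq, haq⟩ := surjInertTraceWitnessAtFive_holds W p hp5 hsurj 4 χ isQuadratic_χ₄_ringHomComp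
    isPrimitive_χ₄_ringHomComp hne (p + 2 + W.conductorNorm ℤ)
  exact not_dvd_ordp_of_cmLevelAdditive_of_not_ram hmod hLL hOS W p hp5 hmultp hirr hnram (k := 5)
    hodd2 h64 (fun M hM ↦ not_dvd_totient_of_dvd_thirtyTwo (by simpa using hM) hp (by omega))
    (fun M _ hM hMne f ↦ by
      have hM16 : M ∣ 16 := by
        obtain ⟨i, hi, rfl⟩ := (Nat.dvd_prime_pow Nat.prime_two).mp hM
        interval_cases i
        · exact ⟨16, by norm_num⟩
        · exact ⟨8, by norm_num⟩
        · exact ⟨4, by norm_num⟩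
        · exact ⟨2, by norm_num⟩
        · exact dvd_rfl
        · exact absurd rfl hMne
      exact cuspForm_two_gamma0_eq_zero_of_dvd_sixteen hM16 f)
    isQuadratic_χ₄_ringHomComp isPrimitive_χ₄_ringHomComp (by norm_num)
    (by simpa using finrank_cuspForm_two_gamma0_thirtyTwo.le) hq (by omega)
    (fun h ↦ by have := Nat.le_of_dvd (by norm_num) h; omega)
    (fun h ↦ by have := Nat.le_of_dvd (conductorNorm_pos_holds W) h; omega) hχq haq

/-- **The 49-rung (`7² ∥ N_add`), proved modulo HOLE 2 and the dimension formula at level `49`:**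
every prime `≠ 7` semistable, `7³ ∤ N_E`, `p ≠ 7`, `ρ̄_{E,p}` surjective ⟹ `p ∤ ord_p(Δ_min)`. Levels
`M ∣ 7` carry no forms; at `M = 49` the newform (`X₀(49)`) is its own twist by `(·/7)`.
(At `p = 7` the locus is semistable and §3 applies.) -/
theorem not_dvd_ordp_of_fortyNineAdditive_of_not_ram
    (hmod : exists_isNewformOf) (hLL : diamond1995_refinedSerre)
    (hOS : ∀ (W : WeierstrassCurve ℚ) (ℓ : ℕ) [Fact ℓ.Prime],
      W.artinConductorExponent_tate_eq_conductorExponent_of_isElliptic ℓ)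
    (hDS49 : finrank_cuspForm_two_eq_genusX0 49)
    (W : WeierstrassCurve ℚ) [W.IsElliptic] [W.IsGloballyMinimal]
    (p : ℕ) [Fact p.Prime] (hp5 : 5 ≤ p) (hp7 : p ≠ 7) (hmultp : Mult W p) (hirr : Irr W p)
    (hsurj : Surj W p) (hnram : ¬ Ram W p)
    (hsemi7 : ∀ (ℓ : ℕ) [Fact ℓ.Prime], ℓ ≠ 7 →
      W.HasGoodReductionAtPrime ℓ ∨ W.HasMultiplicativeReductionAtPrime ℓ)
    (h343 : ¬ 7 ^ 3 ∣ W.conductorNorm ℤ) :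
    ¬ p ∣ padicValInt p W.minimalDiscriminantInt := by
  have hp : p.Prime := Fact.out
  have hne : jacobiChar 7 ≠ 1 := jacobiChar_ne_one (by decide) (by norm_num : Nat.Prime 7).prime.squarefree (by norm_num)
  obtain ⟨q, hq, hBq, hχq, haq⟩ := surjInertTraceWitnessAtFive_holds W p hp5 hsurj 7 (jacobiChar 7) isQuadratic_jacobiChar
    (isPrimitive_jacobiChar (by decide) (by norm_num : Nat.Prime 7).prime.squarefree) hne (p + 7 + W.conductorNorm ℤ)
  exact not_dvd_ordp_of_cmLevelAdditive_of_not_ram hmod hLL hOS W p hp5 hmultp hirr hnram (k := 2)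
    hsemi7 h343 (fun M hM ↦ not_dvd_totient_of_dvd_fortyNine (by simpa using hM) hp hp5 hp7)
    (fun M _ hM hMne f ↦ by
      have hM7 : M ∣ 7 := by
        obtain ⟨i, hi, rfl⟩ := (Nat.dvd_prime_pow (by norm_num : Nat.Prime 7)).mp hM
        interval_cases i
        · exact ⟨7, by norm_num⟩
        · exact dvd_rfl
        · exact absurd rfl hMne
      exact cuspForm_two_gamma0_eq_zero_of_le_ten ((Nat.le_of_dvd (by norm_num) hM7).trans (by norm_num)) f)
    isQuadratic_jacobiChar
    (isPrimitive_jacobiChar (by decide) (by norm_num : Nat.Prime 7).prime.squarefree) (by norm_num)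
    (by simpa using finrank_cuspForm_two_gamma0_fortyNine_le hDS49) hq (by omega)
    (fun h ↦ by have := Nat.le_of_dvd (by norm_num) h; omega)
    (fun h ↦ by have := Nat.le_of_dvd (conductorNorm_pos_holds W) h; omega) hχq haq


/-- **`SelfCarrierFreeOnTwentySevenAdditiveOfSurjAtFive` (TYPED, v4):** on 19715's locus with `ρ̄_{E,p}` SURJECTIVE, every prime `≠ 3`
semistable and `3⁴ ∤ N_E` (`N_add ∣ 27` ⊋ the v2 locus `N_add ∣ 9`): `p ∤ ord_p(Δ_min)`. -/
def SelfCarrierFreeOnTwentySevenAdditiveOfSurjAtFive : Prop :=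
  ∀ (W : WeierstrassCurve ℚ) [W.IsElliptic] [W.IsGloballyMinimal] (p : ℕ) [Fact p.Prime],
    5 ≤ p → Mult W p → Irr W p → Surj W p → ¬ Ram W p →
    ((∀ (ℓ : ℕ) [Fact ℓ.Prime], ℓ ≠ 3 → W.HasGoodReductionAtPrime ℓ ∨ W.HasMultiplicativeReductionAtPrime ℓ) ∧
      ¬ 3 ^ 4 ∣ W.conductorNorm ℤ) →
    ¬ p ∣ padicValInt p W.minimalDiscriminantInt

/-- **§6c, packaged: the 27-rung HOLDS** given modularity, Diamond 1995, Ogg–Saito and HOLE 2. -/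
theorem selfCarrierFreeOnTwentySevenAdditiveOfSurjAtFive_of (hnf : exists_isNewformOf) (hLL : diamond1995_refinedSerre)
    (hOS : ∀ (W : WeierstrassCurve ℚ) (ℓ : ℕ) [Fact ℓ.Prime],
      W.artinConductorExponent_tate_eq_conductorExponent_of_isElliptic ℓ) :
    SelfCarrierFreeOnTwentySevenAdditiveOfSurjAtFive :=
  fun W _ _ p _ hp5 hM hI hS hnram hL ↦
    not_dvd_ordp_of_twentySevenAdditive_of_not_ram hnf hLL hOS W p hp5 hM hI hS hnram hL.1 hL.2

/-- **`SelfCarrierFreeOnThirtyTwoAdditiveOfSurjAtFive` (TYPED, v4):** on 19715's locus with `ρ̄_{E,p}` SURJECTIVE, every odd prime semistable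
and `2⁶ ∤ N_E` (`N_add ∣ 32` ⊋ the v2 locus `N_add ∣ 16`): `p ∤ ord_p(Δ_min)`. -/
def SelfCarrierFreeOnThirtyTwoAdditiveOfSurjAtFive : Prop :=
  ∀ (W : WeierstrassCurve ℚ) [W.IsElliptic] [W.IsGloballyMinimal] (p : ℕ) [Fact p.Prime],
    5 ≤ p → Mult W p → Irr W p → Surj W p → ¬ Ram W p →
    ((∀ (ℓ : ℕ) [Fact ℓ.Prime], ℓ ≠ 2 → W.HasGoodReductionAtPrime ℓ ∨ W.HasMultiplicativeReductionAtPrime ℓ) ∧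
      ¬ 2 ^ 6 ∣ W.conductorNorm ℤ) →
    ¬ p ∣ padicValInt p W.minimalDiscriminantInt

/-- **§6c, packaged: the 32-rung HOLDS** given modularity, Diamond 1995, Ogg–Saito and HOLE 2 (`dim S₂(Γ₀(32)) = 1` is a tree theorem). -/
theorem selfCarrierFreeOnThirtyTwoAdditiveOfSurjAtFive_of (hnf : exists_isNewformOf) (hLL : diamond1995_refinedSerre)
    (hOS : ∀ (W : WeierstrassCurve ℚ) (ℓ : ℕ) [Fact ℓ.Prime],
      W.artinConductorExponent_tate_eq_conductorExponent_of_isElliptic ℓ) :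
    SelfCarrierFreeOnThirtyTwoAdditiveOfSurjAtFive :=
  fun W _ _ p _ hp5 hM hI hS hnram hL ↦
    not_dvd_ordp_of_thirtyTwoAdditive_of_not_ram hnf hLL hOS W p hp5 hM hI hS hnram hL.1 hL.2

/-- **`SelfCarrierFreeOnFortyNineAdditiveOfSurjAtFive` (TYPED, v4):** on 19715's locus with `ρ̄_{E,p}` SURJECTIVE, every prime `≠ 7`
semistable and `7³ ∤ N_E` (`N_add ∣ 49`, a NEW locus): `p ∤ ord_p(Δ_min)`. -/
def SelfCarrierFreeOnFortyNineAdditiveOfSurjAtFive : Prop :=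
  ∀ (W : WeierstrassCurve ℚ) [W.IsElliptic] [W.IsGloballyMinimal] (p : ℕ) [Fact p.Prime],
    5 ≤ p → Mult W p → Irr W p → Surj W p → ¬ Ram W p →
    ((∀ (ℓ : ℕ) [Fact ℓ.Prime], ℓ ≠ 7 → W.HasGoodReductionAtPrime ℓ ∨ W.HasMultiplicativeReductionAtPrime ℓ) ∧
      ¬ 7 ^ 3 ∣ W.conductorNorm ℤ) →
    ¬ p ∣ padicValInt p W.minimalDiscriminantInt

/-- **§6c, packaged: the 49-rung HOLDS** given modularity, Diamond 1995, Ogg–Saito, HOLE 2 and the dimension formula at level 49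
(`by_cases p = 7`: then the curve is semistable and §3 applies, no twist needed). -/
theorem selfCarrierFreeOnFortyNineAdditiveOfSurjAtFive_of (hnf : exists_isNewformOf) (hLL : diamond1995_refinedSerre)
    (hOS : ∀ (W : WeierstrassCurve ℚ) (ℓ : ℕ) [Fact ℓ.Prime],
      W.artinConductorExponent_tate_eq_conductorExponent_of_isElliptic ℓ)
    (hDS49 : finrank_cuspForm_two_eq_genusX0 49) :
    SelfCarrierFreeOnFortyNineAdditiveOfSurjAtFive := by
  intro W _ _ p _ hp5 hM hI hS hnram hL
  by_cases hp7 : p = 7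
  · subst hp7
    have hsst : Semistable W := fun ℓ hℓ ↦ by
      haveI : Fact ℓ.Prime := ⟨hℓ⟩
      by_cases h7 : ℓ = 7
      · subst h7; exact Or.inr hM
      · exact hL.1 ℓ h7
    exact not_dvd_ordp_of_semistable_of_not_ram hnf hLL W 7 hp5 hM hI hsst hnram
  · exact not_dvd_ordp_of_fortyNineAdditive_of_not_ram hnf hLL hOS hDS49 W p hp5 hp7 hM hI hS hnram hL.1 hL.2

end CMLevelProof

/-- **§6d (generic, PROVED): a self-carrier-free rung on a locus `L` that may use `Surj` gives 19715 on `L`** — by the (W)-witness at `p`,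
the exhaustion lemma (§2) and the landed B♯ road (HOLE 1), exactly as §4b′. -/
theorem res_of_selfCarrierFreeOfSurjOn
    (L : ∀ (W : WeierstrassCurve ℚ) [W.IsElliptic] [W.IsGloballyMinimal], Prop)
    (hGZK : rank_eq_analyticRank_of_analyticRank_le_one) (hmod : hasEntireLFunction_rat)
    (hnf : exists_isNewformOf) (hFH : friedbergHoffstein_exists_twist_ne_zero_inertAt)
    (hMaz : mazur_not_dvd_maninConstant_of_odd)
    (hBR : localTamagawaNumber_quadraticTwist_two_mem_of_goodReduction)
    (hJL : nonempty_shimuraParametrizationData)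
    (hCO : PastenShimura2024_componentOrders)
    (hSCF : ∀ (W : WeierstrassCurve ℚ) [W.IsElliptic] [W.IsGloballyMinimal] (p : ℕ) [Fact p.Prime],
      5 ≤ p → Mult W p → Irr W p → Surj W p → ¬ Ram W p → L W → ¬ p ∣ padicValInt p W.minimalDiscriminantInt)
    (hX11a : ∀ (Wd : WeierstrassCurve ℚ) [Wd.IsElliptic] [Wd.IsGloballyMinimal] (p : ℕ) [Fact p.Prime],
      ClassX11a Wd p → Typed.MissingLowerBoundAt Wd p)
    (hSavD : ∀ (W : WeierstrassCurve ℚ) [W.IsElliptic] [W.IsGloballyMinimal] (p : ℕ) [Fact p.Prime]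
      (q₁ : ℕ) [Fact q₁.Prime], ClassX11b W p → 5 ≤ p → Surj W p → ¬ Ram W p →
      W.HasSplitMultiplicativeReductionAtPrime q₁ → p ∣ padicValInt q₁ W.minimalDiscriminantInt →
      Theorems.ShimuraInertSavedDisplayAtD W p q₁) :
    ∀ (W : WeierstrassCurve ℚ) [W.IsElliptic] [W.IsGloballyMinimal] (p : ℕ) [Fact p.Prime],
      ClassX11b W p → 5 ≤ p → Surj W p → ¬ Ram W p → p ∣ W.tamagawaProduct → L W →
      ¬ InertSetDatum W p → Typed.MissingUpperBoundAt W p := by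
  intro W _ _ p _ hX hp5 hsurj hnram htam hL hnoA
  obtain ⟨-, -, hMp, hirr⟩ := id hX
  have hp : p.Prime := Fact.out
  have hW : ¬ p ∣ padicValInt p W.minimalDiscriminantInt := hSCF W p hp5 hMp hirr hsurj hnram hL
  have hother : ∃ ℓ : ℕ, ∃ _ : Fact ℓ.Prime, ℓ ≠ p ∧ W.HasMultiplicativeReductionAtPrime ℓ := by
    obtain ⟨ℓ, _, hs, hd⟩ := (dvd_tamagawaProduct_iff_exists_split W hp hp5).mp htam
    refine ⟨ℓ, ‹_›, ?_, hs.hasMultiplicativeReductionAtPrime⟩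
    rintro rfl
    exact hW hd
  have hB : UpToOneSharpDatum W p := by
    by_contra hnoB
    exact hW (allCarriers_of_not_inertSetDatum_of_not_upToOneSharpDatum W p hp5 hMp hother hnoA hnoB p hMp)
  exact res_upToOneSharpAtFive_of_savedDisplayD_of_lowerX11a hGZK hmod hnf hFH hMaz hBR hJL hCO hX11a hSavD W p hX hp5 hsurj hnram hB

/-- **§6d (generic, over the ROUTE ITEMS): 19715's binders VERBATIM + the locus hypothesis `L W`** from a rung on `L` (+ HOLE 1) — PROVED.
CONDITIONAL; nothing booked; 19715 NOT closed; BSD NOT proved. -/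
theorem res_of_selfCarrierFreeOfSurjOn_of_items
    (L : ∀ (W : WeierstrassCurve ℚ) [W.IsElliptic] [W.IsGloballyMinimal], Prop)
    (h₅ : Summit.BirchSwinnertonDyer.BirchSwinnertonDyer.Theses.ErratumRoadFive.PublishedInputsFive)
    (h₃ : Summit.BirchSwinnertonDyer.BirchSwinnertonDyer.Theses.ErratumRoadFive.X11aLowerHalf)
    (hJL : Summit.BirchSwinnertonDyer.BirchSwinnertonDyer.Theses.ErratumRoadFive.ShimuraParametrizationDataNonempty)
    (hCO : Summit.BirchSwinnertonDyer.BirchSwinnertonDyer.Theses.ErratumRoadFive.PastenComponentOrdersInput)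
    (hSCF : ∀ (W : WeierstrassCurve ℚ) [W.IsElliptic] [W.IsGloballyMinimal] (p : ℕ) [Fact p.Prime],
      5 ≤ p → Mult W p → Irr W p → Surj W p → ¬ Ram W p → L W → ¬ p ∣ padicValInt p W.minimalDiscriminantInt)
    (hSav : ∀ (W : WeierstrassCurve ℚ) [W.IsElliptic] [W.IsGloballyMinimal] (p : ℕ) [Fact p.Prime]
      (q₁ : ℕ) [Fact q₁.Prime], ClassX11b W p → 5 ≤ p → Surj W p → ¬ Ram W p →
      W.HasSplitMultiplicativeReductionAtPrime q₁ → p ∣ padicValInt q₁ W.minimalDiscriminantInt →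
      Theorems.ShimuraInertSavedDisplayAtD W p q₁) :
    ∀ (W : WeierstrassCurve ℚ) [W.IsElliptic] [W.IsGloballyMinimal] (p : ℕ) [Fact p.Prime],
      Summit.BirchSwinnertonDyer.Rank1Residual.ClassX11b W p → 5 ≤ p →
      Literature.NumberTheory.EllipticCurves.Rank1Residual.Surj W p →
      ¬ Literature.NumberTheory.EllipticCurves.Rank1Residual.Ram W p → p ∣ W.tamagawaProduct →
      ¬ (∃ S : Finset ℕ, (∀ ℓ ∈ S, ∃ _ : Fact ℓ.Prime, Literature.NumberTheory.EllipticCurves.Rank1Residual.Mult W ℓ) ∧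
          Even S.card ∧ p ∈ S ∧
          (∀ (ℓ : ℕ) [Fact ℓ.Prime], ℓ ∉ S → W.HasSplitMultiplicativeReductionAtPrime ℓ →
            ¬ p ∣ padicValInt ℓ W.minimalDiscriminantInt) ∧
          (¬ p ∣ padicValInt p W.minimalDiscriminantInt ∨
            ∃ R ⊆ S, S.card = 2 * R.card ∧ ∀ q ∈ R, q ≠ 2 ∧ ¬ p ∣ q - 1)) →
      L W → Literature.NumberTheory.EllipticCurves.Rank1Residual.Typed.MissingUpperBoundAt W p := by
  intro W _ _ p _ hX hp5 hsurj hnram htam hnoA hL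
  obtain ⟨-, -, -, -, -, hGZK, hmod, hnf, -, -, hMaz, -, hFH, -, -⟩ := h₅
  exact res_of_selfCarrierFreeOfSurjOn L hGZK hmod hnf hFH hMaz
    localTamagawaNumber_quadraticTwist_two_mem_of_goodReduction_holds hJL hCO hSCF (fun Wd _ _ p _ hXa ↦ h₃ Wd p hXa) hSav
    W p hX hp5 hsurj hnram htam hL hnoA

/-- `exists_isNewformOf` is a conjunct of `PublishedInputsFive` (bookkeeping). -/
theorem exists_isNewformOf_of_publishedInputsFive
    (h₅ : Summit.BirchSwinnertonDyer.BirchSwinnertonDyer.Theses.ErratumRoadFive.PublishedInputsFive) : exists_isNewformOf := by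
  obtain ⟨-, -, -, -, -, -, -, hnf, -, -, -, -, -, -, -⟩ := h₅
  exact hnf

/-- **`ResThreeBadOffendingAfterCMCutsAtFive` (TYPED `def`, nothing asserted; v4): the HONEST residual of S2c″ after ALL the cuts of this file incl. §6** —
v9's S2c″ VERBATIM with four extra hypotheses: NOT on the loci `N_add ∣ 32` (every odd prime semistable, `2⁶ ∤ N_E`), `N_add ∣ 27`, `N_add ∣ 25`, `N_add ∣ 49`.
Equivalently: an additive prime `∉ {2, 3, 5, 7}`, or two additive primes, or `2⁶ ∣ N_E`, or `3⁴ ∣ N_E`, or `5³ ∣ N_E`, or `7³ ∣ N_E`. -/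
def ResThreeBadOffendingAfterCMCutsAtFive : Prop :=
    ∀ (W : WeierstrassCurve ℚ) [W.IsElliptic] [W.IsGloballyMinimal] (p : ℕ) [Fact p.Prime], Summit.BirchSwinnertonDyer.Rank1Residual.ClassX11b W p → 5 ≤ p → Literature.NumberTheory.EllipticCurves.Rank1Residual.Surj W p → ¬ Literature.NumberTheory.EllipticCurves.Rank1Residual.Ram W p → p ∣ W.tamagawaProduct → (∃ ℓ : ℕ, ∃ _ : Fact ℓ.Prime, ℓ ≠ p ∧ W.HasMultiplicativeReductionAtPrime ℓ) → 
      (∃ (q₁ q₂ q₃ : ℕ) (_ : Fact q₁.Prime) (_ : Fact q₂.Prime) (_ : Fact q₃.Prime),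
        q₁ ≠ p ∧ q₂ ≠ p ∧ q₃ ≠ p ∧ q₁ ≠ q₂ ∧ q₁ ≠ q₃ ∧ q₂ ≠ q₃ ∧
        (W.HasSplitMultiplicativeReductionAtPrime q₁ ∧ p ∣ padicValInt q₁ W.minimalDiscriminantInt ∧ (q₁ = 2 ∨ p ∣ q₁ - 1)) ∧
        (W.HasSplitMultiplicativeReductionAtPrime q₂ ∧ p ∣ padicValInt q₂ W.minimalDiscriminantInt ∧ (q₂ = 2 ∨ p ∣ q₂ - 1)) ∧
        (W.HasSplitMultiplicativeReductionAtPrime q₃ ∧ p ∣ padicValInt q₃ W.minimalDiscriminantInt ∧ (q₃ = 2 ∨ p ∣ q₃ - 1))) →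
      ¬ (∃ S : Finset ℕ, (∀ ℓ ∈ S, ∃ _ : Fact ℓ.Prime, Literature.NumberTheory.EllipticCurves.Rank1Residual.Mult W ℓ) ∧ Even S.card ∧ p ∈ S ∧ (∀ (ℓ : ℕ) [Fact ℓ.Prime], ℓ ∉ S → W.HasSplitMultiplicativeReductionAtPrime ℓ → ¬ p ∣ padicValInt ℓ W.minimalDiscriminantInt) ∧ (¬ p ∣ padicValInt p W.minimalDiscriminantInt ∨ ∃ R ⊆ S, S.card = 2 * R.card ∧ ∀ q ∈ R, q ≠ 2 ∧ ¬ p ∣ q - 1)) → ¬ (∃ S : Finset ℕ, (∀ ℓ ∈ S, ∃ _ : Fact ℓ.Prime, Literature.NumberTheory.EllipticCurves.Rank1Residual.Mult W ℓ) ∧ Even S.card ∧ p ∉ S ∧ (∀ (ℓ : ℕ) [Fact ℓ.Prime], ℓ ∉ S → W.HasSplitMultiplicativeReductionAtPrime ℓ → ¬ p ∣ padicValInt ℓ W.minimalDiscriminantInt) ∧ ((∃ (ℓ₀ : ℕ) (_ : Fact ℓ₀.Prime), Literature.NumberTheory.EllipticCurves.Rank1Residual.Mult W ℓ₀ ∧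 ℓ₀ ≠ p ∧ ¬ p ∣ padicValInt ℓ₀ W.minimalDiscriminantInt) ∨ ∃ R ⊆ S, S.card = 2 * R.card ∧ ∀ q ∈ R, ¬ p ∣ q - 1)) →
      ¬ (∃ (q₁ : ℕ) (_ : Fact q₁.Prime) (S : Finset ℕ), W.HasSplitMultiplicativeReductionAtPrime q₁ ∧
        p ∣ padicValInt q₁ W.minimalDiscriminantInt ∧
        (∀ ℓ ∈ S, ∃ _ : Fact ℓ.Prime, Literature.NumberTheory.EllipticCurves.Rank1Residual.Mult W ℓ) ∧ Even S.card ∧ p ∈ S ∧ q₁ ∉ S ∧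
        (∀ (ℓ : ℕ) [Fact ℓ.Prime], ℓ ∉ S → ℓ ≠ q₁ → W.HasSplitMultiplicativeReductionAtPrime ℓ →
          ¬ p ∣ padicValInt ℓ W.minimalDiscriminantInt) ∧
        ∃ R ⊆ S, S.card = 2 * R.card ∧ ∀ q ∈ R, q ≠ 2 ∧ ¬ p ∣ q - 1) →
      ¬ ((∀ (ℓ : ℕ) [Fact ℓ.Prime], ℓ ≠ 2 → W.HasGoodReductionAtPrime ℓ ∨ W.HasMultiplicativeReductionAtPrime ℓ) ∧
          ¬ 2 ^ 6 ∣ W.conductorNorm ℤ) →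
      ¬ ((∀ (ℓ : ℕ) [Fact ℓ.Prime], ℓ ≠ 3 → W.HasGoodReductionAtPrime ℓ ∨ W.HasMultiplicativeReductionAtPrime ℓ) ∧
          ¬ 3 ^ 4 ∣ W.conductorNorm ℤ) →
      ¬ ((∀ (ℓ : ℕ) [Fact ℓ.Prime], ℓ ≠ 5 → W.HasGoodReductionAtPrime ℓ ∨ W.HasMultiplicativeReductionAtPrime ℓ) ∧
          ¬ 5 ^ 3 ∣ W.conductorNorm ℤ) →
      ¬ ((∀ (ℓ : ℕ) [Fact ℓ.Prime], ℓ ≠ 7 → W.HasGoodReductionAtPrime ℓ ∨ W.HasMultiplicativeReductionAtPrime ℓ) ∧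
          ¬ 7 ^ 3 ∣ W.conductorNorm ℤ) →
      Literature.NumberTheory.EllipticCurves.Rank1Residual.Typed.MissingUpperBoundAt W p

/-- **S2c″ ⟸ `ResThreeBadOffendingAfterCMCutsAtFive`** (given the items, HOLE 1, HOLE 2, `hLL`, `hOS`, `hDS49`): the sharpest v10 graft option of this
file — PROVED. Nothing booked; 19715 NOT closed; BSD NOT proved. -/
theorem res_threeBadOffending_of_afterCMCuts_of_items
    (h₅ : Summit.BirchSwinnertonDyer.BirchSwinnertonDyer.Theses.ErratumRoadFive.PublishedInputsFive)
    (h₃ : Summit.BirchSwinnertonDyer.BirchSwinnertonDyer.Theses.ErratumRoadFive.X11aLowerHalf)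
    (hJL : Summit.BirchSwinnertonDyer.BirchSwinnertonDyer.Theses.ErratumRoadFive.ShimuraParametrizationDataNonempty)
    (hCO : Summit.BirchSwinnertonDyer.BirchSwinnertonDyer.Theses.ErratumRoadFive.PastenComponentOrdersInput)
    (hLL : diamond1995_refinedSerre)
    (hOS : ∀ (W : WeierstrassCurve ℚ) (ℓ : ℕ) [Fact ℓ.Prime],
      W.artinConductorExponent_tate_eq_conductorExponent_of_isElliptic ℓ)
    (hDS49 : finrank_cuspForm_two_eq_genusX0 49)
    (hSav : ∀ (W : WeierstrassCurve ℚ) [W.IsElliptic] [W.IsGloballyMinimal] (p : ℕ) [Fact p.Prime]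
      (q₁ : ℕ) [Fact q₁.Prime], ClassX11b W p → 5 ≤ p → Surj W p → ¬ Ram W p →
      W.HasSplitMultiplicativeReductionAtPrime q₁ → p ∣ padicValInt q₁ W.minimalDiscriminantInt →
      Theorems.ShimuraInertSavedDisplayAtD W p q₁)
    (hRes : ResThreeBadOffendingAfterCMCutsAtFive) :
    ∀ (W : WeierstrassCurve ℚ) [W.IsElliptic] [W.IsGloballyMinimal] (p : ℕ) [Fact p.Prime], Summit.BirchSwinnertonDyer.Rank1Residual.ClassX11b W p → 5 ≤ p → Literature.NumberTheory.EllipticCurves.Rank1Residual.Surj W p → ¬ Literature.NumberTheory.EllipticCurves.Rank1Residual.Ram W p → p ∣ W.tamagawaProduct → (∃ ℓ : ℕ, ∃ _ : Fact ℓ.Prime, ℓ ≠ p ∧ W.HasMultiplicativeReductionAtPrime ℓ) → 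
      (∃ (q₁ q₂ q₃ : ℕ) (_ : Fact q₁.Prime) (_ : Fact q₂.Prime) (_ : Fact q₃.Prime),
        q₁ ≠ p ∧ q₂ ≠ p ∧ q₃ ≠ p ∧ q₁ ≠ q₂ ∧ q₁ ≠ q₃ ∧ q₂ ≠ q₃ ∧
        (W.HasSplitMultiplicativeReductionAtPrime q₁ ∧ p ∣ padicValInt q₁ W.minimalDiscriminantInt ∧ (q₁ = 2 ∨ p ∣ q₁ - 1)) ∧
        (W.HasSplitMultiplicativeReductionAtPrime q₂ ∧ p ∣ padicValInt q₂ W.minimalDiscriminantInt ∧ (q₂ = 2 ∨ p ∣ q₂ - 1)) ∧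
        (W.HasSplitMultiplicativeReductionAtPrime q₃ ∧ p ∣ padicValInt q₃ W.minimalDiscriminantInt ∧ (q₃ = 2 ∨ p ∣ q₃ - 1))) →
      ¬ (∃ S : Finset ℕ, (∀ ℓ ∈ S, ∃ _ : Fact ℓ.Prime, Literature.NumberTheory.EllipticCurves.Rank1Residual.Mult W ℓ) ∧ Even S.card ∧ p ∈ S ∧ (∀ (ℓ : ℕ) [Fact ℓ.Prime], ℓ ∉ S → W.HasSplitMultiplicativeReductionAtPrime ℓ → ¬ p ∣ padicValInt ℓ W.minimalDiscriminantInt) ∧ (¬ p ∣ padicValInt p W.minimalDiscriminantInt ∨ ∃ R ⊆ S, S.card = 2 * R.card ∧ ∀ q ∈ R, q ≠ 2 ∧ ¬ p ∣ q - 1)) → ¬ (∃ S : Finset ℕ, (∀ ℓ ∈ S, ∃ _ : Fact ℓ.Prime, Literature.NumberTheory.EllipticCurves.Rank1Residual.Mult W ℓ) ∧ Even S.card ∧ p ∉ S ∧ (∀ (ℓ : ℕ) [Fact ℓ.Prime], ℓ ∉ S → W.HasSplitMultiplicativeReductionAtPrime ℓ → ¬ p ∣ padicValInt ℓ W.minimalDiscriminantInt)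 ∧ ((∃ (ℓ₀ : ℕ) (_ : Fact ℓ₀.Prime), Literature.NumberTheory.EllipticCurves.Rank1Residual.Mult W ℓ₀ ∧ ℓ₀ ≠ p ∧ ¬ p ∣ padicValInt ℓ₀ W.minimalDiscriminantInt) ∨ ∃ R ⊆ S, S.card = 2 * R.card ∧ ∀ q ∈ R, ¬ p ∣ q - 1)) →
      ¬ (∃ (q₁ : ℕ) (_ : Fact q₁.Prime) (S : Finset ℕ), W.HasSplitMultiplicativeReductionAtPrime q₁ ∧
        p ∣ padicValInt q₁ W.minimalDiscriminantInt ∧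
        (∀ ℓ ∈ S, ∃ _ : Fact ℓ.Prime, Literature.NumberTheory.EllipticCurves.Rank1Residual.Mult W ℓ) ∧ Even S.card ∧ p ∈ S ∧ q₁ ∉ S ∧
        (∀ (ℓ : ℕ) [Fact ℓ.Prime], ℓ ∉ S → ℓ ≠ q₁ → W.HasSplitMultiplicativeReductionAtPrime ℓ →
          ¬ p ∣ padicValInt ℓ W.minimalDiscriminantInt) ∧
        ∃ R ⊆ S, S.card = 2 * R.card ∧ ∀ q ∈ R, q ≠ 2 ∧ ¬ p ∣ q - 1) →
      Literature.NumberTheory.EllipticCurves.Rank1Residual.Typed.MissingUpperBoundAt W p := by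
  intro W _ _ p _ hX hp5 hsurj hnram htam hother h3 hnoA hnoD hnoB
  have hnf : exists_isNewformOf := exists_isNewformOf_of_publishedInputsFive h₅
  by_cases h2 : (∀ (ℓ : ℕ) [Fact ℓ.Prime], ℓ ≠ 2 → W.HasGoodReductionAtPrime ℓ ∨ W.HasMultiplicativeReductionAtPrime ℓ) ∧
      ¬ 2 ^ 6 ∣ W.conductorNorm ℤ
  · exact res_of_selfCarrierFreeOfSurjOn_of_items _ h₅ h₃ hJL hCO (selfCarrierFreeOnThirtyTwoAdditiveOfSurjAtFive_of hnf hLL hOS) hSav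
      W p hX hp5 hsurj hnram htam hnoA h2
  by_cases h3' : (∀ (ℓ : ℕ) [Fact ℓ.Prime], ℓ ≠ 3 → W.HasGoodReductionAtPrime ℓ ∨ W.HasMultiplicativeReductionAtPrime ℓ) ∧
      ¬ 3 ^ 4 ∣ W.conductorNorm ℤ
  · exact res_of_selfCarrierFreeOfSurjOn_of_items _ h₅ h₃ hJL hCO (selfCarrierFreeOnTwentySevenAdditiveOfSurjAtFive_of hnf hLL hOS) hSav
      W p hX hp5 hsurj hnram htam hnoA h3'
  by_cases h5' : (∀ (ℓ : ℕ) [Fact ℓ.Prime], ℓ ≠ 5 → W.HasGoodReductionAtPrime ℓ ∨ W.HasMultiplicativeReductionAtPrime ℓ) ∧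
      ¬ 5 ^ 3 ∣ W.conductorNorm ℤ
  · exact res_fiveSquareAdditiveAtFive_of_items h₅ h₃ hJL hCO hLL hOS hSav W p hX hp5 hsurj hnram htam hnoA
      (fun ℓ _ hℓ ↦ h5'.1 ℓ hℓ) h5'.2
  by_cases h7' : (∀ (ℓ : ℕ) [Fact ℓ.Prime], ℓ ≠ 7 → W.HasGoodReductionAtPrime ℓ ∨ W.HasMultiplicativeReductionAtPrime ℓ) ∧
      ¬ 7 ^ 3 ∣ W.conductorNorm ℤ
  · exact res_of_selfCarrierFreeOfSurjOn_of_items _ h₅ h₃ hJL hCO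
      (selfCarrierFreeOnFortyNineAdditiveOfSurjAtFive_of hnf hLL hOS hDS49) hSav W p hX hp5 hsurj hnram htam hnoA h7'
  · exact hRes W p hX hp5 hsurj hnram htam hother h3 hnoA hnoD hnoB h2 h3' h5' h7'

/-- **The v3 residual implies the v4 residual's complement is covered** (bookkeeping): `ResThreeBadOffendingAfterCutsAtFive → ResThreeBadOffendingAfterCMCutsAtFive`
— the v4 residual is a WEAKER demand (more hypotheses). -/
theorem resAfterCMCuts_of_resAfterCuts (h : ResThreeBadOffendingAfterCutsAtFive) : ResThreeBadOffendingAfterCMCutsAtFive := by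
  intro W _ _ p _ hX hp5 hsurj hnram htam hother h3 hnoA hnoD hnoB h2 h3' h5' _
  refine h W p hX hp5 hsurj hnram htam hother h3 hnoA hnoD hnoB (fun h2w ↦ h2 ⟨h2w.1, fun h64 ↦ h2w.2 ?_⟩)
    (fun h3w ↦ h3' ⟨h3w.1, fun h81 ↦ h3w.2 ?_⟩) h5'
  · exact (pow_dvd_pow 2 (by norm_num : 5 ≤ 6)).trans h64
  · exact (pow_dvd_pow 3 (by norm_num : 3 ≤ 4)).trans h81

end Summit.BirchSwinnertonDyer.BirchSwinnertonDyer.Cruxes.EulerHalfNotRamNoInertSetAtFive.LevelLoweringCut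

end
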